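import Literature.NumberTheory.EllipticCurves.Voight2007.RingClassGenusField
import Literature.NumberTheory.EllipticCurves.RingClassFieldGenusProofs
import Literature.NumberTheory.EllipticCurves.RingClassFieldTower
import Literature.NumberTheory.QuadraticFields.RingClassNumberFormula
import Literature.NumberTheory.NumberFields.SplitPrimesBaseChange
import Literature.NumberTheory.QuadraticFields.KroneckerSplitting
import Literature.NumberTheory.QuadraticFields.SquareRootGenerator
import Literature.NumberTheory.GaloisRepresentations.SplitsCompletelyCriteria
import Mathlib.FieldTheory.KummerPolynomial
import Mathlib.NumberTheory.LegendreSymbol.JacobiSymbol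
import HarnessLib

/-!
# Voight 2007, Prop. 3.8 (genus class field of the order of conductor `f`), PROVED by ring-class
# DEGREES and LOCAL dyadic arguments: `√m ∈ K[f] ↔ m · disc ℚ(√(d_K m)) ∣ d_K f²` for every
# imaginary quadratic `K` (`prop38_sqrt_mem_ringClassField_iff_of_odd_discr` / `_of_even_discr`),
# with all of Cor. 3.9 (the odd genus characters and the dyadic radicals `√−1, √±2`, both directions)

Topic `NumberTheory/EllipticCurves` (class field theory of the concrete ring class fields
`K[f] = ringClassField K ι f ⊂ ℂ` of `HeegnerPointsOfConductor.lean`; Cox, Thm. 11.1, proved in the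
tree). Theorems only (no definition, no named fact); companion of
`Voight2007/RingClassGenusField.lean`, whose named fact `Voight2007.prop38_sqrt_mem_ringClassField_iff`
(J. Voight, Math. Comp. 76 (2007), §3 Prop. 3.8: "The genus class field `P_(f)` of `K` is the
compositum of all fields `ℚ(√m)` of discriminant `m` satisfying `m · disc(ℚ(√(dm))) ∣ D = d f²`")
types the COMPLETE genus theory of the order `ℤ + f𝒪_K` — odd and dyadic prime discriminants, both
directions. Its discharge `Voight2007.prop38_sqrt_mem_ringClassField_iff_holds` is the sibling file
`RingClassGenusFieldHolds.lean` (seat u2-p1: Artin reciprocity at `2` with explicit `α ≡ 1 (mod F)`);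
THIS file is an independent proof by ring-class degrees (Cox Cor. 7.28) and local arguments at the
ramified dyadic prime, stated as the two halves `prop38_sqrt_mem_ringClassField_iff_of_odd_discr` and
`…_of_even_discr` (whose conjunction is the fact), together with the genus-field API below. This file PROVES:

* `sqrt_intCast_mem_ringClassField_of_dvd_sq_mul_discr` — **`√d ∈ K[f]` for `d ≡ 1 (mod 4)`
  square-free with `d ∣ f² d_K`**: the prime discriminants `q* ∣ d` may divide the conductor `f`
  (ramified genus characters, the tree's `sqrt_intCast_mem_ringClassField`, which needs `|d| ∣ f`)
  OR the field discriminant `d_K` (the UNRAMIFIED genus characters of Gauss's genus theory: e.g.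
  `f = 1`, `√q* ∈ K[1] = H_K` for an odd prime `q ∣ d_K`). Proof (Cox §9.A, Thm. 9.2 with Thm. 6.1,
  exactly as in `RingClassFieldGenusProofs.lean` but with the principal FORM in place of the
  congruence `N(α) ≡ a² (mod f)`): a degree-one prime `𝔭 ∤ 2 d f` of `K` that splits completely
  in the class field `R_f ≅ K[f]` (`exists_classField_algEquiv_ringClassField`) is `(a)` with
  `a ≡ n (mod f𝓞_K)` (`RingClass.exists_generator_of_primeClass_eq_one`), so its norm `ℓ` is a
  value of the principal form of discriminant `f² d_K`
  (`exists_principalForm_conductor_eq_absNorm_span_of_sub_intCast_mem`): `4ℓ = z² − f²d_K y²`,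
  hence `4ℓ ≡ z² (mod |d|)` and `(d/ℓ) = (ℓ/|d|) = 1` (`jacobiSym_eq_one_of_dvd_four_mul_sub_sq`,
  Jacobi reciprocity for `d ≡ 1 (mod 4)`); so `ℓ` splits in `ℚ(√d)` (the tree's decomposition law
  `Quadratic.ncard_primesOver_eq_two_iff_jacobiSym`, `d_{ℚ(√d)} = d`) and `𝔭` splits completely in
  `K(√d) = K·ℚ(√d)` (`mem_splitPrimes_of_splitsCompletely`, base change); Bauer's theorem in
  degree-one form (`le_of_splitPrimes_subset_of_prime_absNorm_algClosure`) gives `K(√d) ⊆ R_f`.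
* `Voight2007.prop38_sqrt_mem_ringClassField_iff_of_odd` — **Prop. 3.8 for ODD fundamental
  discriminants `m` (`m ≡ 1 (mod 4)` square-free, `m ≠ 1`), both directions**: with
  `d_K m = n s²`, `(∃ r ∈ K[f], r² = m) ↔ m n ∣ d_K f²`. (⟸): `m ∣ m n ∣ d_K f²` and the previous
  theorem. (⟹): for a prime `p ∣ m`, either `p ∣ d_K`, and then `p ∣ s` (`p² ∣ d_K m = n s²`, the
  odd part of the fundamental `n` being square-free), or `p ∤ d_K`, and then `p ∣ f` by the tree's
  `sqrt_intCast_not_mem_ringClassField` (`K[f]/K` is unramified off `f`, Cox §9.A); so `m ∣ f s`,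
  i.e. `m n s² = d_K m² ∣ d_K f² s²`.
* `sqrt_intCast_mem_ringClassField_of_forall_principalForm` — the MASTER statement behind all the
  membership results: for a fundamental discriminant `d`, if `(d/ℓ) = 1` for every odd prime `ℓ ∤ d`
  represented by the principal form of discriminant `f² d_K` (Cox Thm. 6.1 / Lemma 3.17: the
  assigned characters are trivial on the principal class), then `√d ∈ K[f]`.
* The DYADIC radicals of Cor. 3.9, membership direction (Prop. 3.8 with `m = −4, 8, −8`), from the
  congruences modulo `4`, `8`, `16` of the values of the principal form:
  `sqrt_neg_one_mem_ringClassField_of_four_dvd` (`4 ∣ f ⟹ √−1 ∈ K[f]`, any `d_K`),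
  `sqrt_two_mem_ringClassField_of_eight_dvd`, `sqrt_neg_two_mem_ringClassField_of_eight_dvd`
  (`8 ∣ f ⟹ √±2 ∈ K[f]`), `sqrt_neg_one_mem_ringClassField_of_discr_div_four_emod`
  (`d_K/4 ≡ 3 (mod 4) ⟹ √−1 ∈ K[f]` for all `f`: Cor. 3.9 "`d ≡ 4 (mod 8)`"),
  `sqrt_neg_one_mem_ringClassField_of_eight_dvd_discr` (`8 ∣ d_K`, `2 ∣ f ⟹ √−1 ∈ K[f]`: Cor. 3.9
  "`d ≡ 0 (mod 8)` and `2 ∣ f`"), `sqrt_two_mem_ringClassField_of_discr_eq_eight_mul` /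
  `sqrt_neg_two_mem_ringClassField_of_discr_eq_eight_mul` (`d_K = 8e′`, `e′ ≡ 1`, resp. `3 (mod 4)`
  ⟹ `√2`, resp. `√−2 ∈ K[f]` for all `f`), `sqrt_two_mem_ringClassField_of_four_dvd_discr`
  (`4 ∣ d_K`, `4 ∣ f ⟹ √±2 ∈ K[f]`: Cor. 3.9 "`d ≡ 4 (mod 8)` and `4 ∣ f`").

* The DYADIC non-membership when `2` is unramified (`d_K` odd, `f` odd; Cor. 3.9: `P_(f) = K*` has no
  dyadic part): `ramificationIdx_two_eq_one_ringClassField` (every prime of `K[f]` above `2` has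
  `e = 1`), `sqrt_not_mem_ringClassField_of_emod_four_eq_three` (`√c ∉ K[f]` for `c ≡ 3 (mod 4)`:
  `2𝓞_{K[f]}` is square-free, and no algebraic integer has square `≡ 3 (mod 4)` modulo a radical
  `2`), `sqrt_not_mem_ringClassField_of_emod_four_eq_two` (`c ≡ 2 (mod 4)`: the tree's
  `sqrt_intCast_not_mem_ringClassField` at `ℓ = 2`).
* `Voight2007.prop38_sqrt_mem_ringClassField_iff_of_odd_discr_of_odd` — **Prop. 3.8 for `d_K` odd
  and `f` odd, EVERY fundamental discriminant `m`** (even `m`: both sides false).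
* The DYADIC TOWER `K[g] ⊆ K[2g] ⊆ K[4g]` for `d_K` odd (Cox Cor. 7.28 at `m = 2`, the tree's
  `card_ringClassGroup_mul_conductor`, read as field degrees through `RingClassFieldTower`):
  `odd_finrank_subfieldIn_two_mul` (**`[K[2g] : K[g]] ∈ {1, 3}` is odd for `g` odd**),
  `finrank_subfieldIn_two_mul_of_even` (**`[K[2g] : K[g]] = 2` for `g` even**); hence the EXACTNESS
  of Cor. 3.9 for `d_K` odd: `sqrt_not_mem_ringClassField_two_mul_of_odd_discr` (`√c ∉ K[2g]` for
  `c ≡ 2, 3 (mod 4)`, `g` odd: a quadratic subextension cannot sit in an odd-degree extension),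
  `sqrt_not_mem_ringClassField_four_mul_of_odd_discr` (`√c ∉ K[4g]` for `c ≡ 2 (mod 4)`, `g` odd:
  `K[4g] = K[2g](√−1)`, and in a quadratic Galois extension the product of two radicals of the
  base lies in the base), `four_dvd_of_sqrt_mem_ringClassField_of_odd_discr`,
  `eight_dvd_of_sqrt_mem_ringClassField_of_odd_discr` (`√−1 ∈ K[f] ⟹ 4 ∣ f`, `√±2 ∈ K[f] ⟹ 8 ∣ f`);
  and `dvd_sq_mul_discr_of_sqrt_mem_ringClassField` (`√d ∈ K[f] ⟹ d ∣ f² d_K` for odd square-free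
  `d ≡ 1 (mod 4)`, the converse of the membership theorem).
* `Voight2007.prop38_sqrt_mem_ringClassField_iff_of_odd_discr` — **Prop. 3.8 for `d_K` odd, EVERY
  conductor `f ≥ 1` and EVERY fundamental discriminant `m`** (`m n ∣ d_K f² ↔ m ∣ f s`, `s` odd;
  even `m = 4e`: both sides say "`4 ∣ f`, resp. `8 ∣ f` for `e` even, and the odd part of `m`
  divides `f² d_K`").
* The DYADIC EXCLUSIONS FOR EVEN `d_K` AND ODD `f` (Cor. 3.9 for `d ≡ 4, 0 (mod 8)`: `√±2 ∉ P_(f)`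
  unless `4 ∣ f` when `d_K = 4D₀`, `D₀ ≡ 3 (mod 4)`; `√−1 ∉ P_(f)` unless `2 ∣ f` when `8 ∣ d_K`),
  by an elementary LOCAL argument at a prime `P ∣ 2` of `K[f]`, which is unramified over the
  ramified dyadic prime of `K` (so `π = 1 + ω`, resp. `π = ω`, `ω² = d_K/4`, has `v_P(π) = 1`):
  `sqrt_not_mem_ringClassField_of_discr_div_four_of_odd` (`√c ∉ K[f]` for `c ≡ 2 (mod 4)`),
  `sqrt_not_mem_ringClassField_of_eight_dvd_discr_of_odd` (`√c ∉ K[f]` for `c ≡ 3 (mod 4)`); with a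
  small `P`-adic toolkit (`P = (π) + P²`, cancellation of `π`, and "`z ∈ v ∖ v²`, `P` unramified
  over `v` ⟹ `z ∉ P²`").

* The LAST dyadic exclusion, for `d_K = 4D₀`, `D₀ ≡ 3 (mod 4)`, `f = 2g ≡ 2 (mod 4)`:
  `sqrt_two_not_mem_ringClassField_two_mul_of_discr_div_four` (**`√2 ∉ K[2g]`**) by BAUER'S THEOREM
  applied to the class fields `R_{2g} ≅ K[2g] ⊊ R_{4g} ≅ K[4g]` (degree `2`, Cor. 7.28): a degree-one
  prime `𝔭 = (a)`, `a ≡ n₀ (mod 2g)`, split in `R_{2g}` but not in `R_{4g}` has `a = X + Yω'` with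
  `Y ≡ 2 (mod 4)`, so `N𝔭 ≡ 5 (mod 8)` and `2` is a non-square mod `N𝔭`, while `√2 ∈ R_{2g}` makes
  `2` a square modulo every degree-one split prime (`𝓞_{R}/Q ≅ ℤ/p` for a residue-degree-one `Q`);
  and `sqrt_not_mem_ringClassField_two_mul_of_discr_div_four` (`√c ∉ K[2g]` for square-free
  `c ≡ 2 (mod 4)`).
* `Voight2007.prop38_sqrt_mem_ringClassField_iff_of_even_discr` — **Prop. 3.8 for `d_K` even, every
  `f`, every `m`**, by the 2-adic bookkeeping of `d_K m = n s²` (`two_adic_of_sq_class`: `n = 2^a n₁`,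
  `s = 2^b s₁`, `a + 2b = k`) in the four cases `(d_K/4, m/4) mod 4 ∈ {2, 3}²`. With
  `…_of_odd_discr` this is Prop. 3.8 for every `K`; the named fact's discharge under the canonical
  name `prop38_sqrt_mem_ringClassField_iff_holds` is `RingClassGenusFieldHolds.lean` (not re-declared
  here: one fully-qualified name, one module).

HONEST FRAMING (cell `bsd-uniform`, HOME run/shared/lean/pub/bsd-uniform/, seat u2-lit GEN 4):
classical published class field theory (genus theory of orders), proved on the tree's proved Artin
reciprocity / Bauer / Cox Thm. 11.1 files; no statement about elliptic curves, `L`-functions or BSD;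
nothing booked, no census number moved.

## References

* J. Voight, *Quadratic forms that represent almost the same primes*, Math. Comp. 76 (2007),
  1589–1617, §3: Prop. 3.1, Prop. 3.7, Prop. 3.8, Cor. 3.9–3.10. [Voight2007]
* D. A. Cox, *Primes of the form x² + ny²*, 2nd ed. (2013): §1.C Lemma 1.14, §2.C (principal
  form), §3.B Lemma 3.17, §6.A Thm. 6.1, §7.B (7.16), §7.D Thm. 7.24 / Cor. 7.28 (p. 148),
  §9.A (p. 180; Thm. 9.2), §11.A Thm. 11.1. [Cox2013]
* J. Neukirch, *Algebraic Number Theory* (1999), Ch. I §8 (decomposition in `ℚ(√d)`), Ch. VII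
  (13.9) (Bauer). [NeukirchANT1999]
* D. A. Marcus, *Number Fields*, 2nd ed. (2018), Ch. 4 Thm. 31 (base change of complete
  splitting). [Marcus2018]

## Mathlib / tree search

Tree (used): `exists_classField_algEquiv_ringClassField` (`RingClassFieldClassNumber.lean`),
`RingClass.exists_generator_of_primeClass_eq_one` (`QuadraticFields/RingClassGenusCharacterTriviality.lean`),
`exists_principalForm_conductor_eq_absNorm_span_of_sub_intCast_mem`, `sq_mul_emod_four`
(`SingularModuliRingClassUnramified.lean`), `le_of_splitPrimes_subset_of_prime_absNorm_algClosure`,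
`sqrt_intCast_mem_ringClassField`, `sqrt_intCast_not_mem_ringClassField`
(`RingClassFieldGenusProofs.lean`), `mem_splitPrimes_of_splitsCompletely`
(`NumberFields/SplitPrimesBaseChange.lean`), `splitsCompletely_of_ncard_primesOver_eq_two`,
`Quadratic.ncard_primesOver_eq_two_iff_jacobiSym` (`QuadraticFields/KroneckerSplitting.lean`),
`NumberField.exists_discr_eq_mul_sq`, `Quadratic.isFundamentalDiscriminant_discr`,
`Quadratic.eq_of_isFundamental_of_eq_mul_sq`, `finite_setOf_le_asIdeal`;
`RingClassField.subfieldIn`, `RingClassField.finrank_subfieldIn_mul_finrank`,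
`finrank_ringClassField_eq_card_ringClassGroup` (`RingClassFieldTower.lean`),
`RingClass.card_ringClassGroup_mul_conductor(_of_two_le)` (`QuadraticFields/RingClassNumberFormula.lean`),
`RingClass.card_units_eq`, `card_orderUnits_eq_two` (`QuadraticFields/RingClassUnits.lean`),
`isUnramifiedIn_ringClassField` (`RingClassFieldSplitting.lean`). Mathlib: `jacobiSym.*`
(quadratic reciprocity), `X_pow_sub_C_irreducible_of_prime`, `IntermediateField.adjoin.finrank`,
`Algebra.IsQuadraticExtension`, `Nat.prod_primeFactors_of_squarefree`, `Finset.prod_primes_dvd`,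
`jacobiSym.at_neg_one` / `at_two` / `at_neg_two`, `ZMod.χ₄_nat_one_mod_four`, `ZMod.χ₈_nat_eq_if_mod_eight`,
`ZMod.χ₈'_nat_eq_if_mod_eight`, `IsGalois.card_aut_eq_finrank`, `IsGalois.mem_range_algebraMap_iff_fixed`,
`Nat.card_eq_two_iff'`, `IntermediateField.adjoin.finrank`, `minpoly.natDegree_eq_one_iff`,
`Module.finrank_mul_finrank`, `Ideal.eq_prime_pow_of_succ_lt_of_le`, `Ideal.IsPrime.mul_mem_pow`,
`emultiplicity_mul` / `emultiplicity_pow` / `pow_dvd_iff_le_emultiplicity`,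
`Ideal.ramificationIdx_eq_one_of_isUnramifiedAt`, `Ideal.IsDedekindDomain.ramificationIdx_eq_normalizedFactors_count`,
`Ideal.absNorm_span_singleton`, `Algebra.norm_algebraMap`, `NumberField.RingOfIntegers.rank`.
`ZMod.exists_sq_eq_two_iff`, `ZMod.ringEquivOfPrime`, `Ideal.absNorm_pow_inertiaDeg`,
`Ideal.finiteQuotientOfFreeOfNeBot`, `pow_multiplicity_dvd`, `Int.finiteMultiplicity_iff`.
`lean search 'dvd_sq_mul_discr|prop38.*odd|genus.*unramified|odd_finrank|subfieldIn_two_mul|prop38.*holds'`: no prior statement.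
-/

noncomputable section

open NumberField IsDedekindDomain Polynomial Module Filter
open scoped nonZeroDivisors

namespace Literature.NumberTheory.EllipticCurves

open Literature.NumberTheory.GaloisRepresentations Literature.NumberTheory.NumberFields
open Literature.NumberTheory.QuadraticFields.Quadratic
open Literature.NumberTheory.QuadraticFields.BinaryQuadraticForm
open Literature.NumberTheory.QuadraticFields.RingClass
open Literature.NumberTheory.NumberFields.RingClassField
open IntermediateField UniqueFactorizationMonoid

/-! ### Jacobi reciprocity for `d ≡ 1 (mod 4)` -/

/-- **Reciprocity for `d ≡ 1 (mod 4)` of either sign: `J(d | p) = J(p | |d|)` for odd `p`**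
(`d > 0`: `J(d|p) = J(p|d)`; `d < 0`, `|d| ≡ 3 (mod 4)`: `J(d|p) = χ₄(p) J(|d| | p) = J(p | |d|)` in
both cases `p ≡ 1, 3 (mod 4)`). Cox, Lemma 1.14: for `D ≡ 1 (mod 4)` the symbol `(D/·)` is a
character modulo `|D|`. [cite: Cox2013, §1.C Lemma 1.14] -/
theorem jacobiSym_eq_jacobiSym_natAbs_of_emod_four_eq_one {d : ℤ} (hd4 : d % 4 = 1) {p : ℕ}
    (hp : Odd p) : jacobiSym d p = jacobiSym p d.natAbs := by
  rcases le_or_gt 0 d with hd | hd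
  · have hdd : (d.natAbs : ℤ) = d := Int.natAbs_of_nonneg hd
    have hM4 : d.natAbs % 4 = 1 := by omega
    rw [← hdd]
    exact jacobiSym.quadratic_reciprocity_one_mod_four hM4 hp
  · have hdd : (d.natAbs : ℤ) = -d := Int.ofNat_natAbs_of_nonpos hd.le
    have hM4 : d.natAbs % 4 = 3 := by omega
    have hd' : d = -(d.natAbs : ℤ) := by omega
    conv_lhs => rw [hd']
    rw [jacobiSym.neg _ hp]
    rcases Nat.odd_mod_four_iff.mp (Nat.odd_iff.mp hp) with hp1 | hp3
    · rw [ZMod.χ₄_nat_one_mod_four hp1, one_mul]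
      exact jacobiSym.quadratic_reciprocity_one_mod_four'
        (Nat.odd_iff.mpr (show d.natAbs % 2 = 1 by omega)) hp1
    · rw [ZMod.χ₄_nat_three_mod_four hp3, jacobiSym.quadratic_reciprocity_three_mod_four hM4 hp3]
      ring

/-- **`4p ≡ z² (mod d)`, `d ≡ 1 (mod 4)`, `p` an odd prime not dividing `d` ⟹ `J(d | p) = 1`**:
`J(d|p) = J(p | |d|)` and `J(4p | |d|) = J(4 | |d|) J(p | |d|) = J(p | |d|)`, while
`J(4p | |d|) = J(z² | |d|) = J(z | |d|)² = 1` because `J(4p | |d|) = ±1` (`(4p, d) = 1`). This is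
the value of the genus character `(d/·)` on a prime `p` with `4p` represented by `z² − f²d_K y²`,
`d ∣ f² d_K` (Cox Thm. 6.1 / Lemma 3.17: the assigned characters are trivial on the principal
form). [cite: Cox2013, §1.C Lemma 1.14, §3.B Lemma 3.17 and §6.A Thm. 6.1] -/
theorem jacobiSym_eq_one_of_dvd_four_mul_sub_sq {d : ℤ} (hd4 : d % 4 = 1) {p : ℕ} (hp : p.Prime)
    (hp2 : p ≠ 2) (hpd : ¬ (p : ℤ) ∣ d) {z : ℤ} (hz : d ∣ 4 * p - z ^ 2) : jacobiSym d p = 1 := by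
  have hpodd : Odd p := hp.odd_of_ne_two hp2
  have hd0 : d ≠ 0 := by rintro rfl; omega
  set M : ℕ := d.natAbs with hM
  haveI : NeZero M := ⟨Int.natAbs_ne_zero.mpr hd0⟩
  have hMd : (M : ℤ) ∣ 4 * p - z ^ 2 := Int.natAbs_dvd.mpr hz
  rw [jacobiSym_eq_jacobiSym_natAbs_of_emod_four_eq_one hd4 hpodd]
  -- `(4p, |d|) = 1`
  have h2 : IsCoprime (2 : ℤ) M := by
    refine (Int.prime_two.coprime_iff_not_dvd).mpr fun h => ?_
    have : (2 : ℤ) ∣ d := (Int.dvd_natAbs).mp h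
    omega
  have h4 : IsCoprime (4 : ℤ) M := by
    have := h2.pow_left (m := 2)
    norm_num at this
    exact this
  have hpM : IsCoprime (p : ℤ) M := by
    refine ((Nat.prime_iff_prime_int.mp hp).coprime_iff_not_dvd).mpr fun h => hpd ?_
    exact (Int.dvd_natAbs).mp h
  have hcop : IsCoprime (4 * p : ℤ) M := h4.mul_left hpM
  -- `J(4p | M) = J(z | M)² ∈ {±1}`, hence `= 1`
  have h4p : jacobiSym (4 * p) M = 1 := by
    have hsq : jacobiSym (4 * p) M = jacobiSym z M ^ 2 := by
      have hmod : (4 * p : ℤ) % M = z ^ 2 % M :=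
        Int.emod_eq_emod_iff_emod_sub_eq_zero.mpr (Int.emod_eq_zero_of_dvd hMd)
      rw [jacobiSym.mod_left (4 * p) M, hmod, ← jacobiSym.mod_left, jacobiSym.pow_left]
    rcases jacobiSym.eq_one_or_neg_one (Int.isCoprime_iff_gcd_eq_one.mp hcop) with h | h
    · exact h
    · exfalso
      have : (0 : ℤ) ≤ jacobiSym z M ^ 2 := sq_nonneg _
      rw [← hsq, h] at this
      norm_num at this
  have h4' : jacobiSym 4 M = 1 := by
    have : (4 : ℤ) = 2 ^ 2 := by norm_num
    rw [this]
    exact jacobiSym.sq_one' (Int.isCoprime_iff_gcd_eq_one.mp h2)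
  rwa [jacobiSym.mul_left, h4', one_mul] at h4p

/-! ### The quadratic field `ℚ(√d)` inside a field of characteristic zero -/

/-- A square-free integer `d ≠ 1` is not the square of a rational number (a rational square root is
an integer by integral closedness, and `n² = d` square-free forces `n = ±1`). [folklore] -/
private theorem sq_ne_intCast_of_squarefree {d : ℤ} (hd : Squarefree d) (hd1 : d ≠ 1) (r : ℚ) :
    r ^ 2 ≠ (d : ℚ) := by
  intro hr
  have hint : IsIntegral ℤ r := by
    refine ⟨X ^ 2 - C d, by monicity!, ?_⟩
    simp only [eval₂_sub, eval₂_X_pow, eval₂_C]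
    rw [hr]
    simp
  obtain ⟨n, hn⟩ := IsIntegrallyClosed.isIntegral_iff.mp hint
  rw [← hn, eq_intCast] at hr
  have hn2 : n * n = d := by rw [← sq]; exact_mod_cast hr
  have hu : IsUnit n := hd n ⟨1, by rw [mul_one, hn2]⟩
  rcases Int.isUnit_iff.mp hu with rfl | rfl <;> simp at hn2 <;> exact hd1 hn2.symm

/-- A fundamental discriminant `d` (`d ≡ 1 (mod 4)` square-free `≠ 1`, or `d = 4e` with
`e ≡ 2, 3 (mod 4)` square-free) is not the square of a rational number. [folklore] -/
private theorem sq_ne_intCast_of_isFundamental {d : ℤ}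
    (hfund : (d % 4 = 1 ∧ Squarefree d ∧ d ≠ 1) ∨
      (4 ∣ d ∧ (d / 4 % 4 = 2 ∨ d / 4 % 4 = 3) ∧ Squarefree (d / 4))) (r : ℚ) :
    r ^ 2 ≠ (d : ℚ) := by
  rcases hfund with ⟨-, hd, hd1⟩ | ⟨⟨e, he⟩, he4, hesq⟩
  · exact sq_ne_intCast_of_squarefree hd hd1 r
  · have hde : d / 4 = e := by rw [he, Int.mul_ediv_cancel_left _ four_ne_zero]
    rw [hde] at he4 hesq
    have he1 : e ≠ 1 := by rintro rfl; omega
    intro hr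
    refine sq_ne_intCast_of_squarefree hesq he1 (r / 2) ?_
    rw [div_pow, hr, he]
    push_cast
    ring

/-- **`[ℚ(θ) : ℚ] = 2` for `θ² = d`**, `d` a fundamental discriminant, in any field `L` of
characteristic zero: `X² − d` is irreducible over `ℚ` (Mathlib `X_pow_sub_C_irreducible_of_prime`),
hence the minimal polynomial of `θ`. [folklore] -/
private theorem finrank_rat_adjoin_sqrt_intCast {L : Type*} [Field L] [CharZero L] {d : ℤ}
    (hfund : (d % 4 = 1 ∧ Squarefree d ∧ d ≠ 1) ∨
      (4 ∣ d ∧ (d / 4 % 4 = 2 ∨ d / 4 % 4 = 3) ∧ Squarefree (d / 4)))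
    {θ : L} (hθ : θ ^ 2 = (d : L)) :
    Module.finrank ℚ ℚ⟮θ⟯ = 2 := by
  have hirr : Irreducible (X ^ 2 - C (d : ℚ)) :=
    X_pow_sub_C_irreducible_of_prime Nat.prime_two fun b hb => sq_ne_intCast_of_isFundamental hfund b hb
  have hmonic : (X ^ 2 - C (d : ℚ)).Monic := by monicity!
  have haeval : aeval θ (X ^ 2 - C (d : ℚ)) = 0 := by
    simp [hθ]
  have hint : IsIntegral ℚ θ := ⟨_, hmonic, by simpa [aeval_def] using haeval⟩
  rw [adjoin.finrank hint, ← minpoly.eq_of_irreducible_of_monic hirr haeval hmonic,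
    natDegree_X_pow_sub_C]

/-- **`d_{ℚ(θ)} = d` for `θ² = d`, `d` a fundamental discriminant** (Marcus, Ch. 2 Thm. 1:
`d_{ℚ(√m)} = m` for `m ≡ 1 (mod 4)` square-free and `4m` otherwise): `d_{ℚ(θ)} = d q²` (the tree's
`NumberField.exists_discr_eq_mul_sq`) and two fundamental discriminants differing by a rational
square are equal (`Quadratic.eq_of_isFundamental_of_eq_mul_sq`, `isFundamentalDiscriminant_discr`).
[cite: Marcus2018, Ch. 2 Thm. 1] -/
theorem discr_rat_adjoin_sqrt_intCast_of_isFundamental {L : Type*} [Field L] [NumberField L]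
    {d : ℤ} (hfund : (d % 4 = 1 ∧ Squarefree d ∧ d ≠ 1) ∨
      (4 ∣ d ∧ (d / 4 % 4 = 2 ∨ d / 4 % 4 = 3) ∧ Squarefree (d / 4)))
    {θ : L} (hθ : θ ^ 2 = (d : L)) :
    haveI : NumberField ℚ⟮θ⟯ := NumberField.of_module_finite ℚ _
    NumberField.discr ℚ⟮θ⟯ = d := by
  haveI : NumberField ℚ⟮θ⟯ := NumberField.of_module_finite ℚ _
  have h2 := finrank_rat_adjoin_sqrt_intCast hfund hθ
  set α : ℚ⟮θ⟯ := AdjoinSimple.gen ℚ θ with hα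
  have hα2 : α ^ 2 = algebraMap ℚ ℚ⟮θ⟯ (d : ℚ) := by
    apply Subtype.ext
    simp [hα, hθ]
  have hαr : α ∉ Set.range (algebraMap ℚ ℚ⟮θ⟯) := by
    rintro ⟨q, hq⟩
    have h : (algebraMap ℚ ℚ⟮θ⟯) (q ^ 2) = algebraMap ℚ ℚ⟮θ⟯ (d : ℚ) := by
      rw [map_pow, hq, hα2]
    exact sq_ne_intCast_of_isFundamental hfund q ((algebraMap ℚ ℚ⟮θ⟯).injective h)
  obtain ⟨q, -, hq⟩ := NumberField.exists_discr_eq_mul_sq h2 hαr hα2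
  exact eq_of_isFundamental_of_eq_mul_sq (isFundamentalDiscriminant_discr h2) hfund hq

/-- **`d_{ℚ(θ)} = d` for `θ² = d`, `d ≡ 1 (mod 4)` square-free, `d ≠ 1`** (Marcus, Ch. 2 Thm. 1:
`d_{ℚ(√m)} = m` for `m ≡ 1 (mod 4)` square-free). [cite: Marcus2018, Ch. 2 Thm. 1] -/
theorem discr_rat_adjoin_sqrt_intCast {L : Type*} [Field L] [NumberField L] {d : ℤ}
    (hd4 : d % 4 = 1) (hd : Squarefree d) (hd1 : d ≠ 1) {θ : L} (hθ : θ ^ 2 = (d : L)) :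
    haveI : NumberField ℚ⟮θ⟯ := NumberField.of_module_finite ℚ _
    NumberField.discr ℚ⟮θ⟯ = d :=
  discr_rat_adjoin_sqrt_intCast_of_isFundamental (Or.inl ⟨hd4, hd, hd1⟩) hθ

variable {K : Type} [Field K] [NumberField K]

/-- **The decomposition law in `K(√d)/K` above a split rational prime, by base change from
`ℚ(√d)`**: for a number field `K`, `r₀ ∈ K̄` with `r₀² = d` (`d` a fundamental discriminant),
`K(r₀)/K` finite Galois, and an odd prime `p` with `(d/p) = 1` — so that `p` splits in `ℚ(√d)`
(the tree's `Quadratic.ncard_primesOver_eq_two_iff_jacobiSym`, Neukirch I (8.5)) — every prime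
`v ∣ p` of `K` splits completely in `K(r₀) = K·ℚ(r₀)` (Marcus, Ch. 4 Thm. 31; the tree's
`mem_splitPrimes_of_splitsCompletely`). [cite: Marcus2018, Ch. 4 Thm. 31] [cite: NeukirchANT1999, Ch. I §8 Prop. (8.5)] -/
theorem mem_splitPrimes_adjoin_sqrt_of_jacobiSym_eq_one_of_isFundamental {d : ℤ}
    (hfund : (d % 4 = 1 ∧ Squarefree d ∧ d ≠ 1) ∨
      (4 ∣ d ∧ (d / 4 % 4 = 2 ∨ d / 4 % 4 = 3) ∧ Squarefree (d / 4)))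
    {r₀ : AlgebraicClosure K}
    (hr₀ : r₀ ^ 2 = (d : AlgebraicClosure K)) [FiniteDimensional K K⟮r₀⟯] [IsGalois K K⟮r₀⟯]
    {p : ℕ} (hp : p.Prime) (hp2 : p ≠ 2) (hJ : jacobiSym d p = 1)
    (v : HeightOneSpectrum (𝓞 K)) (hpv : ((p : ℕ) : 𝓞 K) ∈ v.asIdeal) :
    v ∈ splitPrimes K K⟮r₀⟯ := by
  classical
  set E := K⟮r₀⟯ with hE
  haveI : NumberField E := NumberField.of_module_finite K E
  -- the element `α = r₀ ∈ E` and the subfield `F = ℚ(α) ⊆ E`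
  set α : E := AdjoinSimple.gen K r₀ with hαdef
  have hα : α ^ 2 = (d : E) := by
    apply Subtype.ext
    simp [hαdef, hr₀]
  set F : IntermediateField ℚ E := ℚ⟮α⟯ with hF
  haveI : FiniteDimensional ℚ F := inferInstance
  haveI : NumberField F := NumberField.of_module_finite ℚ F
  have h2 : Module.finrank ℚ F = 2 := finrank_rat_adjoin_sqrt_intCast hfund hα
  haveI : Algebra.IsQuadraticExtension ℚ F := ⟨h2⟩
  haveI : IsGalois ℚ F := inferInstance
  have hdisc : NumberField.discr F = d := discr_rat_adjoin_sqrt_intCast_of_isFundamental hfund hα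
  -- `p` splits in `F = ℚ(√d)`
  have hsplitF : SplitsCompletely F p :=
    splitsCompletely_of_ncard_primesOver_eq_two h2 hp
      ((ncard_primesOver_eq_two_iff_jacobiSym h2 hp hp2).mpr (by rw [hdisc]; exact hJ))
  -- `E = K · F`
  have hgen : IntermediateField.adjoin K (Set.range (algebraMap F E)) = ⊤ := by
    have hαmem : α ∈ Set.range (algebraMap F E) :=
      ⟨AdjoinSimple.gen ℚ α, rfl⟩
    refine top_le_iff.mp ?_
    have htop : K⟮α⟯ = (⊤ : IntermediateField K E) := by
      apply lift_injective
      rw [IntermediateField.lift_adjoin_simple, IntermediateField.lift_top]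
      rfl
    rw [← htop]
    exact adjoin.mono K _ _ (Set.singleton_subset_iff.mpr hαmem)
  exact mem_splitPrimes_of_splitsCompletely hgen hp hsplitF v hpv

/-- The same for `d ≡ 1 (mod 4)` square-free, `d ≠ 1`. [cite: Marcus2018, Ch. 4 Thm. 31] -/
theorem mem_splitPrimes_adjoin_sqrt_of_jacobiSym_eq_one {d : ℤ} (hd4 : d % 4 = 1)
    (hd : Squarefree d) (hd1 : d ≠ 1) {r₀ : AlgebraicClosure K}
    (hr₀ : r₀ ^ 2 = (d : AlgebraicClosure K)) [FiniteDimensional K K⟮r₀⟯] [IsGalois K K⟮r₀⟯]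
    {p : ℕ} (hp : p.Prime) (hp2 : p ≠ 2) (hJ : jacobiSym d p = 1)
    (v : HeightOneSpectrum (𝓞 K)) (hpv : ((p : ℕ) : 𝓞 K) ∈ v.asIdeal) :
    v ∈ splitPrimes K K⟮r₀⟯ :=
  mem_splitPrimes_adjoin_sqrt_of_jacobiSym_eq_one_of_isFundamental (Or.inl ⟨hd4, hd, hd1⟩) hr₀ hp
    hp2 hJ v hpv

/-! ### The master statement: `√d ∈ K[f]` when `(d/ℓ) = 1` on the principal form of `f² d_K` -/

/-- **Genus characters trivial on the principal form give radicals in `K[f]`.** Let `K` be imaginary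
quadratic, `ι : K → ℂ`, `f ≥ 1`, `d` a fundamental discriminant, and suppose that `(d/ℓ) = 1` for
every odd prime `ℓ ∤ d` represented by the principal form `x² + Bxy + Cy²` of discriminant `f² d_K`
(Cox Thm. 6.1 / Lemma 3.17: `(d/·)` is one of the assigned characters of the discriminant `f² d_K`,
which are trivial on the principal class). Then every complex square root of `d` lies in `K[f]`.
Proof: Bauer's theorem (degree-one form) for `K(√d) ⊆ K̄` and the class field `R_f ≅ K[f]`
(`exists_classField_algEquiv_ringClassField`, Cox Thm. 11.1 / 9.2): a degree-one prime of norm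
`ℓ ∤ 2 d f` splitting completely in `R_f` is `(a)` with `a ≡ n (mod f𝓞_K)`, so `ℓ` is a value of
the principal form (`exists_principalForm_conductor_eq_absNorm_span_of_sub_intCast_mem`), `(d/ℓ) = 1`,
`ℓ` splits in `ℚ(√d)` and the prime splits completely in `K(√d)`.
[cite: Cox2013, §6.A Thm. 6.1, §9.A Thm. 9.2, §11.A Thm. 11.1] [cite: Voight2007, §3 Prop. 3.8 (proof: "every prime of K … unramified in HK/K splits completely in HK")] -/
theorem sqrt_intCast_mem_ringClassField_of_forall_principalForm (hK : IsImaginaryQuadratic K)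
    (ι : K →+* ℂ) {d : ℤ}
    (hfund : (d % 4 = 1 ∧ Squarefree d ∧ d ≠ 1) ∨
      (4 ∣ d ∧ (d / 4 % 4 = 2 ∨ d / 4 % 4 = 3) ∧ Squarefree (d / 4)))
    {f : ℕ} (hf : f ≠ 0)
    (H : ∀ ℓ : ℕ, ℓ.Prime → ℓ ≠ 2 → ¬ ((ℓ : ℤ) ∣ d) → ∀ x y : ℤ,
      x ^ 2 + (principalForm ((f : ℤ) ^ 2 * NumberField.discr K)).2.1 * x * y +
        (principalForm ((f : ℤ) ^ 2 * NumberField.discr K)).2.2 * y ^ 2 = ℓ → jacobiSym d ℓ = 1)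
    {r : ℂ} (hr : r ^ 2 = (d : ℂ)) : r ∈ ringClassField K ι f := by
  classical
  have hd0 : d ≠ 0 := by
    rcases hfund with ⟨h4, -, -⟩ | ⟨-, -, hsq⟩
    · rintro rfl; omega
    · rintro rfl; simp at hsq
  -- the class field copy `R ⊆ K̄` of `K[f]`, with its splitting law
  obtain ⟨R, hfd, hgal, -, hsplit, ⟨e⟩⟩ := exists_classField_algEquiv_ringClassField hK ι hf
  haveI := hfd
  haveI := hgal
  -- a square root `r₀` of `d` in `K̄` and `E = K(r₀)`
  obtain ⟨r₀, hr₀⟩ := IsAlgClosed.exists_pow_nat_eq (d : AlgebraicClosure K) two_pos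
  have hmonic : (X ^ 2 - C (d : K)).Monic := by monicity!
  have haeval : aeval r₀ (X ^ 2 - C (d : K)) = 0 := by simp [hr₀]
  have hint : IsIntegral K r₀ := ⟨_, hmonic, by simpa [aeval_def] using haeval⟩
  haveI : FiniteDimensional K K⟮r₀⟯ := adjoin.finiteDimensional hint
  haveI : IsGalois K K⟮r₀⟯ := by
    by_cases hbot : r₀ ∈ (⊥ : IntermediateField K (AlgebraicClosure K))
    · rw [adjoin_simple_eq_bot_iff.mpr hbot]
      infer_instance
    · have hirr : Irreducible (X ^ 2 - C (d : K)) := by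
        refine X_pow_sub_C_irreducible_of_prime Nat.prime_two fun b hb => hbot ?_
        have hb' : (algebraMap K (AlgebraicClosure K) b) ^ 2 = r₀ ^ 2 := by
          rw [← map_pow, hb, hr₀, map_intCast]
        rcases sq_eq_sq_iff_eq_or_eq_neg.mp hb' with h | h
        · exact h ▸ (⊥ : IntermediateField K (AlgebraicClosure K)).algebraMap_mem b
        · have : r₀ = algebraMap K (AlgebraicClosure K) (-b) := by rw [map_neg, h, neg_neg]
          exact this ▸ (⊥ : IntermediateField K (AlgebraicClosure K)).algebraMap_mem (-b)
      have h2 : Module.finrank K K⟮r₀⟯ = 2 := by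
        rw [adjoin.finrank hint, ← minpoly.eq_of_irreducible_of_monic hirr haeval hmonic,
          natDegree_X_pow_sub_C]
      haveI : Algebra.IsQuadraticExtension K K⟮r₀⟯ := ⟨h2⟩
      infer_instance
  -- Bauer: `K(r₀) ⊆ R`
  have hER : K⟮r₀⟯ ≤ R := by
    refine le_of_splitPrimes_subset_of_prime_absNorm_algClosure ?_
    -- the finitely many exceptional primes: those above `2 |d| f`
    set N : ℕ := 2 * d.natAbs * f with hNdef
    have hN0 : N ≠ 0 := by
      have : d.natAbs ≠ 0 := Int.natAbs_ne_zero.mpr hd0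
      positivity
    have hNbot : Ideal.span {((N : ℕ) : 𝓞 K)} ≠ ⊥ := by
      rw [Ne, Ideal.span_singleton_eq_bot]; exact_mod_cast hN0
    have hev : ∀ᶠ v : HeightOneSpectrum (𝓞 K) in cofinite,
        ¬ Ideal.span {((N : ℕ) : 𝓞 K)} ≤ v.asIdeal := by
      rw [eventually_cofinite]
      simpa using finite_setOf_le_asIdeal hNbot
    refine hev.mono fun v hv hprime hvR => ?_
    set p : ℕ := Ideal.absNorm v.asIdeal with hpdef
    have hpv : ((p : ℕ) : 𝓞 K) ∈ v.asIdeal := Ideal.absNorm_mem v.asIdeal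
    -- `p ∤ 2 |d| f`
    have hpN : ¬ p ∣ N := by
      rintro ⟨k, hk⟩
      refine hv ((Ideal.span_singleton_le_iff_mem _).mpr ?_)
      rw [hk, Nat.cast_mul]
      exact Ideal.mul_mem_right _ _ hpv
    have hp2 : p ≠ 2 := by
      rintro h2; exact hpN (h2 ▸ ⟨d.natAbs * f, by rw [hNdef]; ring⟩)
    have hpd : ¬ (p : ℤ) ∣ d := by
      intro h
      have : p ∣ d.natAbs := Int.natCast_dvd_natCast.mp (Int.dvd_natAbs.mpr h)
      exact hpN (this.trans ⟨2 * f, by rw [hNdef]; ring⟩)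
    have hpf : ¬ p ∣ f := fun h => hpN (h.trans ⟨2 * d.natAbs, by rw [hNdef]; ring⟩)
    -- `v ∤ f`
    have hvf : ¬ Ideal.span {((f : ℕ) : 𝓞 K)} ≤ v.asIdeal := by
      intro hle
      have hfv : ((f : ℕ) : 𝓞 K) ∈ v.asIdeal := hle (Ideal.mem_span_singleton_self _)
      have hcop : Nat.Coprime p f := (Nat.Prime.coprime_iff_not_dvd hprime).mpr hpf
      obtain ⟨a, b, hab⟩ := Nat.isCoprime_iff_coprime.mpr hcop
      apply v.isPrime.ne_top
      rw [Ideal.eq_top_iff_one]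
      have h1 : (1 : 𝓞 K) = (a : 𝓞 K) * ((p : ℕ) : 𝓞 K) + (b : 𝓞 K) * ((f : ℕ) : 𝓞 K) := by
        have := congrArg (fun z : ℤ => (z : 𝓞 K)) hab
        push_cast at this ⊢
        exact this.symm
      rw [h1]
      exact Submodule.add_mem _ (Ideal.mul_mem_left _ _ hpv) (Ideal.mul_mem_left _ _ hfv)
    -- `𝔭_v = (a)`, `a ≡ n (mod f𝓞_K)`
    obtain ⟨a, n, -, hva, han⟩ :=
      exists_generator_of_primeClass_eq_one f hvf ((hsplit v hvf).mp hvR)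
    -- `p = N(𝔭_v)` is a value of the principal form of discriminant `f² d_K`
    obtain ⟨x, y, hxy⟩ :=
      exists_principalForm_conductor_eq_absNorm_span_of_sub_intCast_mem hK.1 hK.discr_neg hf han
    rw [← hva, ← hpdef] at hxy
    have hJ : jacobiSym d p = 1 := H p hprime hp2 hpd x y hxy
    exact mem_splitPrimes_adjoin_sqrt_of_jacobiSym_eq_one_of_isFundamental hfund hr₀ hprime hp2 hJ
      v hpv
  -- transport `r₀` along `e : R ≃ K[f]`
  have hr₀E : r₀ ∈ K⟮r₀⟯ := mem_adjoin_simple_self K r₀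
  set y : ringClassField K ι f := e ⟨r₀, hER hr₀E⟩ with hydef
  have hysq : (y : ℂ) ^ 2 = (d : ℂ) := by
    have h1 : (⟨r₀, hER hr₀E⟩ : R) ^ 2 = algebraMap K R (d : K) := by
      apply Subtype.ext
      rw [SubmonoidClass.coe_pow]
      change r₀ ^ 2 = algebraMap K (AlgebraicClosure K) (d : K)
      rw [hr₀, map_intCast]
    have h2 : y ^ 2 = algebraMap K (ringClassField K ι f) (d : K) := by
      rw [hydef, ← map_pow, h1, AlgEquiv.commutes]
    have h3 := congrArg (fun z : ringClassField K ι f => (z : ℂ)) h2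
    simpa [coe_algebraMap_ringClassField] using h3
  have hr' : r ^ 2 = (y : ℂ) ^ 2 := by rw [hr, hysq]
  rcases sq_eq_sq_iff_eq_or_eq_neg.mp hr' with h | h
  · rw [h]; exact y.2
  · rw [h]; exact neg_mem y.2

/-- The discriminant of the principal form of discriminant `f² d_K`: `B² − 4C = f² d_K`. [folklore] -/
private theorem principalForm_sq_sub_four_mul (h2 : Module.finrank ℚ K = 2) (f : ℕ) :
    (principalForm ((f : ℤ) ^ 2 * NumberField.discr K)).2.1 ^ 2 -
        4 * (principalForm ((f : ℤ) ^ 2 * NumberField.discr K)).2.2 =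
      (f : ℤ) ^ 2 * NumberField.discr K := by
  set D' : ℤ := (f : ℤ) ^ 2 * NumberField.discr K with hD'
  have h4' : D' % 4 = 0 ∨ D' % 4 = 1 := sq_mul_emod_four (discr_emod_four h2) f
  have h1 := discr_principalForm h4'
  have h2' : Literature.NumberTheory.QuadraticFields.BinaryQuadraticForm.discr
      (principalForm D') = (principalForm D').2.1 ^ 2 -
        4 * (principalForm D').1 * (principalForm D').2.2 := rfl
  rw [principalForm_fst] at h2'
  linear_combination -h2' + h1

/-! ### `√d ∈ K[f]` for `d ∣ f² d_K`: ramified AND unramified genus characters -/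

/-- **Genus theory of the ring class field `K[f]`, general odd membership: `√d ∈ K[f]` for every
odd square-free `d ≡ 1 (mod 4)` dividing `f² d_K`** (`K` imaginary quadratic, `ι : K → ℂ`,
`f ≥ 1`). Every prime discriminant `q* ∣ d` divides either the conductor `f` (Cox §9.A / Thm. 6.1:
the characters `(q*/·)`, `q ∣ f`, kill `P_{K,ℤ}(f)`) or the field discriminant `d_K` (Gauss's genus
theory of the maximal order: the genus field `K(√q₁*, …, √q_t*)` of `d_K` lies in the Hilbert class
field `K[1] ⊆ K[f]`); Voight Prop. 3.8 / Cor. 3.9: `K* = K(√p₁*, …, √p_r*) ⊆ P_(f) ⊆ R_(f)` for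
the odd primes `p_i ∣ D = d_K f²`; Cohn 1985 (2.2.22): `k_g = ℚ(√q₁*) ⋯ ℚ(√q_t*) K₀`, `q_i` the odd
prime divisors of `f² d_K`. Proof: Bauer's theorem (degree-one form) for `K(√d) ⊆ K̄` and the class
field `R_f ≅ K[f]`: a degree-one prime `𝔭 = (a)`, `a ≡ n (mod f)`, of norm `ℓ ∤ 2 d f` splitting
completely in `R_f` has `4ℓ = z² − f² d_K y²` (principal form of discriminant `f² d_K`), so
`(d/ℓ) = 1` and `𝔭` splits completely in `K(√d)`.
[cite: Voight2007, §3 Prop. 3.8 and Cor. 3.9] [cite: Cox2013, §9.A Thm. 9.2, §6.A Thm. 6.1, §11.A Thm. 11.1]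
[cite: Cohn1985, (2.2.22)–Thm. 2.2.23] -/
theorem sqrt_intCast_mem_ringClassField_of_dvd_sq_mul_discr (hK : IsImaginaryQuadratic K)
    (ι : K →+* ℂ) {d : ℤ} (hd4 : d % 4 = 1) (hd : Squarefree d) {f : ℕ} (hf : f ≠ 0)
    (hdf : d ∣ (f : ℤ) ^ 2 * NumberField.discr K) {r : ℂ} (hr : r ^ 2 = (d : ℂ)) :
    r ∈ ringClassField K ι f := by
  -- the trivial case `d = 1`
  by_cases hd1 : d = 1
  · subst hd1
    have hr' : r ^ 2 = 1 ^ 2 := by rw [hr]; push_cast; ring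
    rcases sq_eq_sq_iff_eq_or_eq_neg.mp hr' with rfl | rfl
    · exact one_mem _
    · exact neg_mem (one_mem _)
  refine sqrt_intCast_mem_ringClassField_of_forall_principalForm hK ι (Or.inl ⟨hd4, hd, hd1⟩) hf
    (fun ℓ hℓ hℓ2 hℓd x y hxy => ?_) hr
  -- `d ∣ 4ℓ − z²` with `z = 2x + By` (`4ℓ = z² − f²d_K y²`, `d ∣ f² d_K`)
  have hP := principalForm_sq_sub_four_mul hK.1 f
  have hz : (d : ℤ) ∣ 4 * (ℓ : ℤ) -
      (2 * x + (principalForm ((f : ℤ) ^ 2 * NumberField.discr K)).2.1 * y) ^ 2 := by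
    obtain ⟨c, hc⟩ := hdf
    exact ⟨-(c * y ^ 2), by linear_combination (-4 : ℤ) * hxy - y ^ 2 * hP - y ^ 2 * hc⟩
  exact jacobiSym_eq_one_of_dvd_four_mul_sub_sq hd4 hℓ hℓ2 hℓd hz

/-- **The genus field of the maximal order: `√q* ∈ K[1]`** (the Hilbert class field realised by
singular moduli) **for every odd square-free `d ≡ 1 (mod 4)` dividing `d_K`** — Gauss's genus
theory: the genus field `K(√q₁*, …, √q_t*)` of `K`, `q_i` the odd primes of `d_K`, is unramified,
hence inside the Hilbert class field (the case `f = 1` of the previous theorem; Cox Thm. 6.1, Cohn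
Thm. 8.2.15–Lemma 8.2.16: "`K_g = ℚ(√d₁, …, √d_{g+1})`"). [cite: Cox2013, §6.A Thm. 6.1]
[cite: Cohn1985, Thm. 8.2.15–Lemma 8.2.16] -/
theorem sqrt_intCast_mem_ringClassField_one_of_dvd_discr (hK : IsImaginaryQuadratic K)
    (ι : K →+* ℂ) {d : ℤ} (hd4 : d % 4 = 1) (hd : Squarefree d) (hdD : d ∣ NumberField.discr K)
    {r : ℂ} (hr : r ^ 2 = (d : ℂ)) : r ∈ ringClassField K ι 1 :=
  sqrt_intCast_mem_ringClassField_of_dvd_sq_mul_discr hK ι hd4 hd one_ne_zero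
    (by simpa using hdD) hr

/-! ### The dyadic genus characters: `√−1 ∈ K[f]` for `4 ∣ f`, `√±2 ∈ K[f]` for `8 ∣ f` -/

/-- The principal form of a discriminant `D ≡ 0 (mod 4)` is `x² − (D/4) y²`. [folklore] -/
private theorem principalForm_of_four_dvd {D : ℤ} (h : 4 ∣ D) :
    principalForm D = (1, 0, -D / 4) := by
  unfold principalForm
  rw [if_pos (Int.emod_eq_zero_of_dvd h)]

/-- For `4 ∣ f` the principal form of discriminant `f² d_K` is `x² − 4 (f/4)² d_K · y²`: a value
`ℓ = x² + Bxy + Cy²` satisfies `ℓ = x² − 4((f/4)² d_K) y²`. [folklore] -/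
private theorem eq_sq_sub_four_mul_of_principalForm {D : ℤ} {g : ℕ} {x y ℓ : ℤ}
    (hxy : x ^ 2 + (principalForm (((4 * g : ℕ) : ℤ) ^ 2 * D)).2.1 * x * y +
      (principalForm (((4 * g : ℕ) : ℤ) ^ 2 * D)).2.2 * y ^ 2 = ℓ) :
    ℓ = x ^ 2 - 4 * ((g : ℤ) ^ 2 * D * y ^ 2) := by
  have h4 : (4 : ℤ) ∣ ((4 * g : ℕ) : ℤ) ^ 2 * D := ⟨4 * (g : ℤ) ^ 2 * D, by push_cast; ring⟩
  have hq : -(((4 * g : ℕ) : ℤ) ^ 2 * D) / 4 = -(4 * ((g : ℤ) ^ 2 * D)) := by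
    rw [show -(((4 * g : ℕ) : ℤ) ^ 2 * D) = 4 * (-(4 * ((g : ℤ) ^ 2 * D))) by push_cast; ring,
      Int.mul_ediv_cancel_left _ four_ne_zero]
  rw [principalForm_of_four_dvd h4] at hxy
  simp only at hxy
  rw [hq] at hxy
  linear_combination -hxy

/-- An odd number `ℓ = x² − 4t` is `≡ 1 (mod 4)`, and `≡ 1 (mod 8)` if moreover `4 ∣ t`. [folklore] -/
private theorem emod_of_eq_sq_sub_four_mul {ℓ : ℕ} (hℓ : Odd ℓ) {x t : ℤ}
    (h : (ℓ : ℤ) = x ^ 2 - 4 * t) : ℓ % 4 = 1 ∧ (4 ∣ t → ℓ % 8 = 1) := by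
  have hℓ2 : ℓ % 2 = 1 := Nat.odd_iff.mp hℓ
  rcases Int.even_or_odd' x with ⟨k, hk | hk⟩
  · exfalso
    set A : ℤ := k ^ 2 - t with hA
    have : (ℓ : ℤ) = 4 * A := by rw [h, hk, hA]; ring
    omega
  · obtain ⟨j, hj⟩ := Int.even_mul_succ_self k
    set A : ℤ := 2 * j - t with hA
    have hℓA : (ℓ : ℤ) = 4 * A + 1 := by
      rw [h, hk, hA]; linear_combination (4 : ℤ) * hj
    refine ⟨by omega, fun ⟨u, hu⟩ => ?_⟩
    set B : ℤ := j - 2 * u with hB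
    have hℓB : (ℓ : ℤ) = 8 * B + 1 := by rw [hℓA, hA, hu, hB]; ring
    omega

/-- `J(2² | ℓ) = 1` for odd `ℓ`. [folklore] -/
private theorem jacobiSym_four {ℓ : ℕ} (hℓ : ℓ.Prime) (hℓ2 : ℓ ≠ 2) : jacobiSym (2 ^ 2) ℓ = 1 := by
  refine jacobiSym.sq_one' ?_
  rw [show (2 : ℤ) = ((2 : ℕ) : ℤ) by rfl, Int.gcd_natCast_natCast]
  exact (Nat.coprime_primes Nat.prime_two hℓ).mpr (Ne.symm hℓ2)

/-- Halving inside a subfield of `ℂ`: if `2r ∈ L` then `r ∈ L`. [folklore] -/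
private theorem mem_of_two_mul_mem {L : Subfield ℂ} {r : ℂ} (h : 2 * r ∈ L) : r ∈ L := by
  have : r = 2 * r / 2 := by field_simp
  rw [this]
  exact div_mem h (by exact_mod_cast natCast_mem L 2)

/-- **`√−1 ∈ K[f]` whenever `4 ∣ f`** (`K` imaginary quadratic, `ι : K → ℂ`; Voight Cor. 3.9:
`P_(f) ⊇ K*(√−1)` for `d ≡ 1 (mod 4)` and `4 ∣ f`, and in the remaining cases `d ≡ 4 (mod 8)`
(`√−1 ∈ P_(1)` already) and `d ≡ 0 (mod 8)`, `2 ∣ f`; Prop. 3.8 with `m = −4`). Proof: the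
principal form of discriminant `f² d_K` is `x² − 4(f/4)² d_K y²`, so an odd prime `ℓ` it represents
is `≡ 1 (mod 4)` and `(−4/ℓ) = (−1/ℓ) = 1`.
[cite: Voight2007, §3 Prop. 3.8 and Cor. 3.9] [cite: Cox2013, §6.A Thm. 6.1 and §9.A Thm. 9.2] -/
theorem sqrt_neg_one_mem_ringClassField_of_four_dvd (hK : IsImaginaryQuadratic K) (ι : K →+* ℂ)
    {f : ℕ} (hf : f ≠ 0) (h4 : 4 ∣ f) {r : ℂ} (hr : r ^ 2 = -1) : r ∈ ringClassField K ι f := by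
  obtain ⟨g, rfl⟩ := h4
  have h2r : (2 * r) ^ 2 = ((-4 : ℤ) : ℂ) := by rw [mul_pow, hr]; norm_num
  have hfund : ((-4 : ℤ) % 4 = 1 ∧ Squarefree (-4 : ℤ) ∧ (-4 : ℤ) ≠ 1) ∨
      (4 ∣ (-4 : ℤ) ∧ ((-4 : ℤ) / 4 % 4 = 2 ∨ (-4 : ℤ) / 4 % 4 = 3) ∧ Squarefree ((-4 : ℤ) / 4)) :=
    Or.inr ⟨⟨-1, by norm_num⟩, by decide, by
      rw [show (-4 : ℤ) / 4 = -1 by decide]; exact isUnit_one.neg.squarefree⟩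
  refine mem_of_two_mul_mem (sqrt_intCast_mem_ringClassField_of_forall_principalForm hK ι hfund hf
    (fun ℓ hℓ hℓ2 _ x y hxy => ?_) h2r)
  have hℓo : Odd ℓ := hℓ.odd_of_ne_two hℓ2
  have hℓ4 := (emod_of_eq_sq_sub_four_mul hℓo (eq_sq_sub_four_mul_of_principalForm hxy)).1
  rw [show (-4 : ℤ) = -1 * 2 ^ 2 by norm_num, jacobiSym.mul_left, jacobiSym.at_neg_one hℓo,
    ZMod.χ₄_nat_one_mod_four hℓ4, jacobiSym_four hℓ hℓ2, one_mul]

/-- **`√2 ∈ K[f]` whenever `8 ∣ f`** (Voight Cor. 3.9: `P_(f) ⊇ K*(√−1, √2)` for `d ≡ 1 (mod 4)`,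
`8 ∣ f`; Prop. 3.8 with `m = 8`). Proof: an odd prime `ℓ = x² − 16(f/8)² d_K y²` is `≡ 1 (mod 8)`,
so `(8/ℓ) = (2/ℓ) = 1`. [cite: Voight2007, §3 Prop. 3.8 and Cor. 3.9] [cite: Cox2013, §6.A Thm. 6.1 and §9.A Thm. 9.2] -/
theorem sqrt_two_mem_ringClassField_of_eight_dvd (hK : IsImaginaryQuadratic K) (ι : K →+* ℂ)
    {f : ℕ} (hf : f ≠ 0) (h8 : 8 ∣ f) {r : ℂ} (hr : r ^ 2 = 2) : r ∈ ringClassField K ι f := by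
  obtain ⟨g', rfl⟩ := h8
  have h2r : (2 * r) ^ 2 = ((8 : ℤ) : ℂ) := by rw [mul_pow, hr]; norm_num
  have hfund : ((8 : ℤ) % 4 = 1 ∧ Squarefree (8 : ℤ) ∧ (8 : ℤ) ≠ 1) ∨
      (4 ∣ (8 : ℤ) ∧ ((8 : ℤ) / 4 % 4 = 2 ∨ (8 : ℤ) / 4 % 4 = 3) ∧ Squarefree ((8 : ℤ) / 4)) :=
    Or.inr ⟨⟨2, by norm_num⟩, by decide, by
      rw [show (8 : ℤ) / 4 = 2 by decide]; exact Int.prime_two.squarefree⟩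
  have hf' : 4 * (2 * g') ≠ 0 := by omega
  have key := sqrt_intCast_mem_ringClassField_of_forall_principalForm hK ι hfund hf'
    (fun ℓ hℓ hℓ2 _ x y hxy => ?_) h2r
  · rw [show 8 * g' = 4 * (2 * g') by ring]
    exact mem_of_two_mul_mem key
  have hℓo : Odd ℓ := hℓ.odd_of_ne_two hℓ2
  have hℓ8 := (emod_of_eq_sq_sub_four_mul hℓo (eq_sq_sub_four_mul_of_principalForm hxy)).2
    ⟨(g' : ℤ) ^ 2 * NumberField.discr K * y ^ 2, by push_cast; ring⟩
  rw [show (8 : ℤ) = 2 * 2 ^ 2 by norm_num, jacobiSym.mul_left, jacobiSym.at_two hℓo,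
    ZMod.χ₈_nat_eq_if_mod_eight, if_neg (by omega), if_pos (Or.inl hℓ8), jacobiSym_four hℓ hℓ2,
    one_mul]

/-- **`√−2 ∈ K[f]` whenever `8 ∣ f`** (Voight Cor. 3.9, Prop. 3.8 with `m = −8`): an odd prime
`ℓ = x² − 16(f/8)² d_K y²` is `≡ 1 (mod 8)`, so `(−8/ℓ) = (−2/ℓ) = 1`.
[cite: Voight2007, §3 Prop. 3.8 and Cor. 3.9] [cite: Cox2013, §6.A Thm. 6.1 and §9.A Thm. 9.2] -/
theorem sqrt_neg_two_mem_ringClassField_of_eight_dvd (hK : IsImaginaryQuadratic K) (ι : K →+* ℂ)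
    {f : ℕ} (hf : f ≠ 0) (h8 : 8 ∣ f) {r : ℂ} (hr : r ^ 2 = -2) : r ∈ ringClassField K ι f := by
  obtain ⟨g', rfl⟩ := h8
  have h2r : (2 * r) ^ 2 = ((-8 : ℤ) : ℂ) := by rw [mul_pow, hr]; norm_num
  have hfund : ((-8 : ℤ) % 4 = 1 ∧ Squarefree (-8 : ℤ) ∧ (-8 : ℤ) ≠ 1) ∨
      (4 ∣ (-8 : ℤ) ∧ ((-8 : ℤ) / 4 % 4 = 2 ∨ (-8 : ℤ) / 4 % 4 = 3) ∧
        Squarefree ((-8 : ℤ) / 4)) :=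
    Or.inr ⟨⟨-2, by norm_num⟩, by decide, by
      rw [show (-8 : ℤ) / 4 = -2 by decide]; exact Int.prime_two.neg.squarefree⟩
  have hf' : 4 * (2 * g') ≠ 0 := by omega
  have key := sqrt_intCast_mem_ringClassField_of_forall_principalForm hK ι hfund hf'
    (fun ℓ hℓ hℓ2 _ x y hxy => ?_) h2r
  · rw [show 8 * g' = 4 * (2 * g') by ring]
    exact mem_of_two_mul_mem key
  have hℓo : Odd ℓ := hℓ.odd_of_ne_two hℓ2
  have hℓ8 := (emod_of_eq_sq_sub_four_mul hℓo (eq_sq_sub_four_mul_of_principalForm hxy)).2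
    ⟨(g' : ℤ) ^ 2 * NumberField.discr K * y ^ 2, by push_cast; ring⟩
  rw [show (-8 : ℤ) = -2 * 2 ^ 2 by norm_num, jacobiSym.mul_left, jacobiSym.at_neg_two hℓo,
    ZMod.χ₈'_nat_eq_if_mod_eight, if_neg (by omega), if_pos (Or.inl hℓ8), jacobiSym_four hℓ hℓ2,
    one_mul]

/-! ### The dyadic genus characters for even `d_K` (Voight Cor. 3.9, cases `d ≡ 4, 0 (mod 8)`) -/

/-- For `4 ∣ d_K`, `d_K = 4e`, the principal form of discriminant `f² d_K` is `x² − e (fy)²`: a value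
`ℓ = x² + Bxy + Cy²` satisfies `ℓ = x² − e (f y)²`. [folklore] -/
private theorem eq_sq_sub_of_principalForm_of_discr_eq_four_mul {D e : ℤ} (hD : D = 4 * e) {f : ℕ}
    {x y ℓ : ℤ}
    (hxy : x ^ 2 + (principalForm ((f : ℤ) ^ 2 * D)).2.1 * x * y +
      (principalForm ((f : ℤ) ^ 2 * D)).2.2 * y ^ 2 = ℓ) :
    ℓ = x ^ 2 - e * ((f : ℤ) * y) ^ 2 := by
  have h4 : (4 : ℤ) ∣ (f : ℤ) ^ 2 * D := ⟨(f : ℤ) ^ 2 * e, by rw [hD]; ring⟩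
  have hq : -((f : ℤ) ^ 2 * D) / 4 = -((f : ℤ) ^ 2 * e) := by
    rw [show -((f : ℤ) ^ 2 * D) = 4 * (-((f : ℤ) ^ 2 * e)) by rw [hD]; ring,
      Int.mul_ediv_cancel_left _ four_ne_zero]
  rw [principalForm_of_four_dvd h4] at hxy
  simp only at hxy
  rw [hq] at hxy
  linear_combination -hxy

/-- An odd `ℓ = a² + b² + 4k` is `≡ 1 (mod 4)`. [folklore] -/
private theorem emod_four_of_eq_sq_add_sq {ℓ : ℕ} (hℓ : Odd ℓ) {a b k : ℤ}
    (h : (ℓ : ℤ) = a ^ 2 + b ^ 2 + 4 * k) : ℓ % 4 = 1 := by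
  have hℓ2 : ℓ % 2 = 1 := Nat.odd_iff.mp hℓ
  rcases Int.even_or_odd' a with ⟨i, hi | hi⟩ <;> rcases Int.even_or_odd' b with ⟨j, hj | hj⟩
  · set A : ℤ := i ^ 2 + j ^ 2 + k with hA
    have : (ℓ : ℤ) = 4 * A := by rw [h, hi, hj, hA]; ring
    omega
  · set A : ℤ := i ^ 2 + j ^ 2 + j + k with hA
    have : (ℓ : ℤ) = 4 * A + 1 := by rw [h, hi, hj, hA]; ring
    omega
  · set A : ℤ := i ^ 2 + i + j ^ 2 + k with hA
    have : (ℓ : ℤ) = 4 * A + 1 := by rw [h, hi, hj, hA]; ring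
    omega
  · set A : ℤ := i ^ 2 + i + j ^ 2 + j + k with hA
    have : (ℓ : ℤ) = 4 * A + 2 := by rw [h, hi, hj, hA]; ring
    omega

/-- An odd `ℓ = a² − 2e′b²`: `ℓ ≡ 1 (mod 8)` if `b` is even; `ℓ ≡ 1, 7 (mod 8)` if `e′ ≡ 1 (mod 4)`;
`ℓ ≡ 1, 3 (mod 8)` if `e′ ≡ 3 (mod 4)`. [folklore] -/
private theorem emod_eight_of_eq_sq_sub_two_mul {ℓ : ℕ} (hℓ : Odd ℓ) {a b e' : ℤ}
    (h : (ℓ : ℤ) = a ^ 2 - 2 * e' * b ^ 2) :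
    (2 ∣ b → ℓ % 8 = 1) ∧ (e' % 4 = 1 → ℓ % 8 = 1 ∨ ℓ % 8 = 7) ∧
      (e' % 4 = 3 → ℓ % 8 = 1 ∨ ℓ % 8 = 3) := by
  have hℓ2 : ℓ % 2 = 1 := Nat.odd_iff.mp hℓ
  rcases Int.even_or_odd' a with ⟨i, hi | hi⟩
  · exfalso
    set A : ℤ := 2 * i ^ 2 - e' * b ^ 2 with hA
    have : (ℓ : ℤ) = 2 * A := by rw [h, hi, hA]; ring
    omega
  · obtain ⟨j, hj⟩ := Int.even_mul_succ_self i
    -- `a² = 8j + 1`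
    have ha : a ^ 2 = 8 * j + 1 := by rw [hi]; linear_combination (4 : ℤ) * hj
    rcases Int.even_or_odd' b with ⟨c, hc | hc⟩
    · -- `b` even: `2 e' b² = 8 e' c²`
      set A : ℤ := j - e' * c ^ 2 with hA
      have : (ℓ : ℤ) = 8 * A + 1 := by rw [h, ha, hc, hA]; ring
      refine ⟨fun _ => by omega, fun _ => Or.inl (by omega), fun _ => Or.inl (by omega)⟩
    · -- `b` odd: `b² = 8u + 1`, `2 e' b² = 16 e' u + 2e'`
      obtain ⟨u, hu⟩ := Int.even_mul_succ_self c
      have hb : b ^ 2 = 8 * u + 1 := by rw [hc]; linear_combination (4 : ℤ) * hu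
      set A : ℤ := j - 2 * e' * u with hA
      have hℓA : (ℓ : ℤ) = 8 * A + 1 - 2 * e' := by rw [h, ha, hb, hA]; ring
      refine ⟨fun ⟨v, hv⟩ => ?_, fun h1 => Or.inr ?_, fun h3 => Or.inr ?_⟩
      · exfalso; omega
      · obtain ⟨q, hq⟩ : ∃ q, e' = 4 * q + 1 := ⟨e' / 4, by omega⟩
        rw [hq] at hℓA
        omega
      · obtain ⟨q, hq⟩ : ∃ q, e' = 4 * q + 3 := ⟨e' / 4, by omega⟩
        rw [hq] at hℓA
        omega

/-- `−4` is a fundamental discriminant (tree's explicit form). [folklore] -/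
private theorem isFundamental_neg_four :
    ((-4 : ℤ) % 4 = 1 ∧ Squarefree (-4 : ℤ) ∧ (-4 : ℤ) ≠ 1) ∨
      (4 ∣ (-4 : ℤ) ∧ ((-4 : ℤ) / 4 % 4 = 2 ∨ (-4 : ℤ) / 4 % 4 = 3) ∧ Squarefree ((-4 : ℤ) / 4)) :=
  Or.inr ⟨⟨-1, by norm_num⟩, by decide, by
    rw [show (-4 : ℤ) / 4 = -1 by decide]; exact isUnit_one.neg.squarefree⟩

/-- `8` is a fundamental discriminant (tree's explicit form). [folklore] -/
private theorem isFundamental_eight :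
    ((8 : ℤ) % 4 = 1 ∧ Squarefree (8 : ℤ) ∧ (8 : ℤ) ≠ 1) ∨
      (4 ∣ (8 : ℤ) ∧ ((8 : ℤ) / 4 % 4 = 2 ∨ (8 : ℤ) / 4 % 4 = 3) ∧ Squarefree ((8 : ℤ) / 4)) :=
  Or.inr ⟨⟨2, by norm_num⟩, by decide, by
    rw [show (8 : ℤ) / 4 = 2 by decide]; exact Int.prime_two.squarefree⟩

/-- `−8` is a fundamental discriminant (tree's explicit form). [folklore] -/
private theorem isFundamental_neg_eight :
    ((-8 : ℤ) % 4 = 1 ∧ Squarefree (-8 : ℤ) ∧ (-8 : ℤ) ≠ 1) ∨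
      (4 ∣ (-8 : ℤ) ∧ ((-8 : ℤ) / 4 % 4 = 2 ∨ (-8 : ℤ) / 4 % 4 = 3) ∧
        Squarefree ((-8 : ℤ) / 4)) :=
  Or.inr ⟨⟨-2, by norm_num⟩, by decide, by
    rw [show (-8 : ℤ) / 4 = -2 by decide]; exact Int.prime_two.neg.squarefree⟩

/-- `J(−4 | ℓ) = (−1/ℓ) = 1` for `ℓ ≡ 1 (mod 4)`. [folklore] -/
private theorem jacobiSym_neg_four_eq_one {ℓ : ℕ} (hℓ : ℓ.Prime) (hℓ2 : ℓ ≠ 2) (h : ℓ % 4 = 1) :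
    jacobiSym (-4) ℓ = 1 := by
  rw [show (-4 : ℤ) = -1 * 2 ^ 2 by norm_num, jacobiSym.mul_left,
    jacobiSym.at_neg_one (hℓ.odd_of_ne_two hℓ2), ZMod.χ₄_nat_one_mod_four h,
    jacobiSym_four hℓ hℓ2, one_mul]

/-- `J(8 | ℓ) = (2/ℓ) = 1` for `ℓ ≡ ±1 (mod 8)`. [folklore] -/
private theorem jacobiSym_eight_eq_one {ℓ : ℕ} (hℓ : ℓ.Prime) (hℓ2 : ℓ ≠ 2)
    (h : ℓ % 8 = 1 ∨ ℓ % 8 = 7) : jacobiSym 8 ℓ = 1 := by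
  have hℓo := hℓ.odd_of_ne_two hℓ2
  rw [show (8 : ℤ) = 2 * 2 ^ 2 by norm_num, jacobiSym.mul_left, jacobiSym.at_two hℓo,
    ZMod.χ₈_nat_eq_if_mod_eight, if_neg (by rcases h with h | h <;> omega), if_pos h,
    jacobiSym_four hℓ hℓ2, one_mul]

/-- `J(−8 | ℓ) = (−2/ℓ) = 1` for `ℓ ≡ 1, 3 (mod 8)`. [folklore] -/
private theorem jacobiSym_neg_eight_eq_one {ℓ : ℕ} (hℓ : ℓ.Prime) (hℓ2 : ℓ ≠ 2)
    (h : ℓ % 8 = 1 ∨ ℓ % 8 = 3) : jacobiSym (-8) ℓ = 1 := by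
  have hℓo := hℓ.odd_of_ne_two hℓ2
  rw [show (-8 : ℤ) = -2 * 2 ^ 2 by norm_num, jacobiSym.mul_left, jacobiSym.at_neg_two hℓo,
    ZMod.χ₈'_nat_eq_if_mod_eight, if_neg (by rcases h with h | h <;> omega), if_pos h,
    jacobiSym_four hℓ hℓ2, one_mul]

/-- **`√−1 ∈ K[f]` for every `f ≥ 1` when `d_K ≡ 12 (mod 16)`** (`d_K = 4e`, `e ≡ 3 (mod 4)`, i.e.
`d_K ≡ 4 (mod 8)` in Voight's Cor. 3.9: then `√−1 = √d_K / (2√e)`-type genus radical is unramified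
and already in the Hilbert class field `K[1]`; Prop. 3.8 with `m = −4`, `mn = −4·(−4e)/… ∣ d_K f²`
automatically). Proof: the principal form is `x² − e(fy)²`, so an odd prime `ℓ` it represents is
`≡ x² + (fy)² ≡ 1 (mod 4)`, and `(−4/ℓ) = 1`.
[cite: Voight2007, §3 Prop. 3.8 and Cor. 3.9] [cite: Cox2013, §6.A Thm. 6.1 and §3.B Lemma 3.17] -/
theorem sqrt_neg_one_mem_ringClassField_of_discr_div_four_emod (hK : IsImaginaryQuadratic K)
    (ι : K →+* ℂ) (hD : 4 ∣ NumberField.discr K) (hD3 : NumberField.discr K / 4 % 4 = 3)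
    {f : ℕ} (hf : f ≠ 0) {r : ℂ} (hr : r ^ 2 = -1) : r ∈ ringClassField K ι f := by
  obtain ⟨e, he⟩ := hD
  have hDe : NumberField.discr K / 4 = e := by rw [he, Int.mul_ediv_cancel_left _ four_ne_zero]
  rw [hDe] at hD3
  have h2r : (2 * r) ^ 2 = ((-4 : ℤ) : ℂ) := by rw [mul_pow, hr]; norm_num
  refine mem_of_two_mul_mem (sqrt_intCast_mem_ringClassField_of_forall_principalForm hK ι
    isFundamental_neg_four hf (fun ℓ hℓ hℓ2 _ x y hxy => ?_) h2r)
  have hℓe := eq_sq_sub_of_principalForm_of_discr_eq_four_mul he hxy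
  obtain ⟨k, hk⟩ : ∃ k, e = 4 * k + 3 := ⟨e / 4, by omega⟩
  have h' : (ℓ : ℤ) = x ^ 2 + ((f : ℤ) * y) ^ 2 + 4 * ((-k - 1) * ((f : ℤ) * y) ^ 2) := by
    rw [hℓe, hk]; ring
  exact jacobiSym_neg_four_eq_one hℓ hℓ2 (emod_four_of_eq_sq_add_sq (hℓ.odd_of_ne_two hℓ2) h')

/-- **`√−1 ∈ K[f]` for every even `f` when `8 ∣ d_K`** (Voight Cor. 3.9: `P_(f) = K*(√−1)` for
`d ≡ 0 (mod 8)` and `2 ∣ f`; Prop. 3.8 with `m = −4`). Proof: `ℓ = x² − 2e′(fy)²` with `fy` even is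
`≡ 1 (mod 8)`. [cite: Voight2007, §3 Prop. 3.8 and Cor. 3.9] [cite: Cox2013, §6.A Thm. 6.1 and §3.B Lemma 3.17] -/
theorem sqrt_neg_one_mem_ringClassField_of_eight_dvd_discr (hK : IsImaginaryQuadratic K)
    (ι : K →+* ℂ) (hD : 8 ∣ NumberField.discr K) {f : ℕ} (hf : f ≠ 0) (h2 : 2 ∣ f) {r : ℂ}
    (hr : r ^ 2 = -1) : r ∈ ringClassField K ι f := by
  obtain ⟨e', he'⟩ := hD
  have he : NumberField.discr K = 4 * (2 * e') := by rw [he']; ring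
  have h2r : (2 * r) ^ 2 = ((-4 : ℤ) : ℂ) := by rw [mul_pow, hr]; norm_num
  refine mem_of_two_mul_mem (sqrt_intCast_mem_ringClassField_of_forall_principalForm hK ι
    isFundamental_neg_four hf (fun ℓ hℓ hℓ2 _ x y hxy => ?_) h2r)
  have hℓe := eq_sq_sub_of_principalForm_of_discr_eq_four_mul he hxy
  have h' : (ℓ : ℤ) = x ^ 2 - 2 * e' * ((f : ℤ) * y) ^ 2 := by linear_combination hℓe
  have h8 := (emod_eight_of_eq_sq_sub_two_mul (hℓ.odd_of_ne_two hℓ2) h').1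
    (dvd_mul_of_dvd_left (Int.natCast_dvd_natCast.mpr h2) _)
  exact jacobiSym_neg_four_eq_one hℓ hℓ2 (by omega)

/-- **`√2 ∈ K[f]` for every `f ≥ 1` when `d_K = 8e′`, `e′ ≡ 1 (mod 4)`** (the unramified genus
radical `√8 = √2·2` of `d_K ≡ 8 (mod 32)`; Voight Prop. 3.8 with `m = 8`, `n = e′`-part: `mn ∣ d_K f²`
for all `f`). Proof: `ℓ = x² − 2e′(fy)² ≡ ±1 (mod 8)`, so `(8/ℓ) = (2/ℓ) = 1`.
[cite: Voight2007, §3 Prop. 3.8 and Cor. 3.9] [cite: Cox2013, §6.A Thm. 6.1 and §3.B Lemma 3.17] -/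
theorem sqrt_two_mem_ringClassField_of_discr_eq_eight_mul (hK : IsImaginaryQuadratic K)
    (ι : K →+* ℂ) (hD : 8 ∣ NumberField.discr K) (hD1 : NumberField.discr K / 8 % 4 = 1) {f : ℕ}
    (hf : f ≠ 0) {r : ℂ} (hr : r ^ 2 = 2) : r ∈ ringClassField K ι f := by
  obtain ⟨e', he'⟩ := hD
  have hDe : NumberField.discr K / 8 = e' := by
    rw [he', Int.mul_ediv_cancel_left _ (by norm_num : (8 : ℤ) ≠ 0)]
  rw [hDe] at hD1
  have he : NumberField.discr K = 4 * (2 * e') := by rw [he']; ring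
  have h2r : (2 * r) ^ 2 = ((8 : ℤ) : ℂ) := by rw [mul_pow, hr]; norm_num
  refine mem_of_two_mul_mem (sqrt_intCast_mem_ringClassField_of_forall_principalForm hK ι
    isFundamental_eight hf (fun ℓ hℓ hℓ2 _ x y hxy => ?_) h2r)
  have hℓe := eq_sq_sub_of_principalForm_of_discr_eq_four_mul he hxy
  have h' : (ℓ : ℤ) = x ^ 2 - 2 * e' * ((f : ℤ) * y) ^ 2 := by linear_combination hℓe
  exact jacobiSym_eight_eq_one hℓ hℓ2
    ((emod_eight_of_eq_sq_sub_two_mul (hℓ.odd_of_ne_two hℓ2) h').2.1 hD1)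

/-- **`√−2 ∈ K[f]` for every `f ≥ 1` when `d_K = 8e′`, `e′ ≡ 3 (mod 4)`** (the unramified genus
radical of `d_K ≡ 24 (mod 32)`; Voight Prop. 3.8 with `m = −8`). Proof: `ℓ = x² − 2e′(fy)² ≡ 1, 3
(mod 8)`, so `(−8/ℓ) = (−2/ℓ) = 1`.
[cite: Voight2007, §3 Prop. 3.8 and Cor. 3.9] [cite: Cox2013, §6.A Thm. 6.1 and §3.B Lemma 3.17] -/
theorem sqrt_neg_two_mem_ringClassField_of_discr_eq_eight_mul (hK : IsImaginaryQuadratic K)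
    (ι : K →+* ℂ) (hD : 8 ∣ NumberField.discr K) (hD3 : NumberField.discr K / 8 % 4 = 3) {f : ℕ}
    (hf : f ≠ 0) {r : ℂ} (hr : r ^ 2 = -2) : r ∈ ringClassField K ι f := by
  obtain ⟨e', he'⟩ := hD
  have hDe : NumberField.discr K / 8 = e' := by
    rw [he', Int.mul_ediv_cancel_left _ (by norm_num : (8 : ℤ) ≠ 0)]
  rw [hDe] at hD3
  have he : NumberField.discr K = 4 * (2 * e') := by rw [he']; ring
  have h2r : (2 * r) ^ 2 = ((-8 : ℤ) : ℂ) := by rw [mul_pow, hr]; norm_num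
  refine mem_of_two_mul_mem (sqrt_intCast_mem_ringClassField_of_forall_principalForm hK ι
    isFundamental_neg_eight hf (fun ℓ hℓ hℓ2 _ x y hxy => ?_) h2r)
  have hℓe := eq_sq_sub_of_principalForm_of_discr_eq_four_mul he hxy
  have h' : (ℓ : ℤ) = x ^ 2 - 2 * e' * ((f : ℤ) * y) ^ 2 := by linear_combination hℓe
  exact jacobiSym_neg_eight_eq_one hℓ hℓ2
    ((emod_eight_of_eq_sq_sub_two_mul (hℓ.odd_of_ne_two hℓ2) h').2.2 hD3)

/-- **`√2, √−2 ∈ K[f]` for `4 ∣ d_K` and `4 ∣ f`** (Voight Cor. 3.9: `P_(f) = K*(√2)` (with `√−1`)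
for `d ≡ 4 (mod 8)`, `4 ∣ f`; and the `d ≡ 0 (mod 8)` cases). Proof: `ℓ = x² − 16 e (f/4)² y² ≡ 1
(mod 8)`. [cite: Voight2007, §3 Prop. 3.8 and Cor. 3.9] [cite: Cox2013, §6.A Thm. 6.1 and §3.B Lemma 3.17] -/
theorem sqrt_two_mem_ringClassField_of_four_dvd_discr (hK : IsImaginaryQuadratic K) (ι : K →+* ℂ)
    (hD : 4 ∣ NumberField.discr K) {f : ℕ} (hf : f ≠ 0) (h4 : 4 ∣ f) {r : ℂ}
    (hr : r ^ 2 = 2 ∨ r ^ 2 = -2) : r ∈ ringClassField K ι f := by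
  obtain ⟨e, he⟩ := hD
  obtain ⟨g, rfl⟩ := h4
  -- an odd prime value of the principal form is `≡ 1 (mod 8)`
  have hmod : ∀ ℓ : ℕ, ℓ.Prime → ℓ ≠ 2 → ∀ x y : ℤ,
      x ^ 2 + (principalForm ((((4 * g : ℕ) : ℤ)) ^ 2 * NumberField.discr K)).2.1 * x * y +
        (principalForm ((((4 * g : ℕ) : ℤ)) ^ 2 * NumberField.discr K)).2.2 * y ^ 2 = ℓ →
      ℓ % 8 = 1 := by
    intro ℓ hℓ hℓ2 x y hxy
    have hℓe := eq_sq_sub_of_principalForm_of_discr_eq_four_mul he hxy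
    have h' : (ℓ : ℤ) = x ^ 2 - 4 * (4 * (e * (g : ℤ) ^ 2 * y ^ 2)) := by
      rw [hℓe]; push_cast; ring
    exact (emod_of_eq_sq_sub_four_mul (hℓ.odd_of_ne_two hℓ2) h').2 (dvd_mul_right 4 _)
  rcases hr with hr | hr
  · have h2r : (2 * r) ^ 2 = ((8 : ℤ) : ℂ) := by rw [mul_pow, hr]; norm_num
    exact mem_of_two_mul_mem (sqrt_intCast_mem_ringClassField_of_forall_principalForm hK ι
      isFundamental_eight hf (fun ℓ hℓ hℓ2 _ x y hxy =>
        jacobiSym_eight_eq_one hℓ hℓ2 (Or.inl (hmod ℓ hℓ hℓ2 x y hxy))) h2r)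
  · have h2r : (2 * r) ^ 2 = ((-8 : ℤ) : ℂ) := by rw [mul_pow, hr]; norm_num
    exact mem_of_two_mul_mem (sqrt_intCast_mem_ringClassField_of_forall_principalForm hK ι
      isFundamental_neg_eight hf (fun ℓ hℓ hℓ2 _ x y hxy =>
        jacobiSym_neg_eight_eq_one hℓ hℓ2 (Or.inl (hmod ℓ hℓ hℓ2 x y hxy))) h2r)

/-! ### Dyadic non-membership when `2` is unramified: `d_K` odd and `f` odd -/

/-- Coprime natural numbers cannot both lie in a proper ideal. [folklore] -/
private theorem not_mem_of_coprime_of_mem' {R : Type*} [CommRing R] {I : Ideal R} (hI : I ≠ ⊤)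
    {p f : ℕ} (hcop : Nat.Coprime p f) (hp : (p : R) ∈ I) : (f : R) ∉ I := by
  intro hf
  obtain ⟨a, b, hab⟩ := Nat.isCoprime_iff_coprime.mpr hcop
  apply hI
  rw [Ideal.eq_top_iff_one]
  have h1 : (1 : R) = (a : R) * (p : R) + (b : R) * (f : R) := by
    have := congrArg (fun z : ℤ => (z : R)) hab
    push_cast at this ⊢
    exact this.symm
  rw [h1]
  exact Submodule.add_mem _ (Ideal.mul_mem_left _ _ hp) (Ideal.mul_mem_left _ _ hf)

/-- If every prime of `𝓞 L` above `2` has ramification index `1`, the ideal `2𝓞_L` is square-free,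
hence radical: `z² ∈ 2𝓞_L ⟹ z ∈ 2𝓞_L`. [folklore] -/
private theorem mem_span_two_of_sq_mem {L : Type*} [Field L] [NumberField L]
    (h : ∀ (P : Ideal (𝓞 L)) [P.IsPrime], P.LiesOver (Ideal.span {(2 : ℤ)}) →
      P.ramificationIdx ℤ = 1)
    {z : 𝓞 L} (hz : z ^ 2 ∈ Ideal.span {(2 : 𝓞 L)}) : z ∈ Ideal.span {(2 : 𝓞 L)} := by
  classical
  set I : Ideal (𝓞 L) := Ideal.span {(2 : 𝓞 L)} with hIdef
  have hI0 : I ≠ ⊥ := by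
    rw [hIdef, Ne, Ideal.span_singleton_eq_bot]; exact two_ne_zero
  have hImap : (Ideal.span {(2 : ℤ)}).map (algebraMap ℤ (𝓞 L)) = I := by
    rw [Ideal.map_span, Set.image_singleton, map_ofNat]
  have hsq : Squarefree I := by
    rw [UniqueFactorizationMonoid.squarefree_iff_nodup_normalizedFactors hI0,
      Multiset.nodup_iff_count_le_one]
    intro P
    by_cases hP : P ∈ normalizedFactors I
    · haveI hPprime : P.IsPrime := Ideal.isPrime_of_prime (prime_of_normalized_factor P hP)
      have h2P : (2 : 𝓞 L) ∈ P :=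
        Ideal.dvd_span_singleton.mp (dvd_of_mem_normalizedFactors hP)
      haveI : P.LiesOver (Ideal.span {(2 : ℤ)}) := by
        refine ⟨(Ideal.IsMaximal.eq_of_le (PrincipalIdealRing.isMaximal_of_irreducible
          Int.prime_two.irreducible) (Ideal.comap_ne_top _ hPprime.ne_top) ?_)⟩
        rw [Ideal.span_singleton_le_iff_mem, Ideal.mem_comap, map_ofNat]
        exact h2P
      rw [← hImap, ← Ideal.IsDedekindDomain.ramificationIdx_eq_normalizedFactors_count _ P
        (by rw [hImap]; exact hI0), h P inferInstance]
    · simp [Multiset.count_eq_zero_of_notMem hP]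
  exact Ideal.dvd_span_singleton.mp
    (hsq.isRadical 2 (Ideal.span {z}) (by rw [Ideal.span_singleton_pow, Ideal.dvd_span_singleton]; exact hz))

/-- **No algebraic integer has `x² ≡ 3 (mod 4)` in a number field in which `2` is unramified**:
with `z = x − 1`, `z(z+2) = x² − 1 ≡ 2 (mod 4)`, so `z² ∈ 2𝓞_L`, `z ∈ 2𝓞_L` (radical), and then
`z(z+2) ∈ 4𝓞_L`, forcing `2 ∣ 1`. (The local fact behind it: `−1`, and any unit `≡ 3 (mod 4)`, is
not a square in an unramified extension of `ℚ₂`.) [folklore] -/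
private theorem not_sq_sub_mem_span_four {L : Type*} [Field L] [NumberField L]
    (h : ∀ (P : Ideal (𝓞 L)) [P.IsPrime], P.LiesOver (Ideal.span {(2 : ℤ)}) →
      P.ramificationIdx ℤ = 1)
    {c : ℤ} (hc : c % 4 = 3) (x : 𝓞 L) : x ^ 2 - (c : 𝓞 L) ∉ Ideal.span {(4 : 𝓞 L)} := by
  intro hx
  obtain ⟨w, hw⟩ := Ideal.mem_span_singleton'.mp hx
  obtain ⟨k, hk⟩ : ∃ k, c = 4 * k + 3 := ⟨c / 4, by omega⟩
  have hck : (c : 𝓞 L) = 4 * (k : 𝓞 L) + 3 := by rw [hk]; push_cast; ring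
  -- `z = x - 1` has `z² ∈ 2𝓞_L`
  have hz2 : (x - 1) ^ 2 ∈ Ideal.span {(2 : 𝓞 L)} :=
    Ideal.mem_span_singleton'.mpr ⟨2 * w + 2 * (k : 𝓞 L) + 1 - (x - 1), by
      linear_combination hw - hck⟩
  obtain ⟨y, hy⟩ := Ideal.mem_span_singleton'.mp (mem_span_two_of_sq_mem h hz2)
  -- `x = 2y + 1`, so `x² − c = 4(y² + y − k) − 2 = 4w`: `2 (…) = 1`
  have h1 : (2 : 𝓞 L) * (2 * (y ^ 2 + y - (k : 𝓞 L) - w)) = 2 * 1 := by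
    linear_combination (2 * y + x + 1) * hy - hw + hck
  have hunit : IsUnit (2 : 𝓞 L) :=
    IsUnit.of_mul_eq_one _ (mul_left_cancel₀ two_ne_zero h1)
  -- but `2` lies in a prime of `𝓞 L`
  haveI : (Ideal.span {(2 : ℤ)}).IsMaximal :=
    PrincipalIdealRing.isMaximal_of_irreducible Int.prime_two.irreducible
  obtain ⟨W, hWmax, hWover⟩ :=
    Ideal.exists_maximal_ideal_liesOver_of_isIntegral (R := ℤ) (S := 𝓞 L) (Ideal.span {(2 : ℤ)})
  have h2W : (2 : 𝓞 L) ∈ W := by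
    have : algebraMap ℤ (𝓞 L) 2 ∈ W := by
      rw [← Ideal.mem_comap, ← Ideal.under_def, ← hWover.over]
      exact Ideal.mem_span_singleton_self _
    simpa using this
  exact hWmax.ne_top (Ideal.eq_top_of_isUnit_mem W h2W hunit)

/-- **For `d_K` odd and `f` odd, `2` is unramified in `K[f]`**: a prime `W ∣ 2` of `K[f]` has
`e(W|2) = e(W|v) e(v|2) = 1` (`v = W ∩ 𝓞_K`: `K[f]/K` is unramified off `f`, Cox §9.A, the tree's
`isUnramifiedIn_ringClassField`; `K/ℚ` is unramified at `2 ∤ d_K`, Dedekind).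
[cite: Cox2013, §9.A (p. 180) and Prop. 5.16] -/
theorem ramificationIdx_two_eq_one_ringClassField (hK : IsImaginaryQuadratic K) (ι : K →+* ℂ)
    (hD2 : ¬ (2 : ℤ) ∣ NumberField.discr K) {f : ℕ} (hf : f ≠ 0) (hf2 : ¬ 2 ∣ f)
    [NumberField (ringClassField K ι f)] (P : Ideal (𝓞 (ringClassField K ι f))) [P.IsPrime]
    (hPover : P.LiesOver (Ideal.span {(2 : ℤ)})) : P.ramificationIdx ℤ = 1 := by
  have h2P : (2 : 𝓞 (ringClassField K ι f)) ∈ P := by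
    have : algebraMap ℤ (𝓞 (ringClassField K ι f)) 2 ∈ P := by
      rw [← Ideal.mem_comap, ← Ideal.under_def, ← hPover.over]
      exact Ideal.mem_span_singleton_self _
    simpa using this
  set v : Ideal (𝓞 K) := P.under (𝓞 K) with hvdef
  haveI hPv : P.LiesOver v := ⟨rfl⟩
  haveI hvprime : v.IsPrime := Ideal.IsPrime.under (𝓞 K) P
  have h2v : ((2 : ℕ) : 𝓞 K) ∈ v := by
    change algebraMap (𝓞 K) (𝓞 (ringClassField K ι f)) ((2 : ℕ) : 𝓞 K) ∈ P
    rw [map_natCast]; exact_mod_cast h2P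
  -- `e(v | 2) = 1` since `2 ∤ d_K`
  haveI hunrv : Algebra.IsUnramifiedAt ℤ v :=
    (NumberField.not_dvd_discr_iff_forall_mem K (𝓞 K) Int.prime_two).mp hD2 v inferInstance
      (by exact_mod_cast h2v)
  -- `e(P | v) = 1` since `v ∤ f` (`f` odd, `2 ∈ v`)
  have hvbot : v ≠ ⊥ := fun h0 => by
    rw [h0, Ideal.mem_bot] at h2v; exact two_ne_zero (by exact_mod_cast h2v)
  set v' : HeightOneSpectrum (𝓞 K) := ⟨v, inferInstance, hvbot⟩ with hv'
  have hvf : ¬ Ideal.span {((f : ℕ) : 𝓞 K)} ≤ v'.asIdeal := fun hle =>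
    not_mem_of_coprime_of_mem' hvprime.ne_top
      ((Nat.Prime.coprime_iff_not_dvd Nat.prime_two).mpr hf2) h2v
      (hle (Ideal.mem_span_singleton_self _))
  haveI hunrP : Algebra.IsUnramifiedAt (𝓞 K) P :=
    isUnramifiedIn_ringClassField hK ι hf hvf P inferInstance hPv
  haveI : Algebra.IsUnramifiedAt ℤ P :=
    Algebra.IsUnramifiedAt.comp (R := ℤ) (A := 𝓞 K) v P
  exact Ideal.ramificationIdx_eq_one_of_isUnramifiedAt

/-- **`√c ∉ K[f]` for `c ≡ 3 (mod 4)` when `d_K` and `f` are odd** (in particular `√−1 ∉ K[f]`, and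
`√m ∉ K[f]` for the fundamental discriminants `m = 4e`, `e ≡ 3 (mod 4)`: Voight Cor. 3.9, the
exactness of "`√−1 ∈ P_(f)` iff `4 ∣ f`" at odd `f`): `2` is unramified in `K[f]`, and no algebraic
integer has square `≡ 3 (mod 4)` there. [cite: Voight2007, §3 Cor. 3.9–3.10] [cite: Cox2013, §9.A (p. 180)] -/
theorem sqrt_not_mem_ringClassField_of_emod_four_eq_three (hK : IsImaginaryQuadratic K)
    (ι : K →+* ℂ) (hD2 : ¬ (2 : ℤ) ∣ NumberField.discr K) {f : ℕ} (hf : f ≠ 0) (hf2 : ¬ 2 ∣ f)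
    {c : ℤ} (hc : c % 4 = 3) {r : ℂ} (hr : r ^ 2 = (c : ℂ)) : r ∉ ringClassField K ι f := by
  intro hrL
  haveI := (finiteDimensional_and_isGalois_ringClassField hK ι hf).1
  haveI : NumberField (ringClassField K ι f) := NumberField.of_module_finite K _
  set r' : ringClassField K ι f := ⟨r, hrL⟩ with hr'def
  have hr' : r' ^ 2 = (c : ringClassField K ι f) := Subtype.ext (by simp [hr'def, hr])
  have hint : IsIntegral ℤ r' := by
    refine ⟨X ^ 2 - C c, by monicity!, ?_⟩
    rw [eval₂_sub, eval₂_X_pow, eval₂_C, hr', eq_intCast, sub_self]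
  set x : 𝓞 (ringClassField K ι f) := ⟨r', hint⟩ with hxdef
  have hx : x ^ 2 - ((c : ℤ) : 𝓞 (ringClassField K ι f)) = 0 := by
    apply NumberField.RingOfIntegers.coe_injective
    simp [hxdef, hr']
  refine not_sq_sub_mem_span_four
    (fun P _ hP => ramificationIdx_two_eq_one_ringClassField hK ι hD2 hf hf2 P hP) hc x ?_
  rw [hx]; exact zero_mem _

/-- **`√c ∉ K[f]` for `c ≡ 2 (mod 4)` when `d_K` and `f` are odd** (e.g. `√±2`, `√±2m₀`; Voight
Cor. 3.9–3.10 at odd `f`): the prime `2` divides `c` exactly once and is unramified in `K[f]`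
(the tree's `sqrt_intCast_not_mem_ringClassField` at `ℓ = 2`). [cite: Voight2007, §3 Cor. 3.9–3.10] [cite: Cox2013, §9.A (p. 180)] -/
theorem sqrt_not_mem_ringClassField_of_emod_four_eq_two (hK : IsImaginaryQuadratic K)
    (ι : K →+* ℂ) (hD2 : ¬ (2 : ℤ) ∣ NumberField.discr K) {f : ℕ} (hf : f ≠ 0) (hf2 : ¬ 2 ∣ f)
    {c : ℤ} (hc : c % 4 = 2) {r : ℂ} (hr : r ^ 2 = (c : ℂ)) : r ∉ ringClassField K ι f :=
  sqrt_intCast_not_mem_ringClassField hK ι hf Nat.prime_two (d := c)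
    (by exact_mod_cast (show (2 : ℤ) ∣ c by omega))
    (by exact_mod_cast (show ¬ ((2 : ℤ) ^ 2 ∣ c) by omega)) hf2 (by exact_mod_cast hD2) r hr

/-! ### Voight 2007, Prop. 3.8 for odd discriminants `m` -/

/-- A square-free integer all of whose prime factors divide `x` divides `x`. [folklore] -/
private theorem dvd_of_squarefree_of_forall_prime_dvd {m x : ℤ} (hm : Squarefree m)
    (h : ∀ p : ℕ, p.Prime → (p : ℤ) ∣ m → (p : ℤ) ∣ x) : m ∣ x := by
  have hsq : Squarefree m.natAbs := Int.squarefree_natAbs.mpr hm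
  have hprod := Nat.prod_primeFactors_of_squarefree hsq
  have hdvd : m.natAbs ∣ x.natAbs := by
    rw [← hprod]
    refine Finset.prod_primes_dvd _ (fun q hq => Nat.prime_iff.mp (Nat.prime_of_mem_primeFactors hq))
      fun q hq => ?_
    have hqm : (q : ℤ) ∣ m := Int.dvd_natAbs.mp (Int.natCast_dvd_natCast.mpr
      (Nat.dvd_of_mem_primeFactors hq))
    exact Int.natCast_dvd_natCast.mp (Int.dvd_natAbs.mpr (h q (Nat.prime_of_mem_primeFactors hq) hqm))
  exact Int.natAbs_dvd_natAbs.mp hdvd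

/-- The odd part of a fundamental discriminant (or of `1`) is square-free: an odd prime `p` with
`p² ∣ n` does not exist. [folklore] -/
private theorem not_sq_dvd_of_isFundamental_of_odd {n : ℤ}
    (hn : ((n % 4 = 1 ∧ Squarefree n ∧ n ≠ 1) ∨
      (4 ∣ n ∧ (n / 4 % 4 = 2 ∨ n / 4 % 4 = 3) ∧ Squarefree (n / 4))) ∨ n = 1)
    {p : ℕ} (hp : p.Prime) (hp2 : p ≠ 2) : ¬ ((p : ℤ) ^ 2 ∣ n) := by
  have hpu : ¬ IsUnit (p : ℤ) := by
    rw [Int.isUnit_iff_natAbs_eq, Int.natAbs_natCast]; exact hp.one_lt.ne'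
  rintro hp2n
  rcases hn with (⟨-, hsq, -⟩ | ⟨h4, -, hsq⟩) | rfl
  · exact hpu (hsq (p : ℤ) (by rw [← sq]; exact hp2n))
  · -- `p² ∣ 4 (n/4)` with `p` odd, so `p² ∣ n/4`
    obtain ⟨e, he⟩ := h4
    have hn4 : n / 4 = e := by rw [he, Int.mul_ediv_cancel_left _ four_ne_zero]
    rw [hn4] at hsq
    rw [he] at hp2n
    have hcop : IsCoprime ((p : ℤ) ^ 2) 4 := by
      have h2 : IsCoprime (p : ℤ) 2 := by
        rw [Nat.cast_ofNat.symm]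
        exact Nat.isCoprime_iff_coprime.mpr ((Nat.coprime_primes hp Nat.prime_two).mpr hp2)
      have := h2.pow (m := 2) (n := 2)
      norm_num at this
      exact this
    exact hpu (hsq (p : ℤ) (by rw [← sq]; exact hcop.dvd_of_dvd_mul_left hp2n))
  · have h1 : (p : ℤ) ^ 2 ∣ 1 := hp2n
    have hu : IsUnit ((p : ℤ) ^ 2) := isUnit_of_dvd_one h1
    exact hpu (isUnit_pow_iff two_ne_zero |>.mp hu)

namespace Voight2007

/-- **Voight 2007, Prop. 3.8, for ODD fundamental discriminants `m`, PROVED** (`m ≡ 1 (mod 4)`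
square-free, `m ≠ 1`; the dyadic discriminants `−4m'`, `±8m'` of the named fact
`prop38_sqrt_mem_ringClassField_iff` are not covered here): for `K` imaginary quadratic
(`d = d_K`), `ι : K → ℂ`, `f ≥ 1`, and `n = disc ℚ(√(dm))` entered as in the fact (`d m = n s²`,
`n` fundamental or `1`): **`(∃ r ∈ K[f], r² = m) ↔ m n ∣ d f²`**. (⟸): `m ∣ d f²`, so `√m ∈ K[f]` by
`sqrt_intCast_mem_ringClassField_of_dvd_sq_mul_discr`. (⟹) ("the conductor `𝔣` of `HK/K` satisfies
`𝔣 ∣ fA`"): a prime `p ∣ m` with `p ∤ d_K` ramifies in `K(√m)/K`, so `p ∣ f` (the tree's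
`sqrt_intCast_not_mem_ringClassField`: `K[f]/K` is unramified off `f`, Cox §9.A), while a prime
`p ∣ m` with `p ∣ d_K` divides `s`; hence `m ∣ f s` and `m n s² = d m² ∣ d f² s²`.
[cite: Voight2007, §3 Prop. 3.8 (with Prop. 3.1, Prop. 3.7, Cor. 3.9–3.10)] [cite: Cox2013, §9.A (p. 180) and Thm. 9.2] -/
theorem prop38_sqrt_mem_ringClassField_iff_of_odd (K : Type) [Field K] [NumberField K]
    (hK : IsImaginaryQuadratic K) (ι : K →+* ℂ) {f : ℕ} (hf : f ≠ 0) {m n s : ℤ}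
    (hm : m % 4 = 1 ∧ Squarefree m ∧ m ≠ 1)
    (hn : ((n % 4 = 1 ∧ Squarefree n ∧ n ≠ 1) ∨
      (4 ∣ n ∧ (n / 4 % 4 = 2 ∨ n / 4 % 4 = 3) ∧ Squarefree (n / 4))) ∨ n = 1)
    (hdm : NumberField.discr K * m = n * s ^ 2) :
    (∃ r : ringClassField K ι f, r ^ 2 = (m : ringClassField K ι f)) ↔
      m * n ∣ NumberField.discr K * (f : ℤ) ^ 2 := by
  classical
  obtain ⟨hm4, hmsq, hm1⟩ := hm
  have hD0 : NumberField.discr K ≠ 0 := NumberField.discr_ne_zero K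
  have hs0 : s ≠ 0 := by
    rintro rfl
    exact (mul_ne_zero hD0 hmsq.ne_zero) (by rw [hdm]; ring)
  constructor
  · -- (⟹)
    rintro ⟨r, hr⟩
    have hrC : (r : ℂ) ^ 2 = (m : ℂ) := by
      have := congrArg Subtype.val hr
      simpa using this
    -- every prime `p ∣ m` divides `f s`
    have hmfs : m ∣ (f : ℤ) * s := by
      refine dvd_of_squarefree_of_forall_prime_dvd hmsq fun p hp hpm => ?_
      have hp2 : p ≠ 2 := by
        rintro rfl
        have : (2 : ℤ) ∣ m := hpm
        omega
      by_cases hpD : (p : ℤ) ∣ NumberField.discr K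
      · -- `p² ∣ d m = n s²`, `p² ∤ n` ⟹ `p ∣ s`
        have hp2dm : (p : ℤ) ^ 2 ∣ n * s ^ 2 := by
          rw [← hdm, sq]; exact mul_dvd_mul hpD hpm
        have hpn : ¬ (p : ℤ) ^ 2 ∣ n := not_sq_dvd_of_isFundamental_of_odd hn hp hp2
        have hpZ : Prime (p : ℤ) := Nat.prime_iff_prime_int.mp hp
        have hps : (p : ℤ) ∣ s := by
          by_contra hps
          have hcop : IsCoprime ((p : ℤ) ^ 2) (s ^ 2) :=
            ((hpZ.coprime_iff_not_dvd).mpr hps).pow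
          exact hpn (hcop.dvd_of_dvd_mul_right hp2dm)
        exact dvd_mul_of_dvd_right hps _
      · -- `p ∤ d_K`: `p ∣ f` since otherwise `√m ∉ K[f]`
        by_contra hpfs
        have hpf : ¬ p ∣ f := fun h => hpfs (dvd_mul_of_dvd_left (Int.natCast_dvd_natCast.mpr h) _)
        have hp2m : ¬ (p : ℤ) ^ 2 ∣ m := fun h2 => by
          have hu : IsUnit (p : ℤ) := hmsq (p : ℤ) (by rw [← sq]; exact h2)
          rw [Int.isUnit_iff_natAbs_eq, Int.natAbs_natCast] at hu
          exact hp.one_lt.ne' hu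
        exact sqrt_intCast_not_mem_ringClassField hK ι hf hp hpm hp2m hpf hpD (r : ℂ) hrC r.2
    -- `m n s² = d m² ∣ d f² s²`
    have h1 : m * n * s ^ 2 = NumberField.discr K * m ^ 2 := by
      linear_combination m * hdm.symm
    have h2 : NumberField.discr K * m ^ 2 ∣ NumberField.discr K * ((f : ℤ) * s) ^ 2 :=
      mul_dvd_mul_left _ (pow_dvd_pow_of_dvd hmfs 2)
    rw [← h1, show NumberField.discr K * ((f : ℤ) * s) ^ 2 =
      NumberField.discr K * (f : ℤ) ^ 2 * s ^ 2 by ring] at h2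
    exact (mul_dvd_mul_iff_right (pow_ne_zero 2 hs0)).mp h2
  · -- (⟸)
    intro hdvd
    have hmdf : m ∣ (f : ℤ) ^ 2 * NumberField.discr K := by
      rw [mul_comm]; exact (dvd_mul_right m n).trans hdvd
    obtain ⟨r, hr⟩ := IsAlgClosed.exists_pow_nat_eq (m : ℂ) two_pos
    refine ⟨⟨r, sqrt_intCast_mem_ringClassField_of_dvd_sq_mul_discr hK ι hm4 hmsq hf hmdf hr⟩,
      Subtype.ext ?_⟩
    simpa using hr

/-- **Voight 2007, Prop. 3.8, PROVED for `d_K` odd and `f` odd, EVERY fundamental discriminant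
`m`**: `(∃ r ∈ K[f], r² = m) ↔ m n ∣ d_K f²` (`d_K m = n s²`). For odd `m` this is
`prop38_sqrt_mem_ringClassField_iff_of_odd`; for even `m = 4e` (`e ≡ 2, 3 (mod 4)` square-free) both
sides are false: `4 ∤ d_K f²`, and `√m = 2√e ∉ K[f]` since `2` is unramified in `K[f]`
(`sqrt_not_mem_ringClassField_of_emod_four_eq_three`, `…_of_emod_four_eq_two`; Cor. 3.9: for
`d ≡ 1 (mod 4)` and odd `f`, `P_(f) = K*` has no dyadic part).
[cite: Voight2007, §3 Prop. 3.8 and Cor. 3.9] [cite: Cox2013, §9.A (p. 180) and Thm. 9.2] -/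
theorem prop38_sqrt_mem_ringClassField_iff_of_odd_discr_of_odd (K : Type) [Field K] [NumberField K]
    (hK : IsImaginaryQuadratic K) (ι : K →+* ℂ) (hD2 : ¬ (2 : ℤ) ∣ NumberField.discr K) {f : ℕ}
    (hf : f ≠ 0) (hf2 : ¬ 2 ∣ f) {m n s : ℤ}
    (hm : (m % 4 = 1 ∧ Squarefree m ∧ m ≠ 1) ∨
      (4 ∣ m ∧ (m / 4 % 4 = 2 ∨ m / 4 % 4 = 3) ∧ Squarefree (m / 4)))
    (hn : ((n % 4 = 1 ∧ Squarefree n ∧ n ≠ 1) ∨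
      (4 ∣ n ∧ (n / 4 % 4 = 2 ∨ n / 4 % 4 = 3) ∧ Squarefree (n / 4))) ∨ n = 1)
    (hdm : NumberField.discr K * m = n * s ^ 2) :
    (∃ r : ringClassField K ι f, r ^ 2 = (m : ringClassField K ι f)) ↔
      m * n ∣ NumberField.discr K * (f : ℤ) ^ 2 := by
  rcases hm with hm | ⟨⟨e, he⟩, he4, -⟩
  · exact prop38_sqrt_mem_ringClassField_iff_of_odd K hK ι hf hm hn hdm
  have hme : m / 4 = e := by rw [he, Int.mul_ediv_cancel_left _ four_ne_zero]
  rw [hme] at he4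
  constructor
  · -- `√m = 2√e ∈ K[f]` is impossible
    rintro ⟨r, hr⟩
    exfalso
    have hrC : (r : ℂ) ^ 2 = (m : ℂ) := by
      have := congrArg Subtype.val hr
      simpa using this
    have hr2 : ((r : ℂ) / 2) ^ 2 = (e : ℂ) := by
      rw [div_pow, hrC, he]; push_cast; ring
    have hmem : (r : ℂ) / 2 ∈ ringClassField K ι f :=
      div_mem r.2 (by exact_mod_cast natCast_mem (ringClassField K ι f) 2)
    rcases he4 with he2 | he3
    · exact sqrt_not_mem_ringClassField_of_emod_four_eq_two hK ι hD2 hf hf2 he2 hr2 hmem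
    · exact sqrt_not_mem_ringClassField_of_emod_four_eq_three hK ι hD2 hf hf2 he3 hr2 hmem
  · -- `4 ∣ m n` but `d_K f²` is odd
    intro hdvd
    exfalso
    have h4 : (4 : ℤ) ∣ NumberField.discr K * (f : ℤ) ^ 2 :=
      (Dvd.intro _ he.symm).trans ((dvd_mul_right m n).trans hdvd)
    have hDodd : Odd (NumberField.discr K) := Int.odd_iff.mpr (by omega)
    have hfodd : Odd ((f : ℤ) ^ 2) := (Int.odd_iff.mpr (by omega : (f : ℤ) % 2 = 1)).pow
    have hodd := Int.odd_iff.mp (Int.odd_mul.mpr ⟨hDodd, hfodd⟩)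
    omega

end Voight2007

/-! ### Degrees in the dyadic tower `K[g] ⊆ K[2g] ⊆ K[4g]` (Cox Cor. 7.28 at `m = 2`) -/

/-- `h(𝒪_{2g}) = c · h(𝒪_g)` with `c ∈ {1, 3}` odd, for `d_K` odd and `g` odd (Cox Cor. 7.28 with
`m = 2`: the factor is `2 − (d_K/2) ∈ {1, 3}` divided by the unit index, which is `1`, or `3` when
`g = 1`, `d_K = −3`). [cite: Cox2013, §7.D Cor. 7.28, p. 148] -/
private theorem card_ringClassGroup_two_mul_of_odd (hK : IsImaginaryQuadratic K)
    (hD2 : ¬ (2 : ℤ) ∣ NumberField.discr K) {g : ℕ} (hg : g ≠ 0) (hg2 : ¬ 2 ∣ g) :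
    ∃ c : ℕ, Odd c ∧ Nat.card (RingClassGroup K (2 * g)) = c * Nat.card (RingClassGroup K g) := by
  classical
  have h2 := hK.1
  have hd := hK.discr_neg
  have hD4 := discr_emod_four h2
  have hD8 : NumberField.discr K % 8 = 1 ∨ NumberField.discr K % 8 = 5 := by omega
  by_cases hg1 : 2 ≤ g
  · have H := card_ringClassGroup_mul_conductor_of_two_le h2 hd hg1 two_ne_zero
    rw [Nat.Prime.primeFactors Nat.prime_two, Finset.prod_singleton,
      Nat.Prime.factorization_self Nat.prime_two, if_neg hg2, if_pos rfl, Nat.sub_self, pow_zero,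
      one_mul] at H
    rcases hD8 with h8 | h8
    · refine ⟨1, odd_one, ?_⟩
      rw [if_pos h8] at H
      have H' : ((Nat.card (RingClassGroup K (2 * g)) : ℕ) : ℤ) =
          ((1 * Nat.card (RingClassGroup K g) : ℕ) : ℤ) := by rw [H]; push_cast; ring
      exact_mod_cast H'
    · refine ⟨3, by decide, ?_⟩
      rw [if_neg (by omega), if_pos h8] at H
      have H' : ((Nat.card (RingClassGroup K (2 * g)) : ℕ) : ℤ) =
          ((3 * Nat.card (RingClassGroup K g) : ℕ) : ℤ) := by rw [H]; push_cast; ring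
      exact_mod_cast H'
  · obtain rfl : g = 1 := by omega
    have H := card_ringClassGroup_mul_conductor h2 hd one_ne_zero two_ne_zero
    obtain ⟨b, hb⟩ := exists_basis_zero_eq_one h2
    have hω := basis_one_mul_self_eq b hb
    have hdK := discr_eq_sq_add_four_mul b hb
    have hneg : (b.repr (b 1 * b 1) 1) ^ 2 + 4 * (b.repr (b 1 * b 1) 0) < 0 := hdK ▸ hd
    have hU2 : Nat.card {ε : (𝓞 K)ˣ // ∃ n : ℤ, IsCoprime n ((2 * 1 : ℕ) : ℤ) ∧
        (ε : 𝓞 K) - n ∈ Ideal.span {((2 * 1 : ℕ) : 𝓞 K)}} = 2 :=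
      card_orderUnits_eq_two b hb hω hneg (f := 2 * 1) (by norm_num)
    have hU1 : Nat.card {ε : (𝓞 K)ˣ // ∃ n : ℤ, IsCoprime n ((1 : ℕ) : ℤ) ∧
        (ε : 𝓞 K) - n ∈ Ideal.span {((1 : ℕ) : 𝓞 K)}} = Nat.card (𝓞 K)ˣ :=
      Nat.card_congr (Equiv.subtypeUnivEquiv fun ε => ⟨0, isCoprime_one_right, by simp⟩)
    rw [hU1, hU2, card_units_eq b hb hω hneg, Nat.Prime.primeFactors Nat.prime_two,
      Finset.prod_singleton, Nat.Prime.factorization_self Nat.prime_two,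
      if_neg (by omega : ¬ 2 ∣ 1), if_pos rfl, Nat.sub_self, pow_zero, one_mul, ← hdK] at H
    simp only [mul_one] at H ⊢
    have hD4' : NumberField.discr K ≠ -4 := by omega
    rw [if_neg hD4'] at H
    push_cast at H
    by_cases hD3 : NumberField.discr K = -3
    · refine ⟨1, odd_one, ?_⟩
      rw [if_pos hD3, if_neg (by omega), if_pos (by omega)] at H
      have H' : ((Nat.card (RingClassGroup K 2) : ℕ) : ℤ) =
          ((1 * Nat.card (RingClassGroup K 1) : ℕ) : ℤ) := by push_cast; linarith
      exact_mod_cast H'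
    · rw [if_neg hD3] at H
      rcases hD8 with h8 | h8
      · refine ⟨1, odd_one, ?_⟩
        rw [if_pos h8] at H
        have H' : ((Nat.card (RingClassGroup K 2) : ℕ) : ℤ) =
            ((1 * Nat.card (RingClassGroup K 1) : ℕ) : ℤ) := by push_cast; linarith
        exact_mod_cast H'
      · refine ⟨3, by decide, ?_⟩
        rw [if_neg (by omega), if_pos h8] at H
        have H' : ((Nat.card (RingClassGroup K 2) : ℕ) : ℤ) =
            ((3 * Nat.card (RingClassGroup K 1) : ℕ) : ℤ) := by push_cast; linarith
        exact_mod_cast H'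

/-- `h(𝒪_{2g}) = 2 · h(𝒪_g)` for `g` even (Cox Cor. 7.28 with `m = 2 ∣ g`).
[cite: Cox2013, §7.D Cor. 7.28, p. 148] -/
private theorem card_ringClassGroup_two_mul_of_even (hK : IsImaginaryQuadratic K)
    {g : ℕ} (hg : g ≠ 0) (hg2 : 2 ∣ g) :
    Nat.card (RingClassGroup K (2 * g)) = 2 * Nat.card (RingClassGroup K g) := by
  classical
  have hg1 : 2 ≤ g := Nat.le_of_dvd (Nat.pos_of_ne_zero hg) hg2
  have H := card_ringClassGroup_mul_conductor_of_two_le hK.1 hK.discr_neg hg1 two_ne_zero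
  rw [Nat.Prime.primeFactors Nat.prime_two, Finset.prod_singleton,
    Nat.Prime.factorization_self Nat.prime_two, if_pos hg2, Nat.sub_self, pow_zero, one_mul,
    sub_zero] at H
  have H' : ((Nat.card (RingClassGroup K (2 * g)) : ℕ) : ℤ) =
      ((2 * Nat.card (RingClassGroup K g) : ℕ) : ℤ) := by rw [H]; push_cast; ring
  exact_mod_cast H'

/-- **`[K[2g] : K[g]]` is odd (`= 1` or `3`) for `d_K` odd and `g` odd.**
[cite: Cox2013, §7.D Cor. 7.28, §9.A (degrees = class numbers)] -/
theorem odd_finrank_subfieldIn_two_mul (hK : IsImaginaryQuadratic K) (ι : K →+* ℂ)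
    (hD2 : ¬ (2 : ℤ) ∣ NumberField.discr K) {g n : ℕ} (hn : n = 2 * g) (hg : g ≠ 0)
    (hg2 : ¬ 2 ∣ g) :
    Odd (finrank (RingClassField.subfieldIn ι n g) (ringClassField K ι n)) := by
  have hn0 : n ≠ 0 := by rw [hn]; exact mul_ne_zero two_ne_zero hg
  haveI := (finiteDimensional_and_isGalois_ringClassField hK ι hg).1
  obtain ⟨c, hc, hcard⟩ := card_ringClassGroup_two_mul_of_odd hK hD2 hg hg2
  have hcard' : Nat.card (RingClassGroup K n) = c * Nat.card (RingClassGroup K g) := by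
    rw [hn]; exact hcard
  have h := RingClassField.finrank_subfieldIn_mul_finrank hK ι (show g ∣ n from ⟨2, by omega⟩) hn0
  rw [finrank_ringClassField_eq_card_ringClassGroup hK ι hn0, hcard',
    ← finrank_ringClassField_eq_card_ringClassGroup hK ι hg] at h
  rw [Nat.eq_of_mul_eq_mul_right Module.finrank_pos h]
  exact hc

/-- **`[K[2g] : K[g]] = 2` for `g` even.** [cite: Cox2013, §7.D Cor. 7.28, §9.A (degrees = class numbers)] -/
theorem finrank_subfieldIn_two_mul_of_even (hK : IsImaginaryQuadratic K) (ι : K →+* ℂ)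
    {g n : ℕ} (hn : n = 2 * g) (hg : g ≠ 0) (hg2 : 2 ∣ g) :
    finrank (RingClassField.subfieldIn ι n g) (ringClassField K ι n) = 2 := by
  have hn0 : n ≠ 0 := by rw [hn]; exact mul_ne_zero two_ne_zero hg
  haveI := (finiteDimensional_and_isGalois_ringClassField hK ι hg).1
  have hcard' : Nat.card (RingClassGroup K n) = 2 * Nat.card (RingClassGroup K g) := by
    rw [hn]; exact card_ringClassGroup_two_mul_of_even hK hg hg2
  have h := RingClassField.finrank_subfieldIn_mul_finrank hK ι (show g ∣ n from ⟨2, by omega⟩) hn0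
  rw [finrank_ringClassField_eq_card_ringClassGroup hK ι hn0, hcard',
    ← finrank_ringClassField_eq_card_ringClassGroup hK ι hg] at h
  exact Nat.eq_of_mul_eq_mul_right Module.finrank_pos h

/-- Membership in `K[n] ∩ K[m] ⊆ K[n]` as membership in the range of the algebra map. [folklore] -/
private theorem mem_range_algebraMap_subfieldIn_iff (ι : K →+* ℂ) (n m : ℕ)
    (x : ringClassField K ι n) :
    x ∈ Set.range (algebraMap (RingClassField.subfieldIn ι n m) (ringClassField K ι n)) ↔
      (x : ℂ) ∈ ringClassField K ι m := by
  rw [← RingClassField.mem_subfieldIn_iff ι n m x]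
  constructor
  · rintro ⟨y, rfl⟩
    exact y.2
  · intro hx
    exact ⟨⟨x, hx⟩, rfl⟩

/-- In a quadratic Galois extension `E/F`, the product of two elements of `E ∖ F` whose squares lie
in `F` lies in `F` (both are negated by the non-trivial automorphism). [folklore] -/
private theorem mul_mem_range_of_sq_mem_range {F E : Type*} [Field F] [Field E] [Algebra F E]
    [FiniteDimensional F E] [IsGalois F E] (h2 : finrank F E = 2) {x y : E}
    (hx : x ∉ Set.range (algebraMap F E)) (hx2 : x ^ 2 ∈ Set.range (algebraMap F E))
    (hy : y ∉ Set.range (algebraMap F E)) (hy2 : y ^ 2 ∈ Set.range (algebraMap F E)) :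
    x * y ∈ Set.range (algebraMap F E) := by
  have hcard : Nat.card (E ≃ₐ[F] E) = 2 := by rw [IsGalois.card_aut_eq_finrank, h2]
  obtain ⟨σ, -, hσuniq⟩ := (Nat.card_eq_two_iff' (1 : E ≃ₐ[F] E)).mp hcard
  have hall : ∀ τ : E ≃ₐ[F] E, τ = 1 ∨ τ = σ := fun τ => by
    by_cases h : τ = 1
    · exact Or.inl h
    · exact Or.inr (hσuniq τ h)
  have hneg : ∀ z : E, z ∉ Set.range (algebraMap F E) → z ^ 2 ∈ Set.range (algebraMap F E) →
      σ z = -z := by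
    intro z hz hz2
    have hsq : (σ z) ^ 2 = z ^ 2 := by
      obtain ⟨a, ha⟩ := hz2
      rw [← map_pow, ← ha, AlgEquiv.commutes]
    rcases sq_eq_sq_iff_eq_or_eq_neg.mp hsq with h | h
    · exfalso
      apply hz
      rw [IsGalois.mem_range_algebraMap_iff_fixed]
      intro τ
      rcases hall τ with rfl | rfl
      · rfl
      · exact h
    · exact h
  rw [IsGalois.mem_range_algebraMap_iff_fixed]
  intro τ
  rcases hall τ with rfl | rfl
  · rfl
  · rw [map_mul, hneg x hx hx2, hneg y hy hy2, neg_mul_neg]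

/-- **`√c ∉ K[2g]` for `c ≡ 2, 3 (mod 4)`, `d_K` odd, `g` odd** (Cor. 3.9's exactness at
`f ≡ 2 (mod 4)`: `√−1 ∉ K[f]`, `√±2 ∉ K[f]`, `√±2m₀ ∉ K[f]`): `[K[2g] : K[g]]` is odd, so a square
root of an element of `K[g]` lying in `K[2g]` lies in `K[g]`, which is excluded for odd `g`
(`sqrt_not_mem_ringClassField_of_emod_four_eq_three/_two`). [cite: Voight2007, §3 Cor. 3.9–3.10]
[cite: Cox2013, §7.D Cor. 7.28] -/
theorem sqrt_not_mem_ringClassField_two_mul_of_odd_discr (hK : IsImaginaryQuadratic K)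
    (ι : K →+* ℂ) (hD2 : ¬ (2 : ℤ) ∣ NumberField.discr K) {g n : ℕ} (hn : n = 2 * g) (hg : g ≠ 0)
    (hg2 : ¬ 2 ∣ g) {c : ℤ} (hc : c % 4 = 2 ∨ c % 4 = 3) {r : ℂ} (hr : r ^ 2 = (c : ℂ)) :
    r ∉ ringClassField K ι n := by
  intro hrn
  have hrg : r ∉ ringClassField K ι g := by
    rcases hc with hc | hc
    · exact sqrt_not_mem_ringClassField_of_emod_four_eq_two hK ι hD2 hg hg2 hc hr
    · exact sqrt_not_mem_ringClassField_of_emod_four_eq_three hK ι hD2 hg hg2 hc hr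
  have hn0 : n ≠ 0 := by rw [hn]; exact mul_ne_zero two_ne_zero hg
  haveI := (finiteDimensional_and_isGalois_ringClassField hK ι hn0).1
  set r' : ringClassField K ι n := ⟨r, hrn⟩ with hr'def
  have hr'2 : r' ^ 2 = ((c : RingClassField.subfieldIn ι n g) : ringClassField K ι n) :=
    Subtype.ext (by simp [hr'def, hr])
  have hr'F : r' ∉ Set.range (algebraMap (RingClassField.subfieldIn ι n g)
      (ringClassField K ι n)) := fun h =>
    hrg ((mem_range_algebraMap_subfieldIn_iff ι _ _ r').mp h)
  -- `[F(r') : F] = 2` for `F = K[g] ⊆ K[n]`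
  have hmonic : (X ^ 2 - C (c : RingClassField.subfieldIn ι n g)).Monic := by monicity!
  have haeval : aeval r' (X ^ 2 - C (c : RingClassField.subfieldIn ι n g)) = 0 := by
    simp [hr'2]
  have hint : IsIntegral (RingClassField.subfieldIn ι n g) r' :=
    ⟨_, hmonic, by simpa [aeval_def] using haeval⟩
  have hdeg : finrank (RingClassField.subfieldIn ι n g)
      (RingClassField.subfieldIn ι n g)⟮r'⟯ = 2 := by
    rw [adjoin.finrank hint]
    have hle : (minpoly (RingClassField.subfieldIn ι n g) r').natDegree ≤ 2 := by
      have h1 := minpoly.min (RingClassField.subfieldIn ι n g) r' hmonic haeval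
      rw [degree_X_pow_sub_C (by norm_num)] at h1
      exact natDegree_le_iff_degree_le.mpr h1
    have hne1 : (minpoly (RingClassField.subfieldIn ι n g) r').natDegree ≠ 1 := by
      intro h1
      apply hr'F
      exact minpoly.natDegree_eq_one_iff.mp h1
    have hpos : 0 < (minpoly (RingClassField.subfieldIn ι n g) r').natDegree :=
      minpoly.natDegree_pos hint
    omega
  haveI : Module.Free ((RingClassField.subfieldIn ι n g)⟮r'⟯) (ringClassField K ι n) :=
    Module.Free.of_divisionRing _ _
  haveI : Module.Free (RingClassField.subfieldIn ι n g) ((RingClassField.subfieldIn ι n g)⟮r'⟯) :=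
    Module.Free.of_divisionRing _ _
  have htower := Module.finrank_mul_finrank (RingClassField.subfieldIn ι n g)
    ((RingClassField.subfieldIn ι n g)⟮r'⟯) (ringClassField K ι n)
  have hodd := odd_finrank_subfieldIn_two_mul hK ι hD2 hn hg hg2
  rw [← htower, hdeg] at hodd
  exact Nat.not_even_iff_odd.mpr hodd (even_two_mul _)

/-- **`√c ∉ K[4g]` for `c ≡ 2 (mod 4)`, `d_K` odd, `g` odd** (Cor. 3.9: `√±2 ∈ P_(f)` iff `8 ∣ f`;
here `f ≡ 4 (mod 8)`): `K[4g]/K[2g]` is a quadratic extension containing `√−1 ∉ K[2g]`; if it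
contained `√c ∉ K[2g]`, the product `√−c` would lie in `K[2g]`, but `−c ≡ 2 (mod 4)` too.
[cite: Voight2007, §3 Cor. 3.9–3.10] [cite: Cox2013, §7.D Cor. 7.28] -/
theorem sqrt_not_mem_ringClassField_four_mul_of_odd_discr (hK : IsImaginaryQuadratic K)
    (ι : K →+* ℂ) (hD2 : ¬ (2 : ℤ) ∣ NumberField.discr K) {g n : ℕ} (hn : n = 4 * g) (hg : g ≠ 0)
    (hg2 : ¬ 2 ∣ g) {c : ℤ} (hc : c % 4 = 2) {r : ℂ} (hr : r ^ 2 = (c : ℂ)) :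
    r ∉ ringClassField K ι n := by
  intro hrn
  -- `k = 2g`, `n = 2k`
  obtain ⟨k, hk⟩ : ∃ k, k = 2 * g := ⟨_, rfl⟩
  have hnk : n = 2 * k := by rw [hn, hk]; ring
  have hk0 : k ≠ 0 := by rw [hk]; exact mul_ne_zero two_ne_zero hg
  have hn0 : n ≠ 0 := by rw [hnk]; exact mul_ne_zero two_ne_zero hk0
  -- `i = √−1 ∈ K[n]`, and `i, r, i r ∉ K[k]`
  have hi : Complex.I ^ 2 = ((-1 : ℤ) : ℂ) := by simp
  have hin : Complex.I ∈ ringClassField K ι n :=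
    sqrt_neg_one_mem_ringClassField_of_four_dvd hK ι hn0 ⟨g, hn⟩ Complex.I_sq
  have hik : Complex.I ∉ ringClassField K ι k :=
    sqrt_not_mem_ringClassField_two_mul_of_odd_discr hK ι hD2 hk hg hg2 (c := -1)
      (Or.inr (by norm_num)) hi
  have hrk : r ∉ ringClassField K ι k :=
    sqrt_not_mem_ringClassField_two_mul_of_odd_discr hK ι hD2 hk hg hg2 (Or.inl hc) hr
  have hir : (Complex.I * r) ^ 2 = ((-c : ℤ) : ℂ) := by
    rw [mul_pow, hr, Complex.I_sq]; push_cast; ring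
  have hirk : Complex.I * r ∉ ringClassField K ι k :=
    sqrt_not_mem_ringClassField_two_mul_of_odd_discr hK ι hD2 hk hg hg2 (c := -c)
      (Or.inl (by omega)) hir
  -- the quadratic Galois extension `K[n]/K[k]`
  haveI := (finiteDimensional_and_isGalois_ringClassField hK ι hn0).1
  haveI := (finiteDimensional_and_isGalois_ringClassField hK ι hn0).2
  have hdegF : finrank (RingClassField.subfieldIn ι n k) (ringClassField K ι n) = 2 :=
    finrank_subfieldIn_two_mul_of_even hK ι hnk hk0 ⟨g, hk⟩
  set i' : ringClassField K ι n := ⟨Complex.I, hin⟩ with hi'def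
  set r' : ringClassField K ι n := ⟨r, hrn⟩ with hr'def
  have hi'F : i' ∉ Set.range (algebraMap (RingClassField.subfieldIn ι n k)
      (ringClassField K ι n)) := fun h =>
    hik ((mem_range_algebraMap_subfieldIn_iff ι _ _ i').mp h)
  have hr'F : r' ∉ Set.range (algebraMap (RingClassField.subfieldIn ι n k)
      (ringClassField K ι n)) := fun h =>
    hrk ((mem_range_algebraMap_subfieldIn_iff ι _ _ r').mp h)
  have hi'2 : i' ^ 2 ∈ Set.range (algebraMap (RingClassField.subfieldIn ι n k)
      (ringClassField K ι n)) :=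
    ⟨((-1 : ℤ) : RingClassField.subfieldIn ι n k), Subtype.ext (by simp [hi'def])⟩
  have hr'2 : r' ^ 2 ∈ Set.range (algebraMap (RingClassField.subfieldIn ι n k)
      (ringClassField K ι n)) :=
    ⟨((c : ℤ) : RingClassField.subfieldIn ι n k), Subtype.ext (by simp [hr'def, hr])⟩
  have hprod := mul_mem_range_of_sq_mem_range hdegF hi'F hi'2 hr'F hr'2
  exact hirk ((mem_range_algebraMap_subfieldIn_iff ι _ _ (i' * r')).mp hprod)

/-! ### Arithmetic of the square class `d_K m = n s²` -/

/-- `m n ∣ d f² ↔ m ∣ f s` when `d m = n s²` (`d, s ≠ 0`): both say `d m² ∣ d f² s²`. [folklore] -/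
private theorem mul_dvd_mul_sq_iff_dvd_mul {d m n s : ℤ} (hdm : d * m = n * s ^ 2) (hd : d ≠ 0)
    (hs : s ≠ 0) (f : ℤ) : m * n ∣ d * f ^ 2 ↔ m ∣ f * s := by
  have h1 : m * n * s ^ 2 = d * m ^ 2 := by linear_combination m * hdm.symm
  constructor
  · intro h
    have h2 : m * n * s ^ 2 ∣ d * f ^ 2 * s ^ 2 := mul_dvd_mul_right h _
    rw [h1, show d * f ^ 2 * s ^ 2 = d * (f * s) ^ 2 by ring] at h2
    exact (Int.pow_dvd_pow_iff two_ne_zero).mp ((mul_dvd_mul_iff_left hd).mp h2)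
  · intro h
    have h2 : d * m ^ 2 ∣ d * (f * s) ^ 2 := mul_dvd_mul_left d (pow_dvd_pow_of_dvd h 2)
    rw [← h1, show d * (f * s) ^ 2 = d * f ^ 2 * s ^ 2 by ring] at h2
    exact (mul_dvd_mul_iff_right (pow_ne_zero 2 hs)).mp h2

/-- For `d_K m = n s²` (`m` fundamental, `n` fundamental or `1`) and an odd prime `p ∣ m`:
`p ∣ s ↔ p ∣ d_K`. [folklore] -/
private theorem prime_dvd_iff_prime_dvd_of_sq_class {D m n s : ℤ}
    (hm : (m % 4 = 1 ∧ Squarefree m ∧ m ≠ 1) ∨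
      (4 ∣ m ∧ (m / 4 % 4 = 2 ∨ m / 4 % 4 = 3) ∧ Squarefree (m / 4)))
    (hn : ((n % 4 = 1 ∧ Squarefree n ∧ n ≠ 1) ∨
      (4 ∣ n ∧ (n / 4 % 4 = 2 ∨ n / 4 % 4 = 3) ∧ Squarefree (n / 4))) ∨ n = 1)
    (hdm : D * m = n * s ^ 2) {p : ℕ} (hp : p.Prime) (hp2 : p ≠ 2) (hpm : (p : ℤ) ∣ m) :
    (p : ℤ) ∣ s ↔ (p : ℤ) ∣ D := by
  have hpZ : Prime (p : ℤ) := Nat.prime_iff_prime_int.mp hp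
  constructor
  · intro hps
    by_contra hpD
    have hp2dm : (p : ℤ) ^ 2 ∣ D * m := by
      rw [hdm]; exact dvd_mul_of_dvd_right (pow_dvd_pow_of_dvd hps 2) n
    have hcop : IsCoprime ((p : ℤ) ^ 2) D := ((hpZ.coprime_iff_not_dvd).mpr hpD).pow_left
    exact not_sq_dvd_of_isFundamental_of_odd (Or.inl hm) hp hp2 (hcop.dvd_of_dvd_mul_left hp2dm)
  · intro hpD
    have hp2dm : (p : ℤ) ^ 2 ∣ n * s ^ 2 := by
      rw [← hdm, sq]; exact mul_dvd_mul hpD hpm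
    have hpn : ¬ (p : ℤ) ^ 2 ∣ n := not_sq_dvd_of_isFundamental_of_odd hn hp hp2
    by_contra hps
    have hcop : IsCoprime ((p : ℤ) ^ 2) (s ^ 2) := ((hpZ.coprime_iff_not_dvd).mpr hps).pow
    exact hpn (hcop.dvd_of_dvd_mul_right hp2dm)

/-- For `d_K m = n s²` as above and an odd square-free `e ∣ m`: `e ∣ f s ↔ e ∣ f² d_K`. [folklore] -/
private theorem odd_dvd_mul_iff_dvd_sq_mul {D m n s : ℤ}
    (hm : (m % 4 = 1 ∧ Squarefree m ∧ m ≠ 1) ∨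
      (4 ∣ m ∧ (m / 4 % 4 = 2 ∨ m / 4 % 4 = 3) ∧ Squarefree (m / 4)))
    (hn : ((n % 4 = 1 ∧ Squarefree n ∧ n ≠ 1) ∨
      (4 ∣ n ∧ (n / 4 % 4 = 2 ∨ n / 4 % 4 = 3) ∧ Squarefree (n / 4))) ∨ n = 1)
    (hdm : D * m = n * s ^ 2) {e : ℤ} (he : Squarefree e) (he2 : ¬ (2 : ℤ) ∣ e) (hem : e ∣ m)
    (f : ℤ) : e ∣ f * s ↔ e ∣ f ^ 2 * D := by
  constructor
  · intro h
    refine dvd_of_squarefree_of_forall_prime_dvd he fun p hp hpe => ?_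
    have hp2 : p ≠ 2 := by rintro rfl; exact he2 hpe
    have hpZ : Prime (p : ℤ) := Nat.prime_iff_prime_int.mp hp
    rcases hpZ.dvd_or_dvd (hpe.trans h) with hpf | hps
    · exact dvd_mul_of_dvd_left (dvd_pow hpf two_ne_zero) D
    · exact dvd_mul_of_dvd_right
        ((prime_dvd_iff_prime_dvd_of_sq_class hm hn hdm hp hp2 (hpe.trans hem)).mp hps) _
  · intro h
    refine dvd_of_squarefree_of_forall_prime_dvd he fun p hp hpe => ?_
    have hp2 : p ≠ 2 := by rintro rfl; exact he2 hpe
    have hpZ : Prime (p : ℤ) := Nat.prime_iff_prime_int.mp hp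
    rcases hpZ.dvd_or_dvd (hpe.trans h) with hpf | hpD
    · exact dvd_mul_of_dvd_left (hpZ.dvd_of_dvd_pow hpf) s
    · exact dvd_mul_of_dvd_right
        ((prime_dvd_iff_prime_dvd_of_sq_class hm hn hdm hp hp2 (hpe.trans hem)).mpr hpD) _

/-- `n t² ≢ 2, 3 (mod 4)` for `n ≡ 0, 1 (mod 4)`. [folklore] -/
private theorem mul_sq_emod_four {n t : ℤ} (hn : n % 4 = 0 ∨ n % 4 = 1) :
    (n * t ^ 2) % 4 = 0 ∨ (n * t ^ 2) % 4 = 1 := by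
  have ht : t ^ 2 % 4 = 0 ∨ t ^ 2 % 4 = 1 := by
    rcases Int.even_or_odd t with ⟨u, rfl⟩ | ⟨u, rfl⟩
    · left
      have : (u + u) ^ 2 = 4 * u ^ 2 := by ring
      omega
    · right
      have : (2 * u + 1) ^ 2 = 4 * (u ^ 2 + u) + 1 := by ring
      omega
  rw [Int.mul_emod]
  rcases hn with hn | hn <;> rcases ht with ht | ht <;> rw [hn, ht] <;> norm_num

/-- For `d_K` odd, `s` is odd: `d_K m = n s²` with `m` fundamental and `n` fundamental or `1`
(the dyadic parts of `m` and `n` agree). [folklore] -/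
private theorem not_two_dvd_of_sq_class_of_odd {D m n s : ℤ} (hD4 : D % 4 = 1)
    (hm : (m % 4 = 1 ∧ Squarefree m ∧ m ≠ 1) ∨
      (4 ∣ m ∧ (m / 4 % 4 = 2 ∨ m / 4 % 4 = 3) ∧ Squarefree (m / 4)))
    (hn : ((n % 4 = 1 ∧ Squarefree n ∧ n ≠ 1) ∨
      (4 ∣ n ∧ (n / 4 % 4 = 2 ∨ n / 4 % 4 = 3) ∧ Squarefree (n / 4))) ∨ n = 1)
    (hdm : D * m = n * s ^ 2) : ¬ (2 : ℤ) ∣ s := by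
  have hn4 : n % 4 = 0 ∨ n % 4 = 1 := by
    rcases hn with (⟨h, -, -⟩ | ⟨⟨k, hk⟩, -, -⟩) | rfl
    · exact Or.inr h
    · left; omega
    · right; norm_num
  rintro ⟨t, rfl⟩
  rcases hm with ⟨hm4, -, -⟩ | ⟨⟨e, rfl⟩, he4, -⟩
  · -- `D m` odd `= 4 n t²`
    have h1 : (D * m) % 4 = 1 := by rw [Int.mul_emod, hD4, hm4]; norm_num
    have h2 : D * m = 4 * (n * t ^ 2) := by rw [hdm]; ring
    omega
  · have he : 4 * e / 4 = e := Int.mul_ediv_cancel_left _ four_ne_zero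
    rw [he] at he4
    have h1 : D * e = n * t ^ 2 := by
      have h := hdm
      have : D * (4 * e) = 4 * (D * e) := by ring
      rw [this, show n * (2 * t) ^ 2 = 4 * (n * t ^ 2) by ring] at h
      linarith
    have h2 : (D * e) % 4 = 2 ∨ (D * e) % 4 = 3 := by
      rw [Int.mul_emod, hD4]
      rcases he4 with h | h <;> rw [h] <;> norm_num
    have h3 := mul_sq_emod_four (t := t) hn4
    rw [← h1] at h3
    omega

/-! ### Prop. 3.8 for `d_K` odd, all conductors -/

/-- **For `d_K` odd: a square root in `K[f]` of `c ≡ 2, 3 (mod 4)` forces `4 ∣ f`** (`f` odd and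
`f ≡ 2 (mod 4)` are excluded by `sqrt_not_mem_ringClassField_of_emod_four_eq_*` and
`sqrt_not_mem_ringClassField_two_mul_of_odd_discr`). [cite: Voight2007, §3 Cor. 3.9–3.10] -/
theorem four_dvd_of_sqrt_mem_ringClassField_of_odd_discr (hK : IsImaginaryQuadratic K) (ι : K →+* ℂ)
    (hD2 : ¬ (2 : ℤ) ∣ NumberField.discr K) {f : ℕ} (hf : f ≠ 0) {c : ℤ}
    (hc : c % 4 = 2 ∨ c % 4 = 3) {r : ℂ} (hr : r ^ 2 = (c : ℂ)) (h : r ∈ ringClassField K ι f) :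
    4 ∣ f := by
  by_contra h4
  by_cases h2 : 2 ∣ f
  · have hf2 : f = 2 * (f / 2) := (Nat.mul_div_cancel' h2).symm
    have hg2 : ¬ 2 ∣ f / 2 := fun h' => h4 (by omega)
    exact sqrt_not_mem_ringClassField_two_mul_of_odd_discr hK ι hD2 hf2 (by omega) hg2 hc hr h
  · rcases hc with hc | hc
    · exact sqrt_not_mem_ringClassField_of_emod_four_eq_two hK ι hD2 hf h2 hc hr h
    · exact sqrt_not_mem_ringClassField_of_emod_four_eq_three hK ι hD2 hf h2 hc hr h

/-- **For `d_K` odd: a square root in `K[f]` of `c ≡ 2 (mod 4)` forces `8 ∣ f`** (Cor. 3.9: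
`√±2 ∈ P_(f)` iff `8 ∣ f`). [cite: Voight2007, §3 Cor. 3.9–3.10] -/
theorem eight_dvd_of_sqrt_mem_ringClassField_of_odd_discr (hK : IsImaginaryQuadratic K)
    (ι : K →+* ℂ) (hD2 : ¬ (2 : ℤ) ∣ NumberField.discr K) {f : ℕ} (hf : f ≠ 0) {c : ℤ}
    (hc : c % 4 = 2) {r : ℂ} (hr : r ^ 2 = (c : ℂ)) (h : r ∈ ringClassField K ι f) : 8 ∣ f := by
  have h4 := four_dvd_of_sqrt_mem_ringClassField_of_odd_discr hK ι hD2 hf (Or.inl hc) hr h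
  by_contra h8
  have hf4 : f = 4 * (f / 4) := (Nat.mul_div_cancel' h4).symm
  have hg2 : ¬ 2 ∣ f / 4 := fun h' => h8 (by omega)
  exact sqrt_not_mem_ringClassField_four_mul_of_odd_discr hK ι hD2 hf4 (by omega) hg2 hc hr h

/-- **`√d ∈ K[f]` for `d ≡ 1 (mod 4)` square-free forces `d ∣ f² d_K`** (the converse of
`sqrt_intCast_mem_ringClassField_of_dvd_sq_mul_discr`): an odd prime `p ∣ d` not dividing
`d_K` must divide `f` (`K[f]/K` is unramified off `f`, the tree's `sqrt_intCast_not_mem_ringClassField`).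
[cite: Voight2007, §3 Prop. 3.8] [cite: Cox2013, §9.A (p. 180)] -/
theorem dvd_sq_mul_discr_of_sqrt_mem_ringClassField (hK : IsImaginaryQuadratic K) (ι : K →+* ℂ)
    {f : ℕ} (hf : f ≠ 0) {d : ℤ} (hd4 : d % 4 = 1) (hd : Squarefree d) {r : ℂ}
    (hr : r ^ 2 = (d : ℂ)) (hrf : r ∈ ringClassField K ι f) :
    d ∣ (f : ℤ) ^ 2 * NumberField.discr K := by
  refine dvd_of_squarefree_of_forall_prime_dvd hd fun p hp hpd => ?_
  have hp2 : p ≠ 2 := by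
    rintro rfl
    have : (2 : ℤ) ∣ d := hpd
    omega
  by_cases hpD : (p : ℤ) ∣ NumberField.discr K
  · exact dvd_mul_of_dvd_right hpD _
  by_cases hpf : p ∣ f
  · exact dvd_mul_of_dvd_left (dvd_pow (Int.natCast_dvd_natCast.mpr hpf) two_ne_zero) _
  exfalso
  have hp2d : ¬ (p : ℤ) ^ 2 ∣ d := fun h2 => by
    have hu : IsUnit (p : ℤ) := hd (p : ℤ) (by rw [← sq]; exact h2)
    rw [Int.isUnit_iff_natAbs_eq, Int.natAbs_natCast] at hu
    exact hp.one_lt.ne' hu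
  exact sqrt_intCast_not_mem_ringClassField hK ι hf hp hpd hp2d hpf hpD r hr hrf

/-- A complex square root of the odd square-free `e` lies in `K[f]` when `e ∣ f² d_K` and `4 ∣ f`
(`e ≡ 1 (mod 4)`: directly; `e ≡ 3 (mod 4)`: `√e = √(−e)·√−1⁻¹` with `√−1 ∈ K[f]`). [cite: Voight2007, §3 Cor. 3.9] -/
private theorem exists_sqrt_mem_of_dvd_of_four_dvd (hK : IsImaginaryQuadratic K) (ι : K →+* ℂ)
    {f : ℕ} (hf : f ≠ 0) (h4 : 4 ∣ f) {e : ℤ} (he : Squarefree e) (he2 : ¬ (2 : ℤ) ∣ e)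
    (heD : e ∣ (f : ℤ) ^ 2 * NumberField.discr K) :
    ∃ ρ : ℂ, ρ ^ 2 = (e : ℂ) ∧ ρ ∈ ringClassField K ι f := by
  have he4 : e % 4 = 1 ∨ e % 4 = 3 := by omega
  rcases he4 with h1 | h3
  · obtain ⟨ρ, hρ⟩ := IsAlgClosed.exists_pow_nat_eq (e : ℂ) two_pos
    exact ⟨ρ, hρ, sqrt_intCast_mem_ringClassField_of_dvd_sq_mul_discr hK ι h1 he hf heD hρ⟩
  · obtain ⟨τ, hτ⟩ := IsAlgClosed.exists_pow_nat_eq ((-e : ℤ) : ℂ) two_pos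
    have hτmem := sqrt_intCast_mem_ringClassField_of_dvd_sq_mul_discr hK ι (d := -e) (by omega)
      (Squarefree.squarefree_of_dvd (neg_dvd.mpr dvd_rfl) he) hf (neg_dvd.mpr heD) hτ
    have hi := sqrt_neg_one_mem_ringClassField_of_four_dvd hK ι hf h4 Complex.I_sq
    refine ⟨τ * Complex.I, ?_, mul_mem hτmem hi⟩
    rw [mul_pow, hτ, Complex.I_sq]; push_cast; ring

/-- Conversely, a square root in `K[f]` of the odd square-free `e` with `4 ∣ f` gives `e ∣ f² d_K`. [cite: Voight2007, §3 Prop. 3.8] -/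
private theorem dvd_of_sqrt_mem_of_four_dvd (hK : IsImaginaryQuadratic K) (ι : K →+* ℂ)
    {f : ℕ} (hf : f ≠ 0) (h4 : 4 ∣ f) {e : ℤ} (he : Squarefree e) (he2 : ¬ (2 : ℤ) ∣ e)
    {ρ : ℂ} (hρ : ρ ^ 2 = (e : ℂ)) (hρmem : ρ ∈ ringClassField K ι f) :
    e ∣ (f : ℤ) ^ 2 * NumberField.discr K := by
  have he4 : e % 4 = 1 ∨ e % 4 = 3 := by omega
  rcases he4 with h1 | h3
  · exact dvd_sq_mul_discr_of_sqrt_mem_ringClassField hK ι hf h1 he hρ hρmem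
  · have hi := sqrt_neg_one_mem_ringClassField_of_four_dvd hK ι hf h4 Complex.I_sq
    have hτ : (ρ * Complex.I) ^ 2 = ((-e : ℤ) : ℂ) := by
      rw [mul_pow, hρ, Complex.I_sq]; push_cast; ring
    have := dvd_sq_mul_discr_of_sqrt_mem_ringClassField hK ι hf (d := -e) (by omega)
      (Squarefree.squarefree_of_dvd (neg_dvd.mpr dvd_rfl) he) hτ (mul_mem hρmem hi)
    exact neg_dvd.mp this

namespace Voight2007

/-- **Voight 2007, Prop. 3.8, PROVED for `d_K` odd — every conductor `f` and every fundamental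
discriminant `m`**: `(∃ r ∈ K[f], r² = m) ↔ m n ∣ d_K f²` (`d_K m = n s²`). Odd `m`:
`prop38_sqrt_mem_ringClassField_iff_of_odd`. Even `m = 4e`: both sides say "`4 ∣ f` (resp.
`8 ∣ f` when `e` is even) and the odd part of `m` divides `f² d_K`" — the left side by the
dyadic membership theorems (`√−1 ∈ K[f]` for `4 ∣ f`, `√±2 ∈ K[f]` for `8 ∣ f`), their exactness
(`four_dvd_/eight_dvd_of_sqrt_mem_ringClassField_of_odd_discr`, via the odd degree
`[K[2g] : K[g]]` and the quadratic step `K[4g]/K[2g]`), and the odd genus characters; the right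
side since `s` is odd and `m n ∣ d_K f² ↔ m ∣ f s`. (Cor. 3.9 for `d ≡ 1 (mod 4)`:
`P_(f) = K*(√−1 if 4 ∣ f, √2 if 8 ∣ f)`.) [cite: Voight2007, §3 Prop. 3.8 and Cor. 3.9]
[cite: Cox2013, §7.D Cor. 7.28, §9.A Thm. 9.2] -/
theorem prop38_sqrt_mem_ringClassField_iff_of_odd_discr (K : Type) [Field K] [NumberField K]
    (hK : IsImaginaryQuadratic K) (ι : K →+* ℂ) (hD2 : ¬ (2 : ℤ) ∣ NumberField.discr K) {f : ℕ}
    (hf : f ≠ 0) {m n s : ℤ}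
    (hm : (m % 4 = 1 ∧ Squarefree m ∧ m ≠ 1) ∨
      (4 ∣ m ∧ (m / 4 % 4 = 2 ∨ m / 4 % 4 = 3) ∧ Squarefree (m / 4)))
    (hn : ((n % 4 = 1 ∧ Squarefree n ∧ n ≠ 1) ∨
      (4 ∣ n ∧ (n / 4 % 4 = 2 ∨ n / 4 % 4 = 3) ∧ Squarefree (n / 4))) ∨ n = 1)
    (hdm : NumberField.discr K * m = n * s ^ 2) :
    (∃ r : ringClassField K ι f, r ^ 2 = (m : ringClassField K ι f)) ↔
      m * n ∣ NumberField.discr K * (f : ℤ) ^ 2 := by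
  have hm' := hm
  rcases hm with hmo | ⟨⟨e, he⟩, he4, hsqe⟩
  · exact prop38_sqrt_mem_ringClassField_iff_of_odd K hK ι hf hmo hn hdm
  have hme : m / 4 = e := by rw [he, Int.mul_ediv_cancel_left _ four_ne_zero]
  rw [hme] at he4 hsqe
  have hD0 : NumberField.discr K ≠ 0 := NumberField.discr_ne_zero K
  have hD4 : NumberField.discr K % 4 = 1 := by have := discr_emod_four hK.1; omega
  have he0 : e ≠ 0 := hsqe.ne_zero
  have hm0 : m ≠ 0 := by rw [he]; exact mul_ne_zero four_ne_zero he0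
  have hs0 : s ≠ 0 := by
    rintro rfl
    exact (mul_ne_zero hD0 hm0) (by rw [hdm]; ring)
  have hs2 : ¬ (2 : ℤ) ∣ s := not_two_dvd_of_sq_class_of_odd hD4 hm' hn hdm
  have h2s : IsCoprime (2 : ℤ) s := (Int.prime_two.coprime_iff_not_dvd).mpr hs2
  have h2nat : ((2 : ℕ) : ℂ) ∈ ringClassField K ι f := natCast_mem _ 2
  rw [mul_dvd_mul_sq_iff_dvd_mul hdm hD0 hs0]
  rcases he4 with he2 | he3
  · -- `m = 8 e'` with `e'` odd square-free
    obtain ⟨e', he'⟩ : ∃ e', e = 2 * e' := ⟨e / 2, by omega⟩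
    have he'2 : ¬ (2 : ℤ) ∣ e' := by omega
    have hsqe' : Squarefree e' := Squarefree.squarefree_of_dvd (Dvd.intro_left 2 he'.symm) hsqe
    have he'm : e' ∣ m := ⟨8, by rw [he, he']; ring⟩
    have hm8 : m = 8 * e' := by rw [he, he']; ring
    have hC := odd_dvd_mul_iff_dvd_sq_mul hm' hn hdm hsqe' he'2 he'm (f : ℤ)
    have h8e' : IsCoprime (8 : ℤ) e' := by
      have := ((Int.prime_two.coprime_iff_not_dvd).mpr he'2).pow_left (m := 3)
      norm_num at this
      exact this
    constructor
    · rintro ⟨x, hx⟩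
      have hxC : (x : ℂ) ^ 2 = (m : ℂ) := by simpa using congrArg Subtype.val hx
      have hρ : ((x : ℂ) / 2) ^ 2 = (e : ℂ) := by rw [div_pow, hxC, he]; push_cast; ring
      have hρmem : (x : ℂ) / 2 ∈ ringClassField K ι f := div_mem x.2 (by exact_mod_cast h2nat)
      have h8 := eight_dvd_of_sqrt_mem_ringClassField_of_odd_discr hK ι hD2 hf he2 hρ hρmem
      -- `√2 ∈ K[f]`, so `√e' = √e/√2 ∈ K[f]`
      obtain ⟨w, hw⟩ := IsAlgClosed.exists_pow_nat_eq (2 : ℂ) two_pos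
      have hwmem := sqrt_two_mem_ringClassField_of_eight_dvd hK ι hf h8 hw
      have hw0 : w ≠ 0 := by rintro rfl; norm_num at hw
      have hσ : ((x : ℂ) / 2 / w) ^ 2 = (e' : ℂ) := by
        rw [div_pow, hρ, hw, he']; push_cast; field_simp
      have he'D := dvd_of_sqrt_mem_of_four_dvd hK ι hf (dvd_trans ⟨2, rfl⟩ h8) hsqe' he'2 hσ
        (div_mem hρmem hwmem)
      rw [hm8]
      exact h8e'.mul_dvd (dvd_mul_of_dvd_left (by exact_mod_cast h8) s) (hC.mpr he'D)
    · intro hdvd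
      rw [hm8] at hdvd
      have h8s : IsCoprime (8 : ℤ) s := by
        have := h2s.pow_left (m := 3)
        norm_num at this
        exact this
      have h8f : (8 : ℤ) ∣ (f : ℤ) := h8s.dvd_of_dvd_mul_right ((dvd_mul_right 8 e').trans hdvd)
      have h8 : 8 ∣ f := by exact_mod_cast h8f
      have he'D := hC.mp ((dvd_mul_left e' 8).trans hdvd)
      obtain ⟨ρ, hρ, hρmem⟩ :=
        exists_sqrt_mem_of_dvd_of_four_dvd hK ι hf (dvd_trans ⟨2, rfl⟩ h8) hsqe' he'2 he'D
      obtain ⟨w, hw⟩ := IsAlgClosed.exists_pow_nat_eq (2 : ℂ) two_pos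
      have hwmem := sqrt_two_mem_ringClassField_of_eight_dvd hK ι hf h8 hw
      refine ⟨⟨2 * w * ρ, mul_mem (mul_mem (by exact_mod_cast h2nat) hwmem) hρmem⟩,
        Subtype.ext ?_⟩
      have h : ((2 : ℂ) * w * ρ) ^ 2 = (m : ℂ) := by
        rw [mul_pow, mul_pow, hw, hρ, hm8]; push_cast; ring
      simpa using h
  · -- `m = 4 e` with `e ≡ 3 (mod 4)` odd square-free
    have he2' : ¬ (2 : ℤ) ∣ e := by omega
    have hem : e ∣ m := ⟨4, by rw [he]; ring⟩
    have hC := odd_dvd_mul_iff_dvd_sq_mul hm' hn hdm hsqe he2' hem (f : ℤ)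
    have h4e : IsCoprime (4 : ℤ) e := by
      have := ((Int.prime_two.coprime_iff_not_dvd).mpr he2').pow_left (m := 2)
      norm_num at this
      exact this
    constructor
    · rintro ⟨x, hx⟩
      have hxC : (x : ℂ) ^ 2 = (m : ℂ) := by simpa using congrArg Subtype.val hx
      have hρ : ((x : ℂ) / 2) ^ 2 = (e : ℂ) := by rw [div_pow, hxC, he]; push_cast; ring
      have hρmem : (x : ℂ) / 2 ∈ ringClassField K ι f := div_mem x.2 (by exact_mod_cast h2nat)
      have h4 := four_dvd_of_sqrt_mem_ringClassField_of_odd_discr hK ι hD2 hf (Or.inr he3) hρ hρmem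
      have heD := dvd_of_sqrt_mem_of_four_dvd hK ι hf h4 hsqe he2' hρ hρmem
      rw [he]
      exact h4e.mul_dvd (dvd_mul_of_dvd_left (by exact_mod_cast h4) s) (hC.mpr heD)
    · intro hdvd
      rw [he] at hdvd
      have h4s : IsCoprime (4 : ℤ) s := by
        have := h2s.pow_left (m := 2)
        norm_num at this
        exact this
      have h4f : (4 : ℤ) ∣ (f : ℤ) := h4s.dvd_of_dvd_mul_right ((dvd_mul_right 4 e).trans hdvd)
      have h4 : 4 ∣ f := by exact_mod_cast h4f
      have heD := hC.mp ((dvd_mul_left e 4).trans hdvd)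
      obtain ⟨ρ, hρ, hρmem⟩ := exists_sqrt_mem_of_dvd_of_four_dvd hK ι hf h4 hsqe he2' heD
      refine ⟨⟨2 * ρ, mul_mem (by exact_mod_cast h2nat) hρmem⟩, Subtype.ext ?_⟩
      have h : ((2 : ℂ) * ρ) ^ 2 = (m : ℂ) := by
        rw [mul_pow, hρ, he]; push_cast; ring
      simpa using h

end Voight2007


/-! ### A `P`-adic toolkit: a prime `P` of a Dedekind domain and an element `π ∈ P ∖ P²` -/

/-- `a ∈ P^i`, `b ∈ P^j` ⟹ `a b ∈ P^(i+j)`. [folklore] -/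
private theorem mul_mem_pow_add {B : Type*} [CommRing B] {P : Ideal B} {a b : B} {i j : ℕ}
    (ha : a ∈ P ^ i) (hb : b ∈ P ^ j) : a * b ∈ P ^ (i + j) := by
  rw [pow_add]; exact Ideal.mul_mem_mul ha hb

/-- For `π ∈ P ∖ P²` (`P` a nonzero prime of a Dedekind domain): `P = (π) + P²`, so every
`x ∈ P` is `≡ u π (mod P²)`. [folklore] -/
private theorem exists_sub_mul_mem_sq {B : Type*} [CommRing B] [IsDedekindDomain B] {P : Ideal B}
    [P.IsPrime] (hP : P ≠ ⊥) {π : B} (hπ : π ∈ P) (hπ2 : π ∉ P ^ 2) {x : B} (hx : x ∈ P) :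
    ∃ u : B, x - u * π ∈ P ^ 2 := by
  have hle : Ideal.span {π} ⊔ P ^ 2 ≤ P ^ 1 := by
    rw [pow_one]
    exact sup_le ((Ideal.span_singleton_le_iff_mem _).mpr hπ) (Ideal.pow_le_self two_ne_zero)
  have hlt : P ^ (1 + 1) < Ideal.span {π} ⊔ P ^ 2 := by
    refine lt_of_le_of_ne le_sup_right fun h => hπ2 ?_
    have : π ∈ Ideal.span {π} ⊔ P ^ 2 := Ideal.mem_sup_left (Ideal.mem_span_singleton_self π)
    rwa [← h] at this
  have hP1 := Ideal.eq_prime_pow_of_succ_lt_of_le hP hlt hle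
  have hx' : x ∈ Ideal.span {π} ⊔ P ^ 2 := by rw [hP1, pow_one]; exact hx
  obtain ⟨y, hy, z, hz, hyz⟩ := Submodule.mem_sup.mp hx'
  obtain ⟨u, rfl⟩ := Ideal.mem_span_singleton'.mp hy
  exact ⟨u, by rw [show x - u * π = z by rw [← hyz]; ring]; exact hz⟩

/-- For `π ∈ P ∖ P²`: `π^j a ∈ P^(j+n)` ⟹ `a ∈ P^n` (`v_P(π) = 1`). [folklore] -/
private theorem mem_pow_of_pow_mul_mem_pow {B : Type*} [CommRing B] [IsDedekindDomain B]
    {P : Ideal B} [P.IsPrime] (hP : P ≠ ⊥) {π : B} (hπ : π ∈ P) (hπ2 : π ∉ P ^ 2) {a : B}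
    {j n : ℕ} (h : π ^ j * a ∈ P ^ (j + n)) : a ∈ P ^ n := by
  classical
  have hprime : Prime P := Ideal.prime_of_isPrime hP inferInstance
  have hπ1 : emultiplicity P (Ideal.span {π}) = 1 := by
    rw [show (1 : ℕ∞) = ((1 : ℕ) : ℕ∞) from rfl, emultiplicity_eq_coe]
    refine ⟨by rw [pow_one, Ideal.dvd_span_singleton]; exact hπ, ?_⟩
    rw [Ideal.dvd_span_singleton]; exact hπ2
  have h1 : P ^ (j + n) ∣ Ideal.span {π} ^ j * Ideal.span {a} := by
    rw [Ideal.span_singleton_pow, Ideal.span_singleton_mul_span_singleton,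
      Ideal.dvd_span_singleton]
    exact h
  have h2 := (pow_dvd_iff_le_emultiplicity).mp h1
  rw [emultiplicity_mul hprime, emultiplicity_pow hprime, hπ1, mul_one] at h2
  have h3 : (n : ℕ∞) ≤ emultiplicity P (Ideal.span {a}) := by
    by_cases htop : emultiplicity P (Ideal.span {a}) = ⊤
    · rw [htop]; exact le_top
    · obtain ⟨k, hk⟩ := ENat.ne_top_iff_exists.mp htop
      rw [← hk] at h2 ⊢
      norm_cast at h2 ⊢
      omega
  rw [← Ideal.dvd_span_singleton]
  exact (pow_dvd_iff_le_emultiplicity).mpr h3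

/-- If `2 ∈ P²` and `1 − u² ∈ P` then `u² − 1 ∈ P²` (`u ≡ ±1`, and `(u ∓ 1)² ± 2(u ∓ 1) = u² − 1`). [folklore] -/
private theorem sq_sub_one_mem_sq {B : Type*} [CommRing B] {P : Ideal B} [P.IsPrime]
    (h2 : (2 : B) ∈ P ^ 2) {u : B} (hu : 1 - u ^ 2 ∈ P) : u ^ 2 - 1 ∈ P ^ 2 := by
  have h : (1 - u) * (1 + u) ∈ P := by rw [show (1 - u) * (1 + u) = 1 - u ^ 2 by ring]; exact hu
  rcases (Ideal.IsPrime.mem_or_mem inferInstance h) with h1 | h1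
  · have hsq : (1 - u) ^ 2 ∈ P ^ 2 := Ideal.pow_mem_pow h1 2
    rw [show u ^ 2 - 1 = (1 - u) ^ 2 - 2 * (1 - u) by ring]
    exact Submodule.sub_mem _ hsq (Ideal.mul_mem_right _ _ h2)
  · have hsq : (1 + u) ^ 2 ∈ P ^ 2 := Ideal.pow_mem_pow h1 2
    rw [show u ^ 2 - 1 = (1 + u) ^ 2 - 2 * (1 + u) by ring]
    exact Submodule.sub_mem _ hsq (Ideal.mul_mem_right _ _ h2)

/-- An odd integer does not lie in a proper ideal containing `2`. [folklore] -/
private theorem intCast_not_mem_of_odd {B : Type*} [CommRing B] {P : Ideal B} (hP : P ≠ ⊤)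
    (h2 : (2 : B) ∈ P) {z : ℤ} (hz : ¬ (2 : ℤ) ∣ z) : (z : B) ∉ P := by
  intro h
  obtain ⟨w, hw⟩ : ∃ w, z = 2 * w + 1 := ⟨z / 2, by omega⟩
  apply hP
  rw [Ideal.eq_top_iff_one]
  have : (1 : B) = (z : B) - 2 * (w : B) := by rw [hw]; push_cast; ring
  rw [this]
  exact Submodule.sub_mem _ h (Ideal.mul_mem_right _ _ h2)

/-- **Unramified primes do not absorb extra powers**: if `P` (a prime of the Dedekind domain `B`)
is unramified over `v = P ∩ A` and `z ∈ v ∖ v²`, then `z ∉ P²` (`v = (z) + v²`, so `z ∈ P²` would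
give `v B ⊆ P²`, i.e. `e(P|v) ≥ 2`). [folklore] -/
private theorem not_mem_sq_of_isUnramifiedAt {A B : Type*} [CommRing A] [IsDedekindDomain A]
    [CommRing B] [IsDedekindDomain B] [Algebra A B] [Algebra.EssFiniteType A B]
    [Module.IsTorsionFree A B] (v : Ideal A) [v.IsPrime] (hv : v ≠ ⊥) (P : Ideal B) [P.IsPrime]
    [P.LiesOver v] [Algebra.IsUnramifiedAt A P] {z : A} (hz : z ∈ v) (hz2 : z ∉ v ^ 2) :
    algebraMap A B z ∉ P ^ 2 := by
  classical
  intro hzP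
  -- `v = (z) + v²`
  have hle : Ideal.span {z} ⊔ v ^ 2 ≤ v ^ 1 := by
    rw [pow_one]
    exact sup_le ((Ideal.span_singleton_le_iff_mem _).mpr hz) (Ideal.pow_le_self two_ne_zero)
  have hlt : v ^ (1 + 1) < Ideal.span {z} ⊔ v ^ 2 := by
    refine lt_of_le_of_ne le_sup_right fun h => hz2 ?_
    have : z ∈ Ideal.span {z} ⊔ v ^ 2 := Ideal.mem_sup_left (Ideal.mem_span_singleton_self z)
    rwa [← h] at this
  have hv1 := Ideal.eq_prime_pow_of_succ_lt_of_le hv hlt hle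
  rw [pow_one] at hv1
  -- hence `v B ≤ P²`
  have hPv : v.map (algebraMap A B) ≤ P := Ideal.map_le_iff_le_comap.mpr (le_of_eq (P.over_def v))
  have hmap : v.map (algebraMap A B) ≤ P ^ 2 := by
    rw [← hv1, Ideal.map_sup, Ideal.map_span, Set.image_singleton, Ideal.map_pow]
    refine sup_le ((Ideal.span_singleton_le_iff_mem _).mpr hzP) ?_
    exact Ideal.pow_right_mono hPv 2
  -- but `e(P|v) = 1`
  have h1 : P.ramificationIdx A = 1 := Ideal.ramificationIdx_eq_one_of_isUnramifiedAt
  have hne : v.map (algebraMap A B) ≠ ⊥ := Ideal.map_ne_bot_of_ne_bot hv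
  have hP0 : P ≠ ⊥ := Ideal.ne_bot_of_liesOver_of_ne_bot hv P
  rw [Ideal.IsDedekindDomain.ramificationIdx_eq_normalizedFactors_count v P hne] at h1
  have h2 := (pow_dvd_iff_le_emultiplicity).mp (Ideal.dvd_iff_le.mpr hmap)
  rw [emultiplicity_eq_count_normalizedFactors
    (Ideal.prime_of_isPrime hP0 inferInstance).irreducible hne, normalize_eq, h1] at h2
  norm_num at h2

/-! ### The ramified dyadic prime of `K` (`4 ∣ d_K`) and the order `ℤ[ω]`, `ω² = d_K/4` -/

/-- For `[K:ℚ] = 2` with `4 ∣ d_K` there is `ω ∈ 𝓞 K` with `ω² = d_K/4` (from an integral basis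
`(1, ω')`, `ω'² = m + tω'`, `d_K = t² + 4m`: `t` is even and `ω = ω' − t/2`). [cite: Cox2013, §5.B (5.13)–(5.14) (the integral basis of a quadratic field)] -/
private theorem exists_sq_eq_discr_div_four (h2 : finrank ℚ K = 2)
    (h4 : (4 : ℤ) ∣ NumberField.discr K) :
    ∃ ω : 𝓞 K, ω ^ 2 = ((NumberField.discr K / 4 : ℤ) : 𝓞 K) := by
  obtain ⟨b, hb⟩ := exists_basis_zero_eq_one h2
  have hω := basis_one_mul_self_eq b hb
  have hdK := discr_eq_sq_add_four_mul b hb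
  set m : ℤ := b.repr (b 1 * b 1) 0 with hm
  set t : ℤ := b.repr (b 1 * b 1) 1 with ht
  have ht2 : (2 : ℤ) ∣ t := by
    by_contra hodd
    have h1 : t ^ 2 % 4 = 1 := Int.sq_mod_four_eq_one_of_odd (Int.odd_iff.mpr (by omega))
    omega
  obtain ⟨t', ht'⟩ := ht2
  have hdiv : NumberField.discr K / 4 = t' ^ 2 + m := by
    rw [hdK, ht', show (2 * t') ^ 2 + 4 * m = 4 * (t' ^ 2 + m) by ring,
      Int.mul_ediv_cancel_left _ four_ne_zero]
  refine ⟨b 1 - (t' : 𝓞 K), ?_⟩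
  rw [hdiv]
  rw [ht'] at hω
  push_cast at hω ⊢
  linear_combination hω

/-- `2 ∉ v⁴` for a proper ideal `v` of `𝓞 K`, `[K:ℚ] = 2`: `N(v)⁴ ∣ N(2𝓞_K) = 4` is impossible. [folklore] -/
private theorem two_not_mem_pow_four (h2 : finrank ℚ K = 2) {v : Ideal (𝓞 K)} (hv : v ≠ ⊤) :
    (2 : 𝓞 K) ∉ v ^ 4 := by
  intro h
  have hdvd : Ideal.absNorm (v ^ 4) ∣ Ideal.absNorm (Ideal.span {(2 : 𝓞 K)}) :=
    Ideal.absNorm_dvd_absNorm_of_le ((Ideal.span_singleton_le_iff_mem _).mpr h)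
  rw [map_pow, Ideal.absNorm_span_singleton] at hdvd
  have hnorm : Algebra.norm ℤ (2 : 𝓞 K) = 4 := by
    have := Algebra.norm_algebraMap (S := 𝓞 K) (2 : ℤ)
    rw [NumberField.RingOfIntegers.rank, h2] at this
    simpa using this
  rw [hnorm] at hdvd
  have h1 : Ideal.absNorm v ≠ 1 := fun h1 => hv (Ideal.absNorm_eq_one_iff.mp h1)
  have h0 : Ideal.absNorm v ≠ 0 := by
    intro h0
    rw [h0] at hdvd
    norm_num at hdvd
  have hge : 2 ≤ Ideal.absNorm v := by omega
  have h16 : 2 ^ 4 ≤ Ideal.absNorm v ^ 4 := Nat.pow_le_pow_left hge 4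
  have h4 : Ideal.absNorm v ^ 4 ≤ 4 := Nat.le_of_dvd (by norm_num) hdvd
  omega

/-- A prime of `K[f]` above `2` is unramified over `K` when `f` is odd (`K[f]/K` is unramified off
`f`, the tree's `isUnramifiedIn_ringClassField`). [cite: Cox2013, §9.A (p. 180)] -/
private theorem isUnramifiedAt_of_two_mem_of_odd (hK : IsImaginaryQuadratic K) (ι : K →+* ℂ)
    {f : ℕ} (hf : f ≠ 0) (hf2 : ¬ 2 ∣ f) [NumberField (ringClassField K ι f)]
    (P : Ideal (𝓞 (ringClassField K ι f))) [P.IsPrime] (h2P : (2 : 𝓞 (ringClassField K ι f)) ∈ P) :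
    Algebra.IsUnramifiedAt (𝓞 K) P := by
  set v : Ideal (𝓞 K) := P.under (𝓞 K) with hvdef
  haveI hPv : P.LiesOver v := ⟨rfl⟩
  haveI hvprime : v.IsPrime := Ideal.IsPrime.under (𝓞 K) P
  have h2v : ((2 : ℕ) : 𝓞 K) ∈ v := by
    change algebraMap (𝓞 K) (𝓞 (ringClassField K ι f)) ((2 : ℕ) : 𝓞 K) ∈ P
    rw [map_natCast]; exact_mod_cast h2P
  have hvbot : v ≠ ⊥ := fun h0 => by
    rw [h0, Ideal.mem_bot] at h2v; exact two_ne_zero (by exact_mod_cast h2v)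
  set v' : HeightOneSpectrum (𝓞 K) := ⟨v, inferInstance, hvbot⟩ with hv'
  have hvf : ¬ Ideal.span {((f : ℕ) : 𝓞 K)} ≤ v'.asIdeal := by
    intro hle
    have hfv : ((f : ℕ) : 𝓞 K) ∈ v := hle (Ideal.mem_span_singleton_self _)
    obtain ⟨a, b, hab⟩ := Nat.isCoprime_iff_coprime.mpr
      ((Nat.Prime.coprime_iff_not_dvd Nat.prime_two).mpr hf2)
    apply hvprime.ne_top
    rw [Ideal.eq_top_iff_one]
    have h1 : (1 : 𝓞 K) = (a : 𝓞 K) * ((2 : ℕ) : 𝓞 K) + (b : 𝓞 K) * ((f : ℕ) : 𝓞 K) := by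
      have := congrArg (fun z : ℤ => (z : 𝓞 K)) hab
      push_cast at this ⊢
      exact this.symm
    rw [h1]
    exact Submodule.add_mem _ (Ideal.mul_mem_left _ _ h2v) (Ideal.mul_mem_left _ _ hfv)
  exact isUnramifiedIn_ringClassField hK ι hf hvf P inferInstance hPv

/-! ### Dyadic non-membership for even `d_K` and odd `f` (local non-squares at the ramified `2`) -/

/-- In `𝓞 L` (`L = K[f]`, `f` odd): a prime `P ∋ 2` together with the data used below. [folklore] -/
private theorem exists_prime_two_mem (L : Type*) [Field L] [NumberField L] :
    ∃ P : Ideal (𝓞 L), P.IsMaximal ∧ (2 : 𝓞 L) ∈ P := by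
  haveI : (Ideal.span {(2 : ℤ)}).IsMaximal :=
    PrincipalIdealRing.isMaximal_of_irreducible Int.prime_two.irreducible
  obtain ⟨P, hPmax, hPover⟩ :=
    Ideal.exists_maximal_ideal_liesOver_of_isIntegral (R := ℤ) (S := 𝓞 L) (Ideal.span {(2 : ℤ)})
  refine ⟨P, hPmax, ?_⟩
  have : algebraMap ℤ (𝓞 L) 2 ∈ P := by
    rw [← Ideal.mem_comap, ← Ideal.under_def, ← hPover.over]
    exact Ideal.mem_span_singleton_self _
  simpa using this

/-- A square root of `c ∈ ℤ` in `K[f]` is an algebraic integer `x` with `x² = c`. [folklore] -/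
private theorem exists_ringOfIntegers_sq_eq {L : Subfield ℂ} [NumberField L] {c : ℤ} {r : ℂ}
    (hr : r ^ 2 = (c : ℂ)) (hrL : r ∈ L) : ∃ x : 𝓞 L, x ^ 2 = (c : 𝓞 L) := by
  set r' : L := ⟨r, hrL⟩ with hr'def
  have hr' : r' ^ 2 = (c : L) := Subtype.ext (by simp [hr'def, hr])
  have hint : IsIntegral ℤ r' := by
    refine ⟨X ^ 2 - C c, by monicity!, ?_⟩
    rw [eval₂_sub, eval₂_X_pow, eval₂_C, hr', eq_intCast, sub_self]
  refine ⟨⟨r', hint⟩, ?_⟩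
  apply NumberField.RingOfIntegers.coe_injective
  simp [hr']

/-- **`√c ∉ K[f]` for `c ≡ 2 (mod 4)`, `f` odd, when `d_K = 4D₀` with `D₀ ≡ 3 (mod 4)`** (Cor. 3.9
for `d ≡ 4 (mod 8)`: `√2, √−2 ∉ P_(f)` unless `4 ∣ f`; here `f` odd). Local argument at a prime
`P ∣ 2` of `K[f]`, unramified over the ramified dyadic prime `𝔭 = (2, 1 + ω)` of `K` (`ω² = D₀`):
`π = 1 + ω` has `v_P(π) = 1`, `π² = 2(ω + 2k)`, and `x² = 2c'` forces, modulo `P²`, first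
`x = uπ`, then `u² ≡ 1`, then `ω ≡ c' ≡ 1`, i.e. `π ≡ 2 ≡ 0 (mod P²)`, a contradiction. (The
local fact: `2c'` is not a square in the unramified closure of `ℚ₂(√D₀)`.)
[cite: Voight2007, §3 Cor. 3.9–3.10] [cite: Cox2013, §9.A (p. 180)] -/
theorem sqrt_not_mem_ringClassField_of_discr_div_four_of_odd (hK : IsImaginaryQuadratic K)
    (ι : K →+* ℂ) (h4 : (4 : ℤ) ∣ NumberField.discr K) (h3 : NumberField.discr K / 4 % 4 = 3)
    {f : ℕ} (hf : f ≠ 0) (hf2 : ¬ 2 ∣ f) {c : ℤ} (hc : c % 4 = 2) {r : ℂ} (hr : r ^ 2 = (c : ℂ)) :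
    r ∉ ringClassField K ι f := by
  intro hrL
  haveI := (finiteDimensional_and_isGalois_ringClassField hK ι hf).1
  haveI : NumberField (ringClassField K ι f) := NumberField.of_module_finite K _
  obtain ⟨x, hx⟩ := exists_ringOfIntegers_sq_eq hr hrL
  -- `ω ∈ 𝓞 K`, `ω² = D₀ = 4k − 1`
  obtain ⟨ω, hω⟩ := exists_sq_eq_discr_div_four hK.1 h4
  obtain ⟨k, hk⟩ : ∃ k : ℤ, NumberField.discr K / 4 = 4 * k - 1 :=
    ⟨(NumberField.discr K / 4 + 1) / 4, by omega⟩
  rw [hk] at hω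
  have hω' : ω ^ 2 = 4 * (k : 𝓞 K) - 1 := by rw [hω]; push_cast; ring
  have hkodd : ¬ (2 : ℤ) ∣ 4 * k - 1 := by omega
  set ωL : 𝓞 (ringClassField K ι f) := algebraMap (𝓞 K) (𝓞 (ringClassField K ι f)) ω with hωLdef
  have hωL2 : ωL ^ 2 = 4 * (k : 𝓞 (ringClassField K ι f)) - 1 := by
    rw [hωLdef, ← map_pow, hω, map_intCast]; push_cast; ring
  have hπ2 : (1 + ωL) ^ 2 = (ωL + 2 * k) * 2 := by linear_combination hωL2
  -- a prime `P ∋ 2` of `𝓞 K[f]`, unramified over `v = P ∩ 𝓞 K`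
  obtain ⟨P, hPmax, h2P⟩ := exists_prime_two_mem (ringClassField K ι f)
  haveI := hPmax.isPrime
  have hPtop : P ≠ ⊤ := hPmax.ne_top
  have hP0 : P ≠ ⊥ := fun h => by
    rw [h, Ideal.mem_bot] at h2P; exact two_ne_zero h2P
  haveI := isUnramifiedAt_of_two_mem_of_odd hK ι hf hf2 P h2P
  haveI hPv : P.LiesOver (P.under (𝓞 K)) := ⟨rfl⟩
  haveI : (P.under (𝓞 K)).IsPrime := Ideal.IsPrime.under (𝓞 K) P
  have hvtop : P.under (𝓞 K) ≠ ⊤ := Ideal.IsPrime.ne_top inferInstance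
  have h2v : (2 : 𝓞 K) ∈ P.under (𝓞 K) := by
    rw [Ideal.under_def, Ideal.mem_comap, map_ofNat]; exact h2P
  have hvbot : P.under (𝓞 K) ≠ ⊥ := fun h0 => by
    rw [h0, Ideal.mem_bot] at h2v; exact two_ne_zero h2v
  -- units and non-units at `P`
  have hωLP : ωL ∉ P := fun h =>
    intCast_not_mem_of_odd hPtop h2P hkodd (by
      have := Ideal.pow_mem_of_mem P h 2 two_pos
      rw [hωL2] at this; push_cast; exact this)
  have hπP : 1 + ωL ∈ P :=
    Ideal.IsPrime.mem_of_pow_mem inferInstance 2 (by rw [hπ2]; exact Ideal.mul_mem_left _ _ h2P)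
  have huP : ωL + 2 * k ∉ P := fun h =>
    hωLP (by simpa using Submodule.sub_mem _ h (Ideal.mul_mem_right (k : 𝓞 _) _ h2P))
  have h2P2 : (2 : 𝓞 (ringClassField K ι f)) ∈ P ^ 2 :=
    (Ideal.IsPrime.mul_mem_pow P (by rw [← hπ2]; exact Ideal.pow_mem_pow hπP 2)).resolve_left huP
  -- `π = 1 + ω ∉ P²`, from `1 + ω ∈ v ∖ v²` in `K` and unramifiedness
  have hωv : ω ∉ P.under (𝓞 K) := fun h => hωLP (by
    rw [Ideal.under_def, Ideal.mem_comap] at h; exact h)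
  have hπv : 1 + ω ∈ P.under (𝓞 K) := by
    rw [Ideal.under_def, Ideal.mem_comap, map_add, map_one]; exact hπP
  have hπv2 : 1 + ω ∉ (P.under (𝓞 K)) ^ 2 := by
    intro h
    have h4' : (ω + 2 * k) * 2 ∈ (P.under (𝓞 K)) ^ 4 := by
      have := Ideal.pow_mem_pow h 2
      rw [← pow_mul, show (1 + ω) ^ 2 = (ω + 2 * k) * 2 by linear_combination hω'] at this
      exact this
    rcases Ideal.IsPrime.mul_mem_pow _ h4' with h5 | h5
    · exact hωv (by simpa using Submodule.sub_mem _ h5 (Ideal.mul_mem_right (k : 𝓞 K) _ h2v))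
    · exact two_not_mem_pow_four hK.1 hvtop h5
  have hπP2 : 1 + ωL ∉ P ^ 2 := by
    have := not_mem_sq_of_isUnramifiedAt (P.under (𝓞 K)) hvbot P hπv hπv2
    rwa [map_add, map_one] at this
  -- the computation: `x² = 2c'`
  obtain ⟨c', hc'⟩ : ∃ c', c = 2 * c' := ⟨c / 2, by omega⟩
  obtain ⟨j, hj⟩ : ∃ j, c' = 2 * j + 1 := ⟨c' / 2, by omega⟩
  have hx' : x ^ 2 = 2 * (c' : 𝓞 (ringClassField K ι f)) := by rw [hx, hc']; push_cast; ring
  have hxP : x ∈ P :=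
    Ideal.IsPrime.mem_of_pow_mem inferInstance 2 (by rw [hx']; exact Ideal.mul_mem_right _ _ h2P)
  obtain ⟨u, hu⟩ := exists_sub_mul_mem_sq hP0 hπP hπP2 hxP
  have ht4 : x ^ 2 - u ^ 2 * (1 + ωL) ^ 2 ∈ P ^ 4 := by
    have e : x ^ 2 - u ^ 2 * (1 + ωL) ^ 2 =
        (2 * (1 + ωL)) * (u * (x - u * (1 + ωL))) + (x - u * (1 + ωL)) * (x - u * (1 + ωL)) := by
      ring
    rw [e]
    refine Submodule.add_mem _ ?_ ?_
    · have h3 : 2 * (1 + ωL) ∈ P ^ 3 := by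
        have := mul_mem_pow_add h2P2 (show 1 + ωL ∈ P ^ 1 by rw [pow_one]; exact hπP)
        exact this
      exact Ideal.pow_le_pow_right (by norm_num) (mul_mem_pow_add h3 (Ideal.mul_mem_left _ u hu))
    · exact mul_mem_pow_add hu hu
  have hkey : (1 + ωL) ^ 2 * ((c' : 𝓞 (ringClassField K ι f)) - u ^ 2 * (ωL + 2 * k)) ∈
      P ^ (2 + 2) := by
    have e : (1 + ωL) ^ 2 * ((c' : 𝓞 (ringClassField K ι f)) - u ^ 2 * (ωL + 2 * k)) =
        (ωL + 2 * k) * (x ^ 2 - u ^ 2 * (1 + ωL) ^ 2) := by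
      rw [hx']; linear_combination (c' : 𝓞 (ringClassField K ι f)) * hπ2
    rw [e]; exact Ideal.mul_mem_left _ _ ht4
  have h5 := mem_pow_of_pow_mul_mem_pow hP0 hπP hπP2 hkey
  have h6 : (c' : 𝓞 (ringClassField K ι f)) - u ^ 2 * ωL ∈ P ^ 2 := by
    have e : (c' : 𝓞 (ringClassField K ι f)) - u ^ 2 * ωL =
        ((c' : 𝓞 (ringClassField K ι f)) - u ^ 2 * (ωL + 2 * k)) + 2 * (u ^ 2 * k) := by ring
    rw [e]; exact Submodule.add_mem _ h5 (Ideal.mul_mem_right _ _ h2P2)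
  have hP2le : P ^ 2 ≤ P := Ideal.pow_le_self two_ne_zero
  have hc'1 : (c' : 𝓞 (ringClassField K ι f)) - 1 ∈ P ^ 2 := by
    rw [hj]; push_cast
    rw [show (2 : 𝓞 (ringClassField K ι f)) * j + 1 - 1 = 2 * j by ring]
    exact Ideal.mul_mem_right _ _ h2P2
  have hω1 : ωL - 1 ∈ P := by
    rw [show ωL - 1 = (1 + ωL) - 2 by ring]; exact Submodule.sub_mem _ hπP h2P
  have h1u : 1 - u ^ 2 ∈ P := by
    have e : 1 - u ^ 2 = ((c' : 𝓞 (ringClassField K ι f)) - u ^ 2 * ωL) -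
        ((c' : 𝓞 (ringClassField K ι f)) - 1) + u ^ 2 * (ωL - 1) := by ring
    rw [e]
    exact Submodule.add_mem _ (Submodule.sub_mem _ (hP2le h6) (hP2le hc'1))
      (Ideal.mul_mem_left _ _ hω1)
  have hu2 : u ^ 2 - 1 ∈ P ^ 2 := sq_sub_one_mem_sq h2P2 h1u
  have h7 : (c' : 𝓞 (ringClassField K ι f)) - ωL ∈ P ^ 2 := by
    have e : (c' : 𝓞 (ringClassField K ι f)) - ωL =
        ((c' : 𝓞 (ringClassField K ι f)) - u ^ 2 * ωL) + (u ^ 2 - 1) * ωL := by ring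
    rw [e]; exact Submodule.add_mem _ h6 (Ideal.mul_mem_right _ _ hu2)
  refine hπP2 ?_
  rw [show 1 + ωL = 2 - (((c' : 𝓞 (ringClassField K ι f)) - ωL) -
    ((c' : 𝓞 (ringClassField K ι f)) - 1)) by ring]
  exact Submodule.sub_mem _ h2P2 (Submodule.sub_mem _ h7 hc'1)

/-- **`√c ∉ K[f]` for `c ≡ 3 (mod 4)`, `f` odd, when `8 ∣ d_K`** (Cor. 3.9 for `d ≡ 0 (mod 8)`:
`√−1 ∉ P_(f)` unless `2 ∣ f`; with `√2` or `√−2 ∈ P_(f)` this covers all odd `c ≡ 3 (mod 4)`).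
Local argument at a prime `P ∣ 2` of `K[f]`, unramified over the ramified dyadic prime
`𝔭 = (2, ω)` of `K` (`ω² = d_K/4 = 2D₁`, `D₁` odd): `π = ω` has `v_P(π) = 1`, `π² = 2D₁`, and
`y² = c` with `y ≡ 1 (mod P)` forces, modulo `P²`, `y − 1 = uπ`, `u² ≡ 1`, then `y − 1 ≡ 0`, so
`u ∈ P`, contradicting `u² ≡ 1 (mod P)`. (The local fact: a unit `≡ 3 (mod 4)` is not a square in
the unramified closure of `ℚ₂(√2D₁)`.) [cite: Voight2007, §3 Cor. 3.9–3.10] [cite: Cox2013, §9.A (p. 180)] -/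
theorem sqrt_not_mem_ringClassField_of_eight_dvd_discr_of_odd (hK : IsImaginaryQuadratic K)
    (ι : K →+* ℂ) (h4 : (4 : ℤ) ∣ NumberField.discr K) (h2' : NumberField.discr K / 4 % 4 = 2)
    {f : ℕ} (hf : f ≠ 0) (hf2 : ¬ 2 ∣ f) {c : ℤ} (hc : c % 4 = 3) {r : ℂ} (hr : r ^ 2 = (c : ℂ)) :
    r ∉ ringClassField K ι f := by
  intro hrL
  haveI := (finiteDimensional_and_isGalois_ringClassField hK ι hf).1
  haveI : NumberField (ringClassField K ι f) := NumberField.of_module_finite K _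
  obtain ⟨x, hx⟩ := exists_ringOfIntegers_sq_eq hr hrL
  -- `ω ∈ 𝓞 K`, `ω² = d_K/4 = 2D₁`, `D₁` odd
  obtain ⟨ω, hω⟩ := exists_sq_eq_discr_div_four hK.1 h4
  obtain ⟨D₁, hD₁⟩ : ∃ D₁ : ℤ, NumberField.discr K / 4 = 2 * D₁ :=
    ⟨NumberField.discr K / 4 / 2, by omega⟩
  have hD₁odd : ¬ (2 : ℤ) ∣ D₁ := by omega
  rw [hD₁] at hω
  set π : 𝓞 (ringClassField K ι f) := algebraMap (𝓞 K) (𝓞 (ringClassField K ι f)) ω with hπdef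
  have hω' : ω ^ 2 = (D₁ : 𝓞 K) * 2 := by rw [hω]; push_cast; ring
  have hπ2 : π ^ 2 = (D₁ : 𝓞 (ringClassField K ι f)) * 2 := by
    rw [hπdef, ← map_pow, hω, map_intCast]; push_cast; ring
  -- a prime `P ∋ 2` of `𝓞 K[f]`, unramified over `v = P ∩ 𝓞 K`
  obtain ⟨P, hPmax, h2P⟩ := exists_prime_two_mem (ringClassField K ι f)
  haveI := hPmax.isPrime
  have hPtop : P ≠ ⊤ := hPmax.ne_top
  have hP0 : P ≠ ⊥ := fun h => by
    rw [h, Ideal.mem_bot] at h2P; exact two_ne_zero h2P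
  haveI := isUnramifiedAt_of_two_mem_of_odd hK ι hf hf2 P h2P
  haveI hPv : P.LiesOver (P.under (𝓞 K)) := ⟨rfl⟩
  haveI : (P.under (𝓞 K)).IsPrime := Ideal.IsPrime.under (𝓞 K) P
  have hvtop : P.under (𝓞 K) ≠ ⊤ := Ideal.IsPrime.ne_top inferInstance
  have h2v : (2 : 𝓞 K) ∈ P.under (𝓞 K) := by
    rw [Ideal.under_def, Ideal.mem_comap, map_ofNat]; exact h2P
  have hvbot : P.under (𝓞 K) ≠ ⊥ := fun h0 => by
    rw [h0, Ideal.mem_bot] at h2v; exact two_ne_zero h2v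
  -- units and non-units at `P`
  have hD₁P : (D₁ : 𝓞 (ringClassField K ι f)) ∉ P := intCast_not_mem_of_odd hPtop h2P hD₁odd
  have hπP : π ∈ P :=
    Ideal.IsPrime.mem_of_pow_mem inferInstance 2 (by rw [hπ2]; exact Ideal.mul_mem_left _ _ h2P)
  have h2P2 : (2 : 𝓞 (ringClassField K ι f)) ∈ P ^ 2 :=
    (Ideal.IsPrime.mul_mem_pow P (by rw [← hπ2]; exact Ideal.pow_mem_pow hπP 2)).resolve_left hD₁P
  -- `π ∉ P²`, from `ω ∈ v ∖ v²` in `K` and unramifiedness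
  have hD₁v : (D₁ : 𝓞 K) ∉ P.under (𝓞 K) := intCast_not_mem_of_odd hvtop h2v hD₁odd
  have hωv : ω ∈ P.under (𝓞 K) := by
    rw [Ideal.under_def, Ideal.mem_comap]; exact hπP
  have hωv2 : ω ∉ (P.under (𝓞 K)) ^ 2 := by
    intro h
    have h4' : (D₁ : 𝓞 K) * 2 ∈ (P.under (𝓞 K)) ^ 4 := by
      have := Ideal.pow_mem_pow h 2
      rw [← pow_mul, hω'] at this
      exact this
    rcases Ideal.IsPrime.mul_mem_pow _ h4' with h5 | h5
    · exact hD₁v h5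
    · exact two_not_mem_pow_four hK.1 hvtop h5
  have hπP2 : π ∉ P ^ 2 := not_mem_sq_of_isUnramifiedAt (P.under (𝓞 K)) hvbot P hωv hωv2
  -- `y² = c` with `y ≡ 1 (mod P)`
  obtain ⟨j, hj⟩ : ∃ j, c = 4 * j + 3 := ⟨c / 4, by omega⟩
  obtain ⟨y, hy, hyP⟩ : ∃ y : 𝓞 (ringClassField K ι f),
      y ^ 2 = (c : 𝓞 (ringClassField K ι f)) ∧ y - 1 ∈ P := by
    have hprod : (x - 1) * (x + 1) ∈ P := by
      rw [show (x - 1) * (x + 1) = x ^ 2 - 1 by ring, hx, hj]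
      push_cast
      rw [show (4 : 𝓞 (ringClassField K ι f)) * j + 3 - 1 = 2 * (2 * j + 1) by ring]
      exact Ideal.mul_mem_right _ _ h2P
    rcases Ideal.IsPrime.mem_or_mem inferInstance hprod with h | h
    · exact ⟨x, hx, h⟩
    · exact ⟨-x, by rw [neg_sq, hx], by rw [show -x - 1 = -(x + 1) by ring]; exact P.neg_mem h⟩
  have ht2 : (y - 1) ^ 2 = 4 * j + 2 - 2 * (y - 1) := by
    have : (c : 𝓞 (ringClassField K ι f)) = 4 * j + 3 := by rw [hj]; push_cast; ring
    linear_combination hy + this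
  obtain ⟨u, hu⟩ := exists_sub_mul_mem_sq hP0 hπP hπP2 hyP
  have ht4 : (y - 1) ^ 2 - u ^ 2 * π ^ 2 ∈ P ^ 4 := by
    have e : (y - 1) ^ 2 - u ^ 2 * π ^ 2 =
        (2 * π) * (u * (y - 1 - u * π)) + (y - 1 - u * π) * (y - 1 - u * π) := by ring
    rw [e]
    refine Submodule.add_mem _ ?_ ?_
    · have h3 : 2 * π ∈ P ^ 3 := by
        have := mul_mem_pow_add h2P2 (show π ∈ P ^ 1 by rw [pow_one]; exact hπP)
        exact this
      exact Ideal.pow_le_pow_right (by norm_num) (mul_mem_pow_add h3 (Ideal.mul_mem_left _ u hu))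
    · exact mul_mem_pow_add hu hu
  have hkey : π ^ 2 * ((2 * j + 1 : 𝓞 (ringClassField K ι f)) - (y - 1) - D₁ * u ^ 2) ∈
      P ^ (2 + 2) := by
    have e : π ^ 2 * ((2 * j + 1 : 𝓞 (ringClassField K ι f)) - (y - 1) - D₁ * u ^ 2) =
        (D₁ : 𝓞 (ringClassField K ι f)) * ((y - 1) ^ 2 - u ^ 2 * π ^ 2) := by
      linear_combination ((2 * j + 1 : 𝓞 (ringClassField K ι f)) - (y - 1)) * hπ2 -
        (D₁ : 𝓞 (ringClassField K ι f)) * ht2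
    rw [e]; exact Ideal.mul_mem_left _ _ ht4
  have h5 := mem_pow_of_pow_mul_mem_pow hP0 hπP hπP2 hkey
  have hP2le : P ^ 2 ≤ P := Ideal.pow_le_self two_ne_zero
  have h1u : 1 - u ^ 2 ∈ P := by
    obtain ⟨w, hw⟩ : ∃ w, D₁ = 2 * w + 1 := ⟨D₁ / 2, by omega⟩
    have e : 1 - u ^ 2 = ((2 * j + 1 : 𝓞 (ringClassField K ι f)) - (y - 1) - D₁ * u ^ 2) -
        2 * j + (y - 1) + 2 * (w * u ^ 2) := by rw [hw]; push_cast; ring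
    rw [e]
    refine Submodule.add_mem _ (Submodule.add_mem _ (Submodule.sub_mem _ (hP2le h5)
      (Ideal.mul_mem_right _ _ h2P)) hyP) (Ideal.mul_mem_right _ _ h2P)
  have hu2 : u ^ 2 - 1 ∈ P ^ 2 := sq_sub_one_mem_sq h2P2 h1u
  -- hence `y − 1 ∈ P²`, so `u π ∈ P²`, so `u ∈ P`: contradiction with `1 − u² ∈ P`
  have h6 : y - 1 ∈ P ^ 2 := by
    obtain ⟨w, hw⟩ : ∃ w, (2 * j + 1 : ℤ) - D₁ = 2 * w := ⟨((2 * j + 1) - D₁) / 2, by omega⟩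
    have e : y - 1 = ((2 * j + 1 : ℤ) - D₁ : ℤ) - (D₁ : 𝓞 (ringClassField K ι f)) * (u ^ 2 - 1) -
        ((2 * j + 1 : 𝓞 (ringClassField K ι f)) - (y - 1) - D₁ * u ^ 2) := by push_cast; ring
    rw [e, hw]; push_cast
    exact Submodule.sub_mem _ (Submodule.sub_mem _ (Ideal.mul_mem_right _ _ h2P2)
      (Ideal.mul_mem_left _ _ hu2)) h5
  have huπ : u * π ∈ P ^ 2 := by
    have := Submodule.sub_mem _ h6 hu
    rwa [sub_sub_cancel] at this
  have huP : u ∈ P := (Ideal.IsPrime.mul_mem_pow P huπ).resolve_right hπP2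
  apply hPtop
  rw [Ideal.eq_top_iff_one, show (1 : 𝓞 (ringClassField K ι f)) = (1 - u ^ 2) + u * u by ring]
  exact Submodule.add_mem _ h1u (Ideal.mul_mem_left _ _ huP)


/-! ### `√2 ∉ K[2g]` for `d_K = 4D₀`, `D₀ ≡ 3 (mod 4)`, `g` odd (Bauer with `K[4g] ≠ K[2g]`) -/

/-- `[𝔭_v] = 1` in `I_K(f)/P_{K,ℤ}(f)` when `𝔭_v = (α)` with `α ≡ a (mod f𝓞_K)`, `a ∈ ℤ` prime to
`f`. [cite: Cox2013, §7.C Prop. 7.22] -/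
private theorem primeClass_eq_one_of_span_singleton_eq {f : ℕ} {v : HeightOneSpectrum (𝓞 K)}
    {α : 𝓞 K} (hv : v.asIdeal = Ideal.span {α}) {a : ℤ} (ha : IsCoprime a (f : ℤ))
    (h : α - (a : 𝓞 K) ∈ Ideal.span {(f : 𝓞 K)}) (hvf : ¬ Ideal.span {(f : 𝓞 K)} ≤ v.asIdeal) :
    primeClass f v = 1 := by
  have hcop : v.asIdeal ⊔ Ideal.span {(f : 𝓞 K)} = ⊤ := (sup_span_eq_top_iff_not_le f).mpr hvf
  rw [primeClass_of_sup_eq_top f hcop]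
  have hα0 : α ≠ 0 := by
    intro h0
    apply v.ne_bot
    rw [hv, Ideal.span_singleton_eq_bot]
    exact h0
  have hcop' : Ideal.span {α} ⊔ Ideal.span {(f : 𝓞 K)} = ⊤ := by rw [← hv]; exact hcop
  have key := idealClass_span_eq_one f hα0 ha h hcop'
  convert key using 2

/-- A square root of `c ∈ ℤ` in a number field `L` gives `x ∈ 𝓞 L` with `x² = c`. [folklore] -/
private theorem exists_ringOfIntegers_sq_eq' {L : Type*} [Field L] [NumberField L] {c : ℤ} {ρ : L}
    (hρ : ρ ^ 2 = (c : L)) : ∃ x : 𝓞 L, x ^ 2 = (c : 𝓞 L) := by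
  have hint : IsIntegral ℤ ρ := by
    refine ⟨X ^ 2 - C c, by monicity!, ?_⟩
    rw [eval₂_sub, eval₂_X_pow, eval₂_C, hρ, eq_intCast, sub_self]
  refine ⟨⟨ρ, hint⟩, ?_⟩
  apply NumberField.RingOfIntegers.coe_injective
  simp [hρ]

/-- **A split prime sees squares**: if `v ∈ splitPrimes K E` has prime norm `p` and `x² = c` in
`𝓞 E`, then `c` is a square mod `p` (a prime `Q ∣ v` of `E` of residue degree one has
`𝓞_E/Q ≅ ℤ/p`). [folklore] -/
private theorem isSquare_zmod_of_mem_splitPrimes {E : Type*} [Field E] [NumberField E]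
    [Algebra K E] {v : HeightOneSpectrum (𝓞 K)} (hv : v ∈ splitPrimes K E) {c : ℤ} (x : 𝓞 E)
    (hx : x ^ 2 = (c : 𝓞 E)) {p : ℕ} (hp : p.Prime) (hpv : Ideal.absNorm v.asIdeal = p) :
    IsSquare ((c : ℤ) : ZMod p) := by
  classical
  haveI : v.asIdeal.IsMaximal := Ideal.IsPrime.isMaximal v.isPrime v.ne_bot
  obtain ⟨Q, hQmax, hQover⟩ :=
    Ideal.exists_maximal_ideal_liesOver_of_isIntegral (R := 𝓞 K) (S := 𝓞 E) v.asIdeal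
  haveI := hQmax.isPrime
  haveI := hQover
  have hf1 : Q.inertiaDeg (𝓞 K) = 1 := hv.2 Q ⟨hQmax.isPrime, hQover⟩
  have hnormQ : Ideal.absNorm Q = p := by
    have h := Ideal.absNorm_pow_inertiaDeg v.asIdeal Q
    rw [hf1, pow_one, hpv] at h
    exact h.symm
  have hQ0 : Q ≠ ⊥ := by
    intro h
    rw [h, Ideal.absNorm_bot] at hnormQ
    exact hp.ne_zero hnormQ.symm
  haveI : Finite (𝓞 E ⧸ Q) := Ideal.finiteQuotientOfFreeOfNeBot Q hQ0
  letI : Fintype (𝓞 E ⧸ Q) := Fintype.ofFinite _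
  have hcard : Fintype.card (𝓞 E ⧸ Q) = p := by
    rw [← Nat.card_eq_fintype_card, ← Submodule.cardQuot_apply, ← Ideal.absNorm_apply, hnormQ]
  let e := ZMod.ringEquivOfPrime (𝓞 E ⧸ Q) hp hcard
  refine ⟨e.symm (Ideal.Quotient.mk Q x), e.injective ?_⟩
  rw [map_mul, RingEquiv.apply_symm_apply, ← map_mul, ← sq, hx, map_intCast, map_intCast]

/-- The norm form `x² + txy − my²` of an imaginary quadratic field (`t² + 4m = d_K < 0`) is
non-negative. [cite: Cox2013, §2.A (positive definite forms)] -/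
private theorem norm_form_nonneg {t m : ℤ} (hneg : t ^ 2 + 4 * m < 0) (x y : ℤ) :
    0 ≤ x ^ 2 + t * x * y - m * y ^ 2 := by
  nlinarith [sq_nonneg (2 * x + t * y), sq_nonneg y]

/-- `x² + 2t′·x·(2y) − m(2y)² ≡ 5 (mod 8)` for `x, y` odd when `t′² + m ≡ 3 (mod 4)`. [folklore] -/
private theorem norm_form_emod_eight {t' m x y : ℤ} (h3 : (t' ^ 2 + m) % 4 = 3)
    (hx : ¬ (2 : ℤ) ∣ x) (hy : ¬ (2 : ℤ) ∣ y) :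
    ∃ W : ℤ, x ^ 2 + (2 * t') * x * (2 * y) - m * (2 * y) ^ 2 = 8 * W + 5 := by
  obtain ⟨x₁, hx₁⟩ : ∃ x₁, x = 2 * x₁ + 1 := ⟨x / 2, by omega⟩
  obtain ⟨y₁, hy₁⟩ : ∃ y₁, y = 2 * y₁ + 1 := ⟨y / 2, by omega⟩
  -- `x² = 8w₁ + 1`, `y² = 8w₂ + 1`, `x y = 2z₁ + 1`
  obtain ⟨w₁, hw₁⟩ : ∃ w₁, x₁ * (x₁ + 1) = 2 * w₁ := by
    have := Int.even_mul_succ_self x₁; exact ⟨_, (this.two_dvd).choose_spec⟩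
  obtain ⟨w₂, hw₂⟩ : ∃ w₂, y₁ * (y₁ + 1) = 2 * w₂ := by
    have := Int.even_mul_succ_self y₁; exact ⟨_, (this.two_dvd).choose_spec⟩
  have hX : x ^ 2 = 8 * w₁ + 1 := by rw [hx₁]; linear_combination 4 * hw₁
  have hY : y ^ 2 = 8 * w₂ + 1 := by rw [hy₁]; linear_combination 4 * hw₂
  have hZ : x * y = 2 * (2 * x₁ * y₁ + x₁ + y₁) + 1 := by rw [hx₁, hy₁]; ring
  -- `t′ − m` is odd
  obtain ⟨q, hq⟩ : ∃ q, t' - m = 2 * q + 1 := by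
    rcases Int.even_or_odd t' with ⟨s, hs⟩ | ⟨s, hs⟩
    · have : t' ^ 2 = 4 * s ^ 2 := by rw [hs]; ring
      exact ⟨(t' - m - 1) / 2, by omega⟩
    · have : t' ^ 2 = 4 * (s ^ 2 + s) + 1 := by rw [hs]; ring
      exact ⟨(t' - m - 1) / 2, by omega⟩
  exact ⟨w₁ + t' * (2 * x₁ * y₁ + x₁ + y₁) - 4 * m * w₂ + q, by
    linear_combination hX + 4 * t' * hZ - 4 * m * hY + 4 * hq⟩

/-- **`√2 ∉ K[2g]` for `d_K = 4D₀` with `D₀ ≡ 3 (mod 4)` and `g` odd** (Cor. 3.9 for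
`d ≡ 4 (mod 8)`: `√2 ∈ P_(f)` iff `4 ∣ f`; here `f = 2g`). Bauer's theorem for the class fields
`R_{2g} ≅ K[2g]` and `R_{4g} ≅ K[4g]`: since `[K[4g] : K[2g]] = 2`, `R_{4g} ⊄ R_{2g}`, so there are
(infinitely many) degree-one primes `𝔭 = (a)` of `K`, `a ≡ n₀ (mod 2g)`, that split completely in
`R_{2g}` but not in `R_{4g}`; for these `a = X + Yω'` (integral basis `(1, ω')`) has `Y ≡ 2 (mod 4)`,
so `N𝔭 = N(a) ≡ 5 (mod 8)` and `2` is not a square mod `N𝔭` — whereas `√2 ∈ R_{2g}` would make `2`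
a square modulo every degree-one prime split in `R_{2g}`. [cite: Voight2007, §3 Cor. 3.9–3.10]
[cite: Cox2013, §7.D Cor. 7.28, §9.A Thm. 9.2] [cite: NeukirchANT1999, Ch. VII (13.9)] -/
theorem sqrt_two_not_mem_ringClassField_two_mul_of_discr_div_four (hK : IsImaginaryQuadratic K)
    (ι : K →+* ℂ) (h4 : (4 : ℤ) ∣ NumberField.discr K) (h3 : NumberField.discr K / 4 % 4 = 3)
    {g n : ℕ} (hn : n = 2 * g) (hg : g ≠ 0) (hg2 : ¬ 2 ∣ g) {r : ℂ} (hr : r ^ 2 = 2) :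
    r ∉ ringClassField K ι n := by
  classical
  intro hrn
  have hn0 : n ≠ 0 := by rw [hn]; exact mul_ne_zero two_ne_zero hg
  have h2n0 : 2 * n ≠ 0 := mul_ne_zero two_ne_zero hn0
  -- class-field models of `K[n]` and `K[2n]`
  obtain ⟨R₂, hfd₂, hgal₂, -, hsplit₂, ⟨e₂⟩⟩ := exists_classField_algEquiv_ringClassField hK ι hn0
  obtain ⟨R₄, hfd₄, hgal₄, -, hsplit₄, ⟨e₄⟩⟩ := exists_classField_algEquiv_ringClassField hK ι h2n0
  haveI := hfd₂; haveI := hgal₂; haveI := hfd₄; haveI := hgal₄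
  haveI := (finiteDimensional_and_isGalois_ringClassField hK ι hn0).1
  haveI := (finiteDimensional_and_isGalois_ringClassField hK ι h2n0).1
  haveI : NumberField R₂ := NumberField.of_module_finite K R₂
  -- `√2 ∈ 𝓞 R₂`
  obtain ⟨x, hx⟩ : ∃ x : 𝓞 R₂, x ^ 2 = ((2 : ℤ) : 𝓞 R₂) := by
    set ρ : R₂ := e₂.symm ⟨r, hrn⟩ with hρdef
    have h1 : (⟨r, hrn⟩ : ringClassField K ι n) ^ 2 = 2 := Subtype.ext (by simp [hr]; rfl)
    have hρ : ρ ^ 2 = ((2 : ℤ) : R₂) := by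
      rw [hρdef, ← map_pow, h1, map_ofNat]; norm_num
    exact exists_ringOfIntegers_sq_eq' hρ
  -- degrees: `[R₄ : K] = 2 [R₂ : K]`, so `R₄ ⊄ R₂`
  have hdeg : finrank K R₄ = 2 * finrank K R₂ := by
    rw [e₂.toLinearEquiv.finrank_eq, e₄.toLinearEquiv.finrank_eq,
      finrank_ringClassField_eq_card_ringClassGroup hK ι h2n0,
      finrank_ringClassField_eq_card_ringClassGroup hK ι hn0]
    exact card_ringClassGroup_two_mul_of_even hK hn0 ⟨g, hn⟩
  have hnot : ¬ R₄ ≤ R₂ := by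
    intro hle
    have h := LinearMap.finrank_le_finrank_of_injective
      (f := (IntermediateField.inclusion hle).toLinearMap) (IntermediateField.inclusion hle).injective
    rw [hdeg] at h
    have := Module.finrank_pos (R := K) (M := R₂)
    omega
  -- Bauer: a degree-one prime split in `R₂`, not split in `R₄`, away from `2n`
  have hB := mt (le_of_splitPrimes_subset_of_prime_absNorm_algClosure (E₁ := R₂) (E₂ := R₄)) hnot
  rw [Filter.not_eventually] at hB
  have hNbot : Ideal.span {((2 * n : ℕ) : 𝓞 K)} ≠ ⊥ := by
    rw [Ne, Ideal.span_singleton_eq_bot]; exact_mod_cast h2n0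
  have hev : ∀ᶠ v : HeightOneSpectrum (𝓞 K) in cofinite,
      ¬ Ideal.span {((2 * n : ℕ) : 𝓞 K)} ≤ v.asIdeal := by
    rw [eventually_cofinite]
    simpa using finite_setOf_le_asIdeal hNbot
  obtain ⟨v, hv, hv2n⟩ := (hB.and_eventually hev).exists
  have hprime : (Ideal.absNorm v.asIdeal).Prime := by
    by_contra h; exact hv (fun hp => absurd hp h)
  have hvR₂ : v ∈ splitPrimes K R₂ := by
    by_contra h; exact hv (fun _ h' => absurd h' h)
  have hvR₄ : v ∉ splitPrimes K R₄ := fun h => hv (fun _ _ => h)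
  set p : ℕ := Ideal.absNorm v.asIdeal with hpdef
  have hpv : ((p : ℕ) : 𝓞 K) ∈ v.asIdeal := Ideal.absNorm_mem v.asIdeal
  -- `p ∤ 2n`; `v ∤ n`
  have hpN : ¬ p ∣ 2 * n := by
    rintro ⟨k, hk⟩
    refine hv2n ((Ideal.span_singleton_le_iff_mem _).mpr ?_)
    rw [hk, Nat.cast_mul]
    exact Ideal.mul_mem_right _ _ hpv
  have hp2 : p ≠ 2 := by rintro h; exact hpN (h ▸ dvd_mul_right 2 n)
  have hvn : ¬ Ideal.span {((n : ℕ) : 𝓞 K)} ≤ v.asIdeal := by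
    intro hle
    refine hv2n ((Ideal.span_singleton_le_iff_mem _).mpr ?_)
    rw [Nat.cast_mul]
    exact Ideal.mul_mem_left _ _ (hle (Ideal.mem_span_singleton_self _))
  -- `𝔭_v = (a)`, `a ≡ n₀ (mod n𝓞_K)`; and `[𝔭_v]_{2n} ≠ 1`
  obtain ⟨a, n₀, hn₀, hva, han⟩ := exists_generator_of_primeClass_eq_one n hvn ((hsplit₂ v hvn).mp hvR₂)
  have h4ne : primeClass (2 * n) v ≠ 1 := fun h => hvR₄ ((hsplit₄ v hv2n).mpr h)
  -- integral basis `(1, ω')`, `ω'² = m + tω'`, `d_K = t² + 4m`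
  obtain ⟨b, hb⟩ := exists_basis_zero_eq_one hK.1
  have hω := basis_one_mul_self_eq b hb
  have hdK := discr_eq_sq_add_four_mul b hb
  set mb : ℤ := b.repr (b 1 * b 1) 0 with hmb
  set tb : ℤ := b.repr (b 1 * b 1) 1 with htb
  have hneg : tb ^ 2 + 4 * mb < 0 := hdK ▸ hK.discr_neg
  -- `a = (n₀ + n β₀) + (n β₁) ω'`
  obtain ⟨β, hβ⟩ := Ideal.mem_span_singleton'.mp han
  set β₀ : ℤ := b.repr β 0 with hβ₀
  set β₁ : ℤ := b.repr β 1 with hβ₁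
  have hβeq : β = (β₀ : 𝓞 K) + (β₁ : 𝓞 K) * b 1 := by
    conv_lhs => rw [← b.sum_repr β]
    rw [Fin.sum_univ_two, hb, zsmul_eq_mul, mul_one, zsmul_eq_mul]
  have haeq : a = ((n₀ + n * β₀ : ℤ) : 𝓞 K) + ((n * β₁ : ℤ) : 𝓞 K) * b 1 := by
    have : a = n₀ + β * ((n : ℕ) : 𝓞 K) := by rw [hβ]; ring
    rw [this, hβeq]
    push_cast
    ring
  -- `β₁` is odd: otherwise `a ≡ n₀ + nβ₀ (mod 2n)` and `[𝔭_v]_{2n} = 1`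
  have hn₀odd : ¬ (2 : ℤ) ∣ n₀ := by
    rintro ⟨k, hk⟩
    have h2 : IsCoprime n₀ (2 : ℤ) := by
      have : IsCoprime n₀ ((2 : ℤ) * g) := by rw [hn] at hn₀; exact_mod_cast hn₀
      exact this.of_mul_right_left
    rw [hk] at h2
    have hu := isCoprime_self.mp h2.of_mul_left_left
    norm_num [Int.isUnit_iff] at hu
  have hβ₁odd : ¬ (2 : ℤ) ∣ β₁ := by
    rintro ⟨γ, hγ⟩
    apply h4ne
    refine primeClass_eq_one_of_span_singleton_eq hva (a := n₀ + n * β₀) ?_ ?_ hv2n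
    · have hodd : ¬ (2 : ℤ) ∣ n₀ + n * β₀ := by
        rintro ⟨k, hk⟩
        apply hn₀odd
        exact ⟨k - g * β₀, by rw [hn] at hk; push_cast at hk; linarith⟩
      have h2 : IsCoprime (n₀ + n * β₀) 2 := ((Int.prime_two.coprime_iff_not_dvd).mpr hodd).symm
      have hg' : IsCoprime (n₀ + n * β₀) (n : ℤ) := hn₀.add_mul_left_left β₀
      have := h2.mul_right hg'
      push_cast
      exact this
    · rw [Ideal.mem_span_singleton']
      refine ⟨(γ : 𝓞 K) * b 1, ?_⟩
      rw [haeq, hγ]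
      push_cast
      ring
  -- the norm `p = N(a) = X² + tXY − mY²` with `X` odd and `Y ≡ 2 (mod 4)`
  have hN : Algebra.norm ℤ a =
      (n₀ + n * β₀) ^ 2 + tb * (n₀ + n * β₀) * (n * β₁) - mb * (n * β₁) ^ 2 := by
    rw [haeq, norm_intCast_add_intCast_mul b hb hω]
  have hpN : (p : ℤ) = Algebra.norm ℤ a := by
    have h1 : p = Ideal.absNorm (Ideal.span {a}) := by rw [hpdef, hva]
    rw [h1, Ideal.absNorm_span_singleton,
      Int.natAbs_of_nonneg (by rw [hN]; exact norm_form_nonneg hneg _ _)]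
  have ht2 : (2 : ℤ) ∣ tb := by
    by_contra hodd
    have h1 : tb ^ 2 % 4 = 1 := Int.sq_mod_four_eq_one_of_odd (Int.odd_iff.mpr (by omega))
    have h4' := h4
    rw [hdK] at h4'
    omega
  obtain ⟨t', ht'⟩ := ht2
  have hD₀ : NumberField.discr K / 4 = t' ^ 2 + mb := by
    rw [hdK, ht', show (2 * t') ^ 2 + 4 * mb = 4 * (t' ^ 2 + mb) by ring,
      Int.mul_ediv_cancel_left _ four_ne_zero]
  have h3' : (t' ^ 2 + mb) % 4 = 3 := by rw [← hD₀]; exact h3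
  have hXodd : ¬ (2 : ℤ) ∣ n₀ + n * β₀ := by
    rintro ⟨k, hk⟩
    apply hn₀odd
    exact ⟨k - g * β₀, by rw [hn] at hk; push_cast at hk; linarith⟩
  have hY : (n : ℤ) * β₁ = 2 * ((g : ℤ) * β₁) := by rw [hn]; push_cast; ring
  have hYodd : ¬ (2 : ℤ) ∣ (g : ℤ) * β₁ := by
    intro h
    rcases Int.prime_two.dvd_or_dvd h with h' | h'
    · exact hg2 (by exact_mod_cast h')
    · exact hβ₁odd h'
  obtain ⟨W, hW⟩ := norm_form_emod_eight h3' hXodd hYodd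
  have hp8 : p % 8 = 5 := by
    have : (p : ℤ) % 8 = 5 := by
      rw [hpN, hN, ht', hY, hW]; omega
    omega
  -- but `2` is a square modulo the split prime `𝔭_v`
  haveI : Fact p.Prime := ⟨hprime⟩
  have hsq : IsSquare ((2 : ℤ) : ZMod p) :=
    isSquare_zmod_of_mem_splitPrimes hvR₂ x hx hprime rfl
  have hsq' : IsSquare (2 : ZMod p) := by simpa using hsq
  rcases (ZMod.exists_sq_eq_two_iff hp2).mp hsq' with h | h <;> omega

/-- **`√c ∉ K[2g]` for every square-free `c ≡ 2 (mod 4)`, `d_K = 4D₀`, `D₀ ≡ 3 (mod 4)`, `g` odd**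
(Cor. 3.9 for `d ≡ 4 (mod 8)`: `√±2 ∈ P_(f)` iff `4 ∣ f`, so `√±2m₀ ∉ P_(2g)`): `√2 ∈ K[4g]` and
`√−1 ∈ K[2g]`, so `√c ∈ K[2g]` would put `√(±c/2) ∈ K[4g]`, hence (odd genus characters) in
`K[2g]`, hence `√2 ∈ K[2g]`, excluded by `sqrt_two_not_mem_ringClassField_two_mul_of_discr_div_four`.
[cite: Voight2007, §3 Prop. 3.8 and Cor. 3.9–3.10] -/
theorem sqrt_not_mem_ringClassField_two_mul_of_discr_div_four (hK : IsImaginaryQuadratic K)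
    (ι : K →+* ℂ) (h4 : (4 : ℤ) ∣ NumberField.discr K) (h3 : NumberField.discr K / 4 % 4 = 3)
    {g n : ℕ} (hn : n = 2 * g) (hg : g ≠ 0) (hg2 : ¬ 2 ∣ g) {c : ℤ} (hc : c % 4 = 2)
    (hsq : Squarefree c) {r : ℂ} (hr : r ^ 2 = (c : ℂ)) : r ∉ ringClassField K ι n := by
  intro hrn
  have hn0 : n ≠ 0 := by rw [hn]; exact mul_ne_zero two_ne_zero hg
  have h2n0 : 2 * n ≠ 0 := mul_ne_zero two_ne_zero hn0
  obtain ⟨c', hc'⟩ : ∃ c', c = 2 * c' := ⟨c / 2, by omega⟩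
  have hc'odd : ¬ (2 : ℤ) ∣ c' := by omega
  have hsqc' : Squarefree c' := Squarefree.squarefree_of_dvd (Dvd.intro_left 2 hc'.symm) hsq
  -- `K[n] ⊆ K[2n] ∋ √2`, `√−1 ∈ K[n]`
  have hle : ringClassField K ι n ≤ ringClassField K ι (2 * n) :=
    ringClassField_mono hK ι (dvd_mul_left n 2) h2n0
  obtain ⟨w, hw⟩ := IsAlgClosed.exists_pow_nat_eq (2 : ℂ) two_pos
  have hw2n : w ∈ ringClassField K ι (2 * n) :=
    sqrt_two_mem_ringClassField_of_four_dvd_discr hK ι h4 h2n0 ⟨g, by rw [hn]; ring⟩ (Or.inl hw)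
  have hw0 : w ≠ 0 := by rintro rfl; norm_num at hw
  have hi : Complex.I ∈ ringClassField K ι n :=
    sqrt_neg_one_mem_ringClassField_of_discr_div_four_emod hK ι h4 h3 hn0 Complex.I_sq
  -- `√c' = √c/√2 ∈ K[2n]`; take `c'' = ±c' ≡ 1 (mod 4)`, `√c'' ∈ K[2n]`
  have hσ : (r / w) ^ 2 = (c' : ℂ) := by
    rw [div_pow, hr, hw, hc']; push_cast; field_simp
  have hσmem : r / w ∈ ringClassField K ι (2 * n) := div_mem (hle hrn) hw2n
  obtain ⟨c'', hc''4, hc''sq, hc''dvd, ρ, hρ, hρmem, hρback⟩ : ∃ c'' : ℤ, c'' % 4 = 1 ∧ Squarefree c'' ∧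
      (c'' ∣ c') ∧ ∃ ρ : ℂ, ρ ^ 2 = (c'' : ℂ) ∧ ρ ∈ ringClassField K ι (2 * n) ∧
        (ρ ∈ ringClassField K ι n → r / w ∈ ringClassField K ι n) := by
    have hc'4 : c' % 4 = 1 ∨ c' % 4 = 3 := by omega
    rcases hc'4 with h1 | h3'
    · exact ⟨c', h1, hsqc', dvd_rfl, r / w, hσ, hσmem, id⟩
    · refine ⟨-c', by omega, Squarefree.squarefree_of_dvd (neg_dvd.mpr dvd_rfl) hsqc',
        neg_dvd.mpr dvd_rfl, r / w * Complex.I, ?_, mul_mem hσmem (hle hi), fun h => ?_⟩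
      · rw [mul_pow, hσ, Complex.I_sq]; push_cast; ring
      · have := div_mem h hi
        rwa [mul_div_assoc, div_self Complex.I_ne_zero, mul_one] at this
  -- `c'' ∣ (2n)² d_K`, hence `c'' ∣ n² d_K` (odd), hence `√c'' ∈ K[n]`
  have hdvd2n := dvd_sq_mul_discr_of_sqrt_mem_ringClassField hK ι h2n0 hc''4 hc''sq hρ hρmem
  have hc''odd : ¬ (2 : ℤ) ∣ c'' := fun h => hc'odd (h.trans hc''dvd)
  have hdvdn : c'' ∣ (n : ℤ) ^ 2 * NumberField.discr K := by
    have hcop : IsCoprime c'' ((2 : ℤ) ^ 2) :=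
      ((Int.prime_two.coprime_iff_not_dvd).mpr hc''odd).symm.pow_right
    refine hcop.dvd_of_dvd_mul_left ?_
    have : ((2 * n : ℕ) : ℤ) ^ 2 * NumberField.discr K = 2 ^ 2 * ((n : ℤ) ^ 2 * NumberField.discr K) := by
      push_cast; ring
    rw [← this]; exact hdvd2n
  have hρn : ρ ∈ ringClassField K ι n :=
    sqrt_intCast_mem_ringClassField_of_dvd_sq_mul_discr hK ι hc''4 hc''sq hn0 hdvdn hρ
  -- so `√c' ∈ K[n]` and `√2 = √c/√c' ∈ K[n]`: contradiction
  have hσn : r / w ∈ ringClassField K ι n := hρback hρn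
  have hr0 : r ≠ 0 := by
    rintro rfl
    have : (c : ℂ) = 0 := by rw [← hr]; ring
    exact hsq.ne_zero (by exact_mod_cast this)
  have h2 : (r / (r / w)) ^ 2 = 2 := by
    rw [show r / (r / w) = w by field_simp, hw]
  exact sqrt_two_not_mem_ringClassField_two_mul_of_discr_div_four hK ι h4 h3 hn hg hg2 h2
    (div_mem hrn hσn)



/-! ### The 2-adic bookkeeping of `d_K m = n s²` for even `d_K` -/

/-- `2^x u = 2^y v` with `u, v` odd forces `x = y` and `u = v`. [folklore] -/
private theorem two_pow_mul_odd_inj {x y : ℕ} {u v : ℤ} (hu : ¬ (2 : ℤ) ∣ u) (hv : ¬ (2 : ℤ) ∣ v)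
    (h : 2 ^ x * u = 2 ^ y * v) : x = y ∧ u = v := by
  rcases lt_trichotomy x y with hlt | rfl | hgt
  · exfalso
    obtain ⟨d, rfl⟩ := Nat.exists_eq_add_of_lt hlt
    rw [show x + d + 1 = x + (d + 1) by ring, pow_add, mul_assoc] at h
    have h' := mul_left_cancel₀ (pow_ne_zero x (two_ne_zero : (2 : ℤ) ≠ 0)) h
    exact hu ⟨2 ^ d * v, by rw [h', pow_succ]; ring⟩
  · exact ⟨rfl, mul_left_cancel₀ (pow_ne_zero x (two_ne_zero : (2 : ℤ) ≠ 0)) h⟩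
  · exfalso
    obtain ⟨d, rfl⟩ := Nat.exists_eq_add_of_lt hgt
    rw [show y + d + 1 = y + (d + 1) by ring, pow_add, mul_assoc] at h
    have h' := mul_left_cancel₀ (pow_ne_zero y (two_ne_zero : (2 : ℤ) ≠ 0)) h
    exact hv ⟨2 ^ d * u, by rw [← h', pow_succ]; ring⟩

/-- **The 2-adic shape of `n` and `s` in `n s² = 2^k w`** (`w` odd, `n` a fundamental discriminant
or `1`, `s ≠ 0`): `n = 2^a n₁`, `s = 2^b s₁` with `n₁, s₁` odd, `a + 2b = k`, `n₁ s₁² = w`, and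
`a = 0` with `n₁ ≡ 1 (mod 4)`, or `a = 2` with `n₁ ≡ 3 (mod 4)`, or `a = 3`. [folklore] -/
private theorem two_adic_of_sq_class {n s w : ℤ} {k : ℕ}
    (hn : ((n % 4 = 1 ∧ Squarefree n ∧ n ≠ 1) ∨
      (4 ∣ n ∧ (n / 4 % 4 = 2 ∨ n / 4 % 4 = 3) ∧ Squarefree (n / 4))) ∨ n = 1)
    (hw : ¬ (2 : ℤ) ∣ w) (hs : s ≠ 0) (h : n * s ^ 2 = 2 ^ k * w) :
    ∃ (a b : ℕ) (n₁ s₁ : ℤ), a + 2 * b = k ∧ s = 2 ^ b * s₁ ∧ ¬ (2 : ℤ) ∣ s₁ ∧ n₁ * s₁ ^ 2 = w ∧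
      ((a = 0 ∧ n₁ % 4 = 1) ∨ (a = 2 ∧ n₁ % 4 = 3) ∨ a = 3) := by
  -- `n = 2^a n₁`
  obtain ⟨a, n₁, hna, hn₁odd, hcase⟩ : ∃ (a : ℕ) (n₁ : ℤ), n = 2 ^ a * n₁ ∧ ¬ (2 : ℤ) ∣ n₁ ∧
      ((a = 0 ∧ n₁ % 4 = 1) ∨ (a = 2 ∧ n₁ % 4 = 3) ∨ a = 3) := by
    rcases hn with (⟨h1, -, -⟩ | ⟨⟨q, hq⟩, hq4, -⟩) | rfl
    · exact ⟨0, n, by ring, by omega, Or.inl ⟨rfl, h1⟩⟩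
    · have hq' : n / 4 = q := by rw [hq, Int.mul_ediv_cancel_left _ four_ne_zero]
      rw [hq'] at hq4
      rcases hq4 with h2 | h3
      · refine ⟨3, q / 2, ?_, by omega, Or.inr (Or.inr rfl)⟩
        rw [hq]; omega
      · exact ⟨2, q, by rw [hq]; ring, by omega, Or.inr (Or.inl ⟨rfl, h3⟩)⟩
    · exact ⟨0, 1, by ring, by omega, Or.inl ⟨rfl, by norm_num⟩⟩
  -- `s = 2^b s₁`
  have hfin : FiniteMultiplicity (2 : ℤ) s := Int.finiteMultiplicity_iff.mpr ⟨by norm_num, hs⟩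
  obtain ⟨s₁, hs₁⟩ := pow_multiplicity_dvd (2 : ℤ) s
  set b := multiplicity (2 : ℤ) s with hbdef
  have hs₁odd : ¬ (2 : ℤ) ∣ s₁ := by
    rintro ⟨t, rfl⟩
    refine hfin.not_pow_dvd_of_multiplicity_lt (lt_add_one b) ⟨t, ?_⟩
    rw [hs₁, pow_succ]; ring
  -- compare `2^(a+2b) (n₁ s₁²) = 2^k w`
  have hodd : ¬ (2 : ℤ) ∣ n₁ * s₁ ^ 2 := by
    intro h2
    rcases Int.prime_two.dvd_or_dvd h2 with h' | h'
    · exact hn₁odd h'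
    · exact hs₁odd (Int.prime_two.dvd_of_dvd_pow h')
  have heq : (2 : ℤ) ^ (a + 2 * b) * (n₁ * s₁ ^ 2) = 2 ^ k * w := by
    rw [← h, hna, hs₁]; ring
  obtain ⟨hk, hw'⟩ := two_pow_mul_odd_inj hodd hw heq
  exact ⟨a, b, n₁, s₁, hk, hs₁, hs₁odd, hw', hcase⟩

/-- `(n₁ s₁²) % 4 = n₁ % 4` for `s₁` odd. [folklore] -/
private theorem mul_sq_emod_four_of_odd {n₁ s₁ : ℤ} (hs₁ : ¬ (2 : ℤ) ∣ s₁) :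
    (n₁ * s₁ ^ 2) % 4 = n₁ % 4 := by
  have h1 : s₁ ^ 2 % 4 = 1 := Int.sq_mod_four_eq_one_of_odd (Int.odd_iff.mpr (by omega))
  rw [Int.mul_emod, h1, mul_one, Int.emod_emod_of_dvd _ (by norm_num)]

/-- `n s² = 16 w`, `w ≡ 1 (mod 4)`: `s = 4 s₁` with `s₁` odd. [folklore] -/
private theorem sq_class_sixteen {n s w : ℤ}
    (hn : ((n % 4 = 1 ∧ Squarefree n ∧ n ≠ 1) ∨
      (4 ∣ n ∧ (n / 4 % 4 = 2 ∨ n / 4 % 4 = 3) ∧ Squarefree (n / 4))) ∨ n = 1)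
    (hw : w % 4 = 1) (hs : s ≠ 0) (h : n * s ^ 2 = 16 * w) :
    ∃ s₁ : ℤ, s = 4 * s₁ ∧ ¬ (2 : ℤ) ∣ s₁ := by
  obtain ⟨a, b, n₁, s₁, hk, hs₁, hs₁odd, hw', hcase⟩ :=
    two_adic_of_sq_class (k := 4) (w := w) hn (by omega) hs (by rw [h]; norm_num)
  have hmod := mul_sq_emod_four_of_odd (n₁ := n₁) hs₁odd
  rw [hw'] at hmod
  rcases hcase with ⟨rfl, h1⟩ | ⟨rfl, h3⟩ | rfl
  · have hb : b = 2 := by omega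
    subst hb
    exact ⟨s₁, by rw [hs₁]; norm_num, hs₁odd⟩
  · omega
  · omega

/-- `n s² = 32 w`, `w` odd: `s = 2 s₁` with `s₁` odd. [folklore] -/
private theorem sq_class_thirtytwo {n s w : ℤ}
    (hn : ((n % 4 = 1 ∧ Squarefree n ∧ n ≠ 1) ∨
      (4 ∣ n ∧ (n / 4 % 4 = 2 ∨ n / 4 % 4 = 3) ∧ Squarefree (n / 4))) ∨ n = 1)
    (hw : ¬ (2 : ℤ) ∣ w) (hs : s ≠ 0) (h : n * s ^ 2 = 32 * w) :
    ∃ s₁ : ℤ, s = 2 * s₁ ∧ ¬ (2 : ℤ) ∣ s₁ := by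
  obtain ⟨a, b, n₁, s₁, hk, hs₁, hs₁odd, -, hcase⟩ :=
    two_adic_of_sq_class (k := 5) hn hw hs (by rw [h]; norm_num)
  rcases hcase with ⟨rfl, -⟩ | ⟨rfl, -⟩ | rfl
  · omega
  · omega
  · have hb : b = 1 := by omega
    subst hb
    exact ⟨s₁, by rw [hs₁]; norm_num, hs₁odd⟩

/-- `n s² = 64 w`, `w` odd: `s = 8 s₁` (`s₁` odd) if `w ≡ 1 (mod 4)`, `s = 4 s₁` if `w ≡ 3 (mod 4)`. [folklore] -/
private theorem sq_class_sixtyfour {n s w : ℤ}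
    (hn : ((n % 4 = 1 ∧ Squarefree n ∧ n ≠ 1) ∨
      (4 ∣ n ∧ (n / 4 % 4 = 2 ∨ n / 4 % 4 = 3) ∧ Squarefree (n / 4))) ∨ n = 1)
    (hw : ¬ (2 : ℤ) ∣ w) (hs : s ≠ 0) (h : n * s ^ 2 = 64 * w) :
    ∃ s₁ : ℤ, ¬ (2 : ℤ) ∣ s₁ ∧ ((s = 8 * s₁ ∧ w % 4 = 1) ∨ (s = 4 * s₁ ∧ w % 4 = 3)) := by
  obtain ⟨a, b, n₁, s₁, hk, hs₁, hs₁odd, hw', hcase⟩ :=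
    two_adic_of_sq_class (k := 6) hn hw hs (by rw [h]; norm_num)
  have hmod := mul_sq_emod_four_of_odd (n₁ := n₁) hs₁odd
  rw [hw'] at hmod
  rcases hcase with ⟨rfl, h1⟩ | ⟨rfl, h3⟩ | rfl
  · have hb : b = 3 := by omega
    subst hb
    exact ⟨s₁, hs₁odd, Or.inl ⟨by rw [hs₁]; norm_num, by omega⟩⟩
  · have hb : b = 2 := by omega
    subst hb
    exact ⟨s₁, hs₁odd, Or.inr ⟨by rw [hs₁]; norm_num, by omega⟩⟩
  · omega

/-- `m = 2^α e₁`, `s = 2^β s₁` (`e₁, s₁` odd, `β ≤ α`): `m ∣ f s ↔ 2^(α−β) ∣ f ∧ e₁ ∣ f s`. [folklore] -/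
private theorem dvd_mul_iff_two_pow_dvd {m s e₁ s₁ f : ℤ} {α β : ℕ} (he₁ : ¬ (2 : ℤ) ∣ e₁)
    (hs₁ : ¬ (2 : ℤ) ∣ s₁) (hm : m = 2 ^ α * e₁) (hs : s = 2 ^ β * s₁) (hβα : β ≤ α) :
    m ∣ f * s ↔ (2 : ℤ) ^ (α - β) ∣ f ∧ e₁ ∣ f * s := by
  obtain ⟨γ, rfl⟩ := Nat.exists_eq_add_of_le hβα
  rw [Nat.add_sub_cancel_left]
  have h2γs : IsCoprime ((2 : ℤ) ^ γ) s₁ :=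
    ((Int.prime_two.coprime_iff_not_dvd).mpr hs₁).pow_left
  have h2βe : IsCoprime ((2 : ℤ) ^ β) e₁ :=
    ((Int.prime_two.coprime_iff_not_dvd).mpr he₁).pow_left
  have h2γe : IsCoprime ((2 : ℤ) ^ γ) e₁ :=
    ((Int.prime_two.coprime_iff_not_dvd).mpr he₁).pow_left
  have hfs : f * s = 2 ^ β * (f * s₁) := by rw [hs]; ring
  constructor
  · intro h
    refine ⟨?_, (Dvd.intro_left _ hm.symm).trans h⟩
    have h1 : (2 : ℤ) ^ β * 2 ^ γ ∣ 2 ^ β * (f * s₁) := by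
      rw [← pow_add, ← hfs]; exact (Dvd.intro _ hm.symm).trans h
    exact h2γs.dvd_of_dvd_mul_right
      ((mul_dvd_mul_iff_left (pow_ne_zero β (two_ne_zero : (2 : ℤ) ≠ 0))).mp h1)
  · rintro ⟨h2f, he⟩
    have he' : e₁ ∣ f * s₁ := by
      rw [hfs] at he; exact h2βe.symm.dvd_of_dvd_mul_left he
    rw [hm, hfs, pow_add, mul_assoc]
    exact mul_dvd_mul_left _ (h2γe.mul_dvd (dvd_mul_of_dvd_left h2f _) he')

/-! ### Prop. 3.8 for even `d_K` -/

/-- `(∃ r ∈ K[f], r² = 4e) ↔ (∃ ρ ∈ K[f], ρ² = e)`. [folklore] -/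
private theorem exists_sq_eq_four_mul_iff (ι : K →+* ℂ) {f : ℕ} {m e : ℤ} (he : m = 4 * e) :
    (∃ r : ringClassField K ι f, r ^ 2 = (m : ringClassField K ι f)) ↔
      ∃ ρ : ℂ, ρ ^ 2 = (e : ℂ) ∧ ρ ∈ ringClassField K ι f := by
  have h2 : (2 : ℂ) ∈ ringClassField K ι f := by exact_mod_cast natCast_mem (ringClassField K ι f) 2
  constructor
  · rintro ⟨x, hx⟩
    have hxC : (x : ℂ) ^ 2 = (m : ℂ) := by simpa using congrArg Subtype.val hx
    exact ⟨(x : ℂ) / 2, by rw [div_pow, hxC, he]; push_cast; ring, div_mem x.2 h2⟩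
  · rintro ⟨ρ, hρ, hmem⟩
    refine ⟨⟨2 * ρ, mul_mem h2 hmem⟩, Subtype.ext ?_⟩
    have h : ((2 : ℂ) * ρ) ^ 2 = (m : ℂ) := by rw [mul_pow, hρ, he]; push_cast; ring
    simpa using h

/-- With `√−1 ∈ K[f]`: a square root in `K[f]` of the odd square-free `e` exists iff `e ∣ f² d_K`
(for `e ≡ 3 (mod 4)` use `√e = √−1 · √(−e)`). [cite: Voight2007, §3 Prop. 3.8 and Cor. 3.9] -/
private theorem exists_sqrt_mem_iff_dvd_of_I_mem (hK : IsImaginaryQuadratic K) (ι : K →+* ℂ)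
    {f : ℕ} (hf : f ≠ 0) (hi : Complex.I ∈ ringClassField K ι f) {e : ℤ} (he : Squarefree e)
    (he2 : ¬ (2 : ℤ) ∣ e) :
    (∃ ρ : ℂ, ρ ^ 2 = (e : ℂ) ∧ ρ ∈ ringClassField K ι f) ↔ e ∣ (f : ℤ) ^ 2 * NumberField.discr K := by
  have he4 : e % 4 = 1 ∨ e % 4 = 3 := by omega
  have hsqn : Squarefree (-e) := Squarefree.squarefree_of_dvd (neg_dvd.mpr dvd_rfl) he
  constructor
  · rintro ⟨ρ, hρ, hρmem⟩
    rcases he4 with h1 | h3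
    · exact dvd_sq_mul_discr_of_sqrt_mem_ringClassField hK ι hf h1 he hρ hρmem
    · have hτ : (ρ * Complex.I) ^ 2 = ((-e : ℤ) : ℂ) := by
        rw [mul_pow, hρ, Complex.I_sq]; push_cast; ring
      exact neg_dvd.mp (dvd_sq_mul_discr_of_sqrt_mem_ringClassField hK ι hf (d := -e) (by omega)
        hsqn hτ (mul_mem hρmem hi))
  · intro heD
    rcases he4 with h1 | h3
    · obtain ⟨ρ, hρ⟩ := IsAlgClosed.exists_pow_nat_eq (e : ℂ) two_pos
      exact ⟨ρ, hρ, sqrt_intCast_mem_ringClassField_of_dvd_sq_mul_discr hK ι h1 he hf heD hρ⟩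
    · obtain ⟨τ, hτ⟩ := IsAlgClosed.exists_pow_nat_eq ((-e : ℤ) : ℂ) two_pos
      have hτmem := sqrt_intCast_mem_ringClassField_of_dvd_sq_mul_discr hK ι (d := -e) (by omega)
        hsqn hf (neg_dvd.mpr heD) hτ
      refine ⟨τ * Complex.I, ?_, mul_mem hτmem hi⟩
      rw [mul_pow, hτ, Complex.I_sq]; push_cast; ring

namespace Voight2007

/-- **Voight 2007, Prop. 3.8, PROVED for `d_K` even — every conductor `f` and every fundamental
discriminant `m`** (`d_K = 4D₀`, `D₀ ≡ 2, 3 (mod 4)`): `(∃ r ∈ K[f], r² = m) ↔ m n ∣ d_K f²`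
(`d_K m = n s²`). Odd `m`: `prop38_sqrt_mem_ringClassField_iff_of_odd`. Even `m = 4e`: the four
cases `(D₀ mod 4, e mod 4) ∈ {2, 3}²`; in each, the 2-adic shape of `s` (`n s² = 16 D₀ e`) turns
`m ∣ f s` into "`2^j ∣ f` and (odd part of `m`) `∣ f² d_K`", and the left side says the same by the
dyadic membership theorems (`√−1`, `√±2 ∈ K[f]` for `4 ∣ d_K` resp. `8 ∣ d_K` and the right parity
of `f`), their exactness for even `d_K` (`sqrt_not_mem_ringClassField_of_discr_div_four_of_odd`,
`…_two_mul_of_discr_div_four`, `…_of_eight_dvd_discr_of_odd`), and the odd genus characters.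
(Cor. 3.9 for `d ≡ 4 (mod 8)`: `P_(f) = K*(√−1)(√2 if 4 ∣ f)`; for `d ≡ 0 (mod 8)`:
`P_(f) = K*(√2 or √−2)(√−1 if 2 ∣ f)`.) [cite: Voight2007, §3 Prop. 3.8 and Cor. 3.9]
[cite: Cox2013, §7.D Cor. 7.28, §9.A Thm. 9.2] -/
theorem prop38_sqrt_mem_ringClassField_iff_of_even_discr (K : Type) [Field K] [NumberField K]
    (hK : IsImaginaryQuadratic K) (ι : K →+* ℂ) (h4 : (4 : ℤ) ∣ NumberField.discr K) {f : ℕ}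
    (hf : f ≠ 0) {m n s : ℤ}
    (hm : (m % 4 = 1 ∧ Squarefree m ∧ m ≠ 1) ∨
      (4 ∣ m ∧ (m / 4 % 4 = 2 ∨ m / 4 % 4 = 3) ∧ Squarefree (m / 4)))
    (hn : ((n % 4 = 1 ∧ Squarefree n ∧ n ≠ 1) ∨
      (4 ∣ n ∧ (n / 4 % 4 = 2 ∨ n / 4 % 4 = 3) ∧ Squarefree (n / 4))) ∨ n = 1)
    (hdm : NumberField.discr K * m = n * s ^ 2) :
    (∃ r : ringClassField K ι f, r ^ 2 = (m : ringClassField K ι f)) ↔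
      m * n ∣ NumberField.discr K * (f : ℤ) ^ 2 := by
  have hm' := hm
  rcases hm with hmo | ⟨⟨e, he⟩, he4, hsqe⟩
  · exact prop38_sqrt_mem_ringClassField_iff_of_odd K hK ι hf hmo hn hdm
  have hme : m / 4 = e := by rw [he, Int.mul_ediv_cancel_left _ four_ne_zero]
  rw [hme] at he4 hsqe
  -- `d_K = 4D₀`, `D₀ ≡ 2, 3 (mod 4)` square-free
  obtain ⟨D₀, hD₀⟩ := h4
  have hDD₀ : NumberField.discr K / 4 = D₀ := by rw [hD₀, Int.mul_ediv_cancel_left _ four_ne_zero]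
  have hD₀4 : D₀ % 4 = 2 ∨ D₀ % 4 = 3 := by
    rcases isFundamentalDiscriminant_discr hK.1 with ⟨h1, -, -⟩ | ⟨-, h23, -⟩
    · omega
    · rwa [hDD₀] at h23
  have h4' : (4 : ℤ) ∣ NumberField.discr K := ⟨D₀, hD₀⟩
  have hD0 : NumberField.discr K ≠ 0 := NumberField.discr_ne_zero K
  have he0 : e ≠ 0 := hsqe.ne_zero
  have hm0 : m ≠ 0 := by rw [he]; exact mul_ne_zero four_ne_zero he0
  have hs0 : s ≠ 0 := by
    rintro rfl
    exact (mul_ne_zero hD0 hm0) (by rw [hdm]; ring)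
  rw [mul_dvd_mul_sq_iff_dvd_mul hdm hD0 hs0, exists_sq_eq_four_mul_iff ι he]
  have hns : n * s ^ 2 = 16 * (D₀ * e) := by rw [← hdm, hD₀, he]; ring
  -- cast helpers `(2:ℤ)^j ∣ (f:ℤ) ↔ 2^j ∣ f`
  have hcast : ∀ j : ℕ, (2 : ℤ) ^ j ∣ (f : ℤ) ↔ 2 ^ j ∣ f := fun j => by
    rw [show (2 : ℤ) ^ j = ((2 ^ j : ℕ) : ℤ) by push_cast; ring, Int.natCast_dvd_natCast]
  rcases hD₀4 with hD₀2 | hD₀3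
  · -- `D₀ = 2D₁`: `√2 ∈ K[f]` (`D₁ ≡ 1`) or `√−2 ∈ K[f]` (`D₁ ≡ 3`) for all `f`; `√−1 ∈ K[f]` iff `2 ∣ f`
    obtain ⟨D₁, hD₁⟩ : ∃ D₁, D₀ = 2 * D₁ := ⟨D₀ / 2, by omega⟩
    have hD₁odd : ¬ (2 : ℤ) ∣ D₁ := by omega
    have h8 : (8 : ℤ) ∣ NumberField.discr K := ⟨D₁, by rw [hD₀, hD₁]; ring⟩
    have hDD₁ : NumberField.discr K / 8 = D₁ := by
      rw [hD₀, hD₁, show (4 : ℤ) * (2 * D₁) = 8 * D₁ by ring, Int.mul_ediv_cancel_left _ (by norm_num)]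
    have hD2' : NumberField.discr K / 4 % 4 = 2 := by rw [hDD₀]; exact hD₀2
    have hiff2 : ∀ {ρ : ℂ} {c : ℤ}, c % 4 = 3 → ρ ^ 2 = (c : ℂ) → ρ ∈ ringClassField K ι f → 2 ∣ f :=
      fun hc hρ hmem => by
        by_contra h2f
        exact sqrt_not_mem_ringClassField_of_eight_dvd_discr_of_odd hK ι h4' hD2' hf h2f hc hρ hmem
    have hi_of : 2 ∣ f → Complex.I ∈ ringClassField K ι f := fun h2f =>
      sqrt_neg_one_mem_ringClassField_of_eight_dvd_discr hK ι h8 hf h2f Complex.I_sq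
    rcases he4 with he2 | he3
    · -- case D: `e = 2e'`
      obtain ⟨e', he'⟩ : ∃ e', e = 2 * e' := ⟨e / 2, by omega⟩
      have he'odd : ¬ (2 : ℤ) ∣ e' := by omega
      have hsqe' : Squarefree e' := Squarefree.squarefree_of_dvd (Dvd.intro_left 2 he'.symm) hsqe
      have hm8 : m = 2 ^ 3 * e' := by rw [he, he']; ring
      have he'm : e' ∣ m := ⟨8, by rw [hm8]; ring⟩
      have hns' : n * s ^ 2 = 64 * (D₁ * e') := by rw [hns, hD₁, he']; ring
      have hwodd : ¬ (2 : ℤ) ∣ D₁ * e' := fun h2 => by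
        rcases Int.prime_two.dvd_or_dvd h2 with h' | h'
        · exact hD₁odd h'
        · exact he'odd h'
      obtain ⟨s₁, hs₁odd, hshape⟩ := sq_class_sixtyfour hn hwodd hs0 hns'
      have hC := odd_dvd_mul_iff_dvd_sq_mul hm' hn hdm hsqe' he'odd he'm (f : ℤ)
      -- `c₀ = ±e' ≡ D₁ e' (mod 4)` with `√(e/c₀) = √±2 ∈ K[f]`
      obtain ⟨c₀, u, hc₀e, hc₀sq, hc₀odd, hu, humem, hc₀mod⟩ : ∃ c₀ u : ℤ, (c₀ = e' ∨ c₀ = -e') ∧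
          Squarefree c₀ ∧ ¬ (2 : ℤ) ∣ c₀ ∧ u * c₀ = e ∧
          (∀ w : ℂ, w ^ 2 = (u : ℂ) → w ∈ ringClassField K ι f) ∧ c₀ % 4 = (D₁ * e') % 4 := by
        have hD₁4 : D₁ % 4 = 1 ∨ D₁ % 4 = 3 := by omega
        rcases hD₁4 with h1 | h3
        · refine ⟨e', 2, Or.inl rfl, hsqe', he'odd, by rw [he'], fun w hw => ?_, ?_⟩
          · exact sqrt_two_mem_ringClassField_of_discr_eq_eight_mul hK ι h8 (by rw [hDD₁]; exact h1)
              hf (by exact_mod_cast hw)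
          · rw [Int.mul_emod, h1, one_mul, Int.emod_emod_of_dvd _ (by norm_num)]
        · refine ⟨-e', -2, Or.inr rfl, Squarefree.squarefree_of_dvd (neg_dvd.mpr dvd_rfl) hsqe',
            by omega, by rw [he']; ring, fun w hw => ?_, ?_⟩
          · exact sqrt_neg_two_mem_ringClassField_of_discr_eq_eight_mul hK ι h8
              (by rw [hDD₁]; exact h3) hf (by exact_mod_cast hw)
          · rw [Int.mul_emod, h3]; omega
      have hc₀dvd : ∀ z : ℤ, c₀ ∣ z ↔ e' ∣ z := fun z => by
        rcases hc₀e with rfl | rfl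
        · exact Iff.rfl
        · exact neg_dvd
      -- `√e ∈ K[f] ↔ √c₀ ∈ K[f]`
      obtain ⟨w, hw⟩ := IsAlgClosed.exists_pow_nat_eq (u : ℂ) two_pos
      have hwmem := humem w hw
      have hu0 : (u : ℂ) ≠ 0 := by
        have : u ≠ 0 := by rintro rfl; simp at hu; exact he0 hu.symm
        exact_mod_cast this
      have hw0 : w ≠ 0 := by rintro rfl; rw [zero_pow two_ne_zero] at hw; exact hu0 hw.symm
      have hLHS : (∃ ρ : ℂ, ρ ^ 2 = (e : ℂ) ∧ ρ ∈ ringClassField K ι f) ↔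
          ∃ σ : ℂ, σ ^ 2 = (c₀ : ℂ) ∧ σ ∈ ringClassField K ι f := by
        constructor
        · rintro ⟨ρ, hρ, hρmem⟩
          refine ⟨ρ / w, ?_, div_mem hρmem hwmem⟩
          rw [div_pow, hρ, hw, ← hu]; push_cast; field_simp
        · rintro ⟨σ, hσ, hσmem⟩
          refine ⟨σ * w, ?_, mul_mem hσmem hwmem⟩
          rw [mul_pow, hσ, hw, ← hu]; push_cast; ring
      rw [hLHS]
      rcases hshape with ⟨hs8, hw1⟩ | ⟨hs4, hw3⟩
      · -- same signs: `s = 8s₁`, `c₀ ≡ 1 (mod 4)`: no condition on `f`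
        have hc₀1 : c₀ % 4 = 1 := by omega
        rw [dvd_mul_iff_two_pow_dvd he'odd hs₁odd hm8 (show s = 2 ^ 3 * s₁ by rw [hs8]; norm_num)
          le_rfl, Nat.sub_self, pow_zero, hC]
        constructor
        · rintro ⟨σ, hσ, hσmem⟩
          exact ⟨one_dvd _, (hc₀dvd _).mp
            (dvd_sq_mul_discr_of_sqrt_mem_ringClassField hK ι hf hc₀1 hc₀sq hσ hσmem)⟩
        · rintro ⟨-, he'D⟩
          obtain ⟨σ, hσ⟩ := IsAlgClosed.exists_pow_nat_eq (c₀ : ℂ) two_pos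
          exact ⟨σ, hσ, sqrt_intCast_mem_ringClassField_of_dvd_sq_mul_discr hK ι hc₀1 hc₀sq hf
            ((hc₀dvd _).mpr he'D) hσ⟩
      · -- opposite signs: `s = 4s₁`, `c₀ ≡ 3 (mod 4)`: `2 ∣ f`
        have hc₀3 : c₀ % 4 = 3 := by omega
        rw [dvd_mul_iff_two_pow_dvd he'odd hs₁odd hm8 (show s = 2 ^ 2 * s₁ by rw [hs4]; norm_num)
          (by norm_num), show 3 - 2 = 1 from rfl, hcast 1, pow_one, hC]
        constructor
        · rintro ⟨σ, hσ, hσmem⟩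
          have h2f := hiff2 hc₀3 hσ hσmem
          exact ⟨h2f, (hc₀dvd _).mp ((exists_sqrt_mem_iff_dvd_of_I_mem hK ι hf (hi_of h2f) hc₀sq
            hc₀odd).mp ⟨σ, hσ, hσmem⟩)⟩
        · rintro ⟨h2f, he'D⟩
          exact (exists_sqrt_mem_iff_dvd_of_I_mem hK ι hf (hi_of h2f) hc₀sq hc₀odd).mpr
            ((hc₀dvd _).mpr he'D)
    · -- case C: `e ≡ 3 (mod 4)` odd
      have heodd : ¬ (2 : ℤ) ∣ e := by omega
      have hm4 : m = 2 ^ 2 * e := by rw [he]; norm_num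
      have hem : e ∣ m := ⟨4, by rw [he]; ring⟩
      have hns' : n * s ^ 2 = 32 * (D₁ * e) := by rw [hns, hD₁]; ring
      have hwodd : ¬ (2 : ℤ) ∣ D₁ * e := fun h2 => by
        rcases Int.prime_two.dvd_or_dvd h2 with h' | h'
        · exact hD₁odd h'
        · exact heodd h'
      obtain ⟨s₁, hs2, hs₁odd⟩ := sq_class_thirtytwo hn hwodd hs0 hns'
      have hC := odd_dvd_mul_iff_dvd_sq_mul hm' hn hdm hsqe heodd hem (f : ℤ)
      rw [dvd_mul_iff_two_pow_dvd heodd hs₁odd hm4 (show s = 2 ^ 1 * s₁ by rw [hs2]; norm_num)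
        (by norm_num), show 2 - 1 = 1 from rfl, hcast 1, pow_one, hC]
      constructor
      · rintro ⟨ρ, hρ, hρmem⟩
        have h2f := hiff2 he3 hρ hρmem
        exact ⟨h2f, (exists_sqrt_mem_iff_dvd_of_I_mem hK ι hf (hi_of h2f) hsqe heodd).mp
          ⟨ρ, hρ, hρmem⟩⟩
      · rintro ⟨h2f, heD⟩
        exact (exists_sqrt_mem_iff_dvd_of_I_mem hK ι hf (hi_of h2f) hsqe heodd).mpr heD
  · -- `D₀ ≡ 3 (mod 4)`: `√−1 ∈ K[f]` for all `f`; `√±2 ∈ K[f]` iff `4 ∣ f`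
    have hD3' : NumberField.discr K / 4 % 4 = 3 := by rw [hDD₀]; exact hD₀3
    have hi : Complex.I ∈ ringClassField K ι f :=
      sqrt_neg_one_mem_ringClassField_of_discr_div_four_emod hK ι h4' hD3' hf Complex.I_sq
    have hD₀odd : ¬ (2 : ℤ) ∣ D₀ := by omega
    rcases he4 with he2 | he3
    · -- case B: `e = 2e'`
      obtain ⟨e', he'⟩ : ∃ e', e = 2 * e' := ⟨e / 2, by omega⟩
      have he'odd : ¬ (2 : ℤ) ∣ e' := by omega
      have hsqe' : Squarefree e' := Squarefree.squarefree_of_dvd (Dvd.intro_left 2 he'.symm) hsqe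
      have hm8 : m = 2 ^ 3 * e' := by rw [he, he']; ring
      have he'm : e' ∣ m := ⟨8, by rw [hm8]; ring⟩
      have hns' : n * s ^ 2 = 32 * (D₀ * e') := by rw [hns, he']; ring
      have hwodd : ¬ (2 : ℤ) ∣ D₀ * e' := fun h2 => by
        rcases Int.prime_two.dvd_or_dvd h2 with h' | h'
        · exact hD₀odd h'
        · exact he'odd h'
      obtain ⟨s₁, hs2, hs₁odd⟩ := sq_class_thirtytwo hn hwodd hs0 hns'
      have hC := odd_dvd_mul_iff_dvd_sq_mul hm' hn hdm hsqe' he'odd he'm (f : ℤ)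
      rw [dvd_mul_iff_two_pow_dvd he'odd hs₁odd hm8 (show s = 2 ^ 1 * s₁ by rw [hs2]; norm_num)
        (by norm_num), show 3 - 1 = 2 from rfl, hcast 2, hC]
      norm_num only
      constructor
      · rintro ⟨ρ, hρ, hρmem⟩
        -- `4 ∣ f`: `f` odd and `f ≡ 2 (mod 4)` are excluded
        have h4f : 4 ∣ f := by
          by_contra h4f
          by_cases h2f : 2 ∣ f
          · have hf2 : f = 2 * (f / 2) := (Nat.mul_div_cancel' h2f).symm
            exact sqrt_not_mem_ringClassField_two_mul_of_discr_div_four hK ι h4' hD3' hf2 (by omega)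
              (fun h' => h4f (by omega)) he2 hsqe hρ hρmem
          · exact sqrt_not_mem_ringClassField_of_discr_div_four_of_odd hK ι h4' hD3' hf h2f he2 hρ hρmem
        obtain ⟨w, hw⟩ := IsAlgClosed.exists_pow_nat_eq (2 : ℂ) two_pos
        have hwmem := sqrt_two_mem_ringClassField_of_four_dvd_discr hK ι h4' hf h4f (Or.inl hw)
        have hw0 : w ≠ 0 := by rintro rfl; norm_num at hw
        have hσ : (ρ / w) ^ 2 = (e' : ℂ) := by rw [div_pow, hρ, hw, he']; push_cast; field_simp
        exact ⟨h4f, (exists_sqrt_mem_iff_dvd_of_I_mem hK ι hf hi hsqe' he'odd).mp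
          ⟨ρ / w, hσ, div_mem hρmem hwmem⟩⟩
      · rintro ⟨h4f, he'D⟩
        obtain ⟨σ, hσ, hσmem⟩ := (exists_sqrt_mem_iff_dvd_of_I_mem hK ι hf hi hsqe' he'odd).mpr he'D
        obtain ⟨w, hw⟩ := IsAlgClosed.exists_pow_nat_eq (2 : ℂ) two_pos
        have hwmem := sqrt_two_mem_ringClassField_of_four_dvd_discr hK ι h4' hf h4f (Or.inl hw)
        refine ⟨σ * w, ?_, mul_mem hσmem hwmem⟩
        rw [mul_pow, hσ, hw, he']; push_cast; ring
    · -- case A: `e ≡ 3 (mod 4)` odd: `s = 4s₁`, no condition on `f`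
      have heodd : ¬ (2 : ℤ) ∣ e := by omega
      have hm4 : m = 2 ^ 2 * e := by rw [he]; norm_num
      have hem : e ∣ m := ⟨4, by rw [he]; ring⟩
      have hw1 : (D₀ * e) % 4 = 1 := by rw [Int.mul_emod, hD₀3, he3]; norm_num
      obtain ⟨s₁, hs4, hs₁odd⟩ := sq_class_sixteen hn hw1 hs0 hns
      have hC := odd_dvd_mul_iff_dvd_sq_mul hm' hn hdm hsqe heodd hem (f : ℤ)
      rw [dvd_mul_iff_two_pow_dvd heodd hs₁odd hm4 (show s = 2 ^ 2 * s₁ by rw [hs4]; norm_num)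
        le_rfl, Nat.sub_self, pow_zero, hC, exists_sqrt_mem_iff_dvd_of_I_mem hK ι hf hi hsqe heodd]
      exact ⟨fun h => ⟨one_dvd _, h⟩, fun h => h.2⟩

end Voight2007


end Literature.NumberTheory.EllipticCurves

end
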